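import Literature.NumberTheory.LFunctions.GreatestRealZeroElementaryProofs
import Literature.NumberTheory.LFunctions.DeuringPhenomenonElementaryProofs
import HarnessLib

/-!
# Pintz 1976 (III), §§3–5 towards Theorem 2 (`pintz1976Deuring_theorem2`): PROVED tools —
# Part P: Lemma 5, `Σ_{n ≤ y} g(n) n^{−s} = L(s)ζ(s) + O(D^{−ε/2})` on `H(ε, D)`;
# Part Q: Lemma 6's multiplicative skeleton (4.20)–(4.21) and the Euler bounds (4.5), (4.16);
# Part R: Lemma 6's split-prime sums (4.6)–(4.13);
# Part S: Lemma 6 assembled ((4.14)–(4.28)) and §5 — `pintz1976Deuring_theorem2_holds` (DISCHARGED)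

Topic `Literature/NumberTheory/LFunctions` (namespace `Literature.NumberTheory.LFunctions`, helpers in
the statement file's grouping sub-namespace `Pintz1976Deuring`). PROOF LAYER (theorems only; no
definition, no named fact, no new hypothesis) for the statement file `DeuringPhenomenonElementary.lean`
(cell `parity-realchar` — SIEGEL INSTRUMENT, conditionals column, the Deuring direction), ending in
the discharge `theorem pintz1976Deuring_theorem2_holds : pintz1976Deuring_theorem2` of its last live
named fact — J. Pintz, *Elementary
methods in the theory of L-functions, III. The Deuring-phenomenon*, Acta Arith. **31** (1976) 295–306,
Theorem 2 (pp. 296–297, (1.7)–(1.9)): for `0 < ε < 1/8`, `D > D₁(ε)`, `h(−D) ≤ log^{3/4}D`, neither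
`L(s, χ_{−D})` nor `ζ(s)` vanishes on `H(ε, D)` and `L(s) = (ζ(2s)/ζ(s))∏_{p∣D}(1 + p^{−s})
[1 + O(exp(−⅛ log^{1/4}D))]` there. The printed proof: §3 Lemma 4 (PROVED in the tree,
`pintz1976Deuring_lemma4_largeD_holds`, file `DeuringPhenomenonElementaryProofs.lean`) and Lemma 5;
§4 Lemma 6; §5 the two-line assembly. This file lands the tools bottom-up and then the theorem:

* **Part P — Lemma 5 (p. 300, (3.10)–(3.12); proof pp. 300–301), PROVED as
  `Pintz1976Deuring.lemma5`.** PRINT: "Further on set for `s = 1 − τ + it ∈ H(ε, D)` (3.10)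
  `y = y(s) = D^{(1/2 − ε)(1/ϱ)}` (`ϱ = max(τ, D^{−ε/4})`). Then with the notations of Lemma 4, we
  have LEMMA 5. If (1.8) holds, then for `s ∈ H(ε, D)` one has (3.11)
  `Σ_{n≤y} g(n)/n^s = L(s)ζ(s) + O(D^{−ε/2})`. Proof. For `s ∈ H(ε, D)` the inequalities
  `A_s = max(1, 1/|1 − s|) ≤ log⁴D`, `|s|²√A_s D^{1/4} ≤ log²D · D^{(1/2−ε)/ϱ − 3/2 + 1/4} < y` hold, so
  we can apply Lemma 4 with `x = y`. Here (3.12) `y^τ ≤ y^ϱ = D^{1/2−ε}`, further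
  `log y ≤ (1/ϱ) log D ≤ D^{ε/4} log D`. Hence … the error term in Lemma 4 is … `= O(D^{−ε/2})`. On
  the other hand from (1.8) follows by Dirichlet's class number formula `L(1) = O((log D)^{3/4}/√D)`
  and thus we have `|y^{1−s}L(1)/(1 − s)| = O(y^τ A_s L(1)) = O(D^{1/2−ε} log²D log^{3/4}D/√D) =
  O(D^{−ε/2})`. ∎" HERE: literally this, with the tree's Lemma 4 (`∃ C₄ D₄`) at `x = y`
  (`|s|² A_s √D ≤ y log⁴D/D ≤ y` for `D ≥ 4096²`), the factor-by-factor bound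
  `y^τ |s| D^{1/4} √A_s log D log y/√y ≤ ½ D^{−3ε/4} log⁴D` (`|s| ≤ √y D^{−3/4}` is the defining
  inequality of `H(ε, D)`), the class number formula `L(1) = π h_K/√D`
  (`Quadratic.LFunction_one_eq_of_discr_neg_of_eq`, `w_K = 2`) with `h_K ≤ log^{3/4}D ≤ log D`, and
  `log⁵D ≤ D^{ε/4}` for `D ≥ (40/ε)^{40/ε}`; result:
  `‖Σ_{n ≤ y} g(n) n^{−s} − L(s, χ)ζ(s)‖ ≤ (max(C₄, 0)/2 + 4) · D^{−ε/2}` for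
  `D > max(D₄, 4096², ⌈(40/ε)^{40/ε}⌉)`.

* **Part Q — Lemma 6, the multiplicative skeleton (pp. 301–305), PROVED.** PRINT (pp. 301–302, 304–305):
  "(4.2) `g(n) = Σ_{d∣n} χ(d) = ∏_{p^α∥n}(1 + χ(p) + … + χ^α(p)) ≥ 0` … For `j = −1, 0, 1` we define
  (4.3) `A_j = {u ; p ∣ u → χ(p) = j}`. Further let (4.4) `R = {r ; r = bm, b ∈ A₀, m ∈ A_{−1}}`. Then an
  arbitrary natural `n` can be written in the form `n = ar = abm` where `a ∈ A₁, b ∈ A₀, m ∈ A_{−1},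
  r ∈ R`. … (4.5) `Σ_{a∈A₁, 1<a≤y} g(a)/a^σ ≤ ∏_{p≤y, χ(p)=1}(1 + 2/p^σ + 3/p^{2σ} + …) − 1 =
  ∏ (1 − p^{−σ})^{−2} − 1` … (4.15) for `r = bm ∈ R`: `g(r) = g(b)g(m) = g(m) = 1` if `m = l²`, `0` if
  `m ≠ l²` … (4.16) `Σ_{r∈R, r≤y} g(r)/r^σ ≤ Σ_{b∈A₀, μ(b)≠0} b^{−3/4} Σ_l (l²)^{−3/4} = ∏_{p∣D}(1 +
  p^{−3/4})ζ(3/2)` … (4.20) `Σ_{n≤y} g(n)/n^s = Σ_{r∈R, r≤y} g(r)/r^s Σ_{a∈A₁, a≤y/r} g(a)/a^s` …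
  (4.21) `Σ_{r∈R, r≤y} g(r)/r^s = Σ_{b∣D, μ(b)≠0} g(b)/b^s Σ_{r∈R, r²≤y/b} 1/r^{2s}`." HERE: the
  identities (4.20) and (4.21) are EXACT finite identities
  (`Pintz1976Deuring.sum_eq_sum_free_mul_sum_split`, `sum_free_eq_sum_kernel_mul_sum_sq`), proved by
  writing `g(n)n^{−s} = (G ∗ F)(n)` resp. `G = U ∗ V` as Dirichlet products of multiplicative
  indicator-weights (`[n ∈ A₁]g(n)n^{−s}`, `[n ∈ R]g(n)n^{−s}`, `[b squarefree ∈ A₀]g(b)b^{−s}`,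
  `[m = l², l ∈ R]g(m)m^{−s}`), checked on prime powers (Mathlib
  `ArithmeticFunction.IsMultiplicative.eq_iff_eq_on_prime_powers`) and summed by Mathlib's hyperbola
  identity `ArithmeticFunction.sum_Ioc_mul_eq_sum_sum`; (4.2)/(4.15) as
  `charDivisorSum_prime_pow_values`, `charDivisorSum_eq_one_of`. The bounds (4.5) and (4.16) are the
  Euler products over the `(M+1)`-smooth numbers (Mathlib
  `EulerProduct.summable_and_hasSum_smoothNumbers_prod_primesBelow_tsum`, all terms `≥ 0`):
  `sum_split_le_prod` — `Σ_{a≤M, a∈A₁} g(a)a^{−σ} ≤ ∏_{p≤M, χ(p)=1}(1 − p^{−σ})^{−2}` (`σ > 0`) — and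
  `sum_free_le_prod` — `Σ_{r≤N, r∈R} g(r)r^{−σ} ≤ 3∏_{p∣D}(1 − p^{−σ})^{−1}` (`σ ≥ 3/4`; local
  factors `(1 − p^{−σ})^{−1}` at ramified and `(1 − p^{−2σ})^{−1}` at inert primes, the latter product
  `≤ Σ_n n^{−2σ} ≤ 3` by `sum_Ioc_rpow_le_two_div_sqrt`: `Σ_{R<n≤M} n^{−2σ} ≤ 2/√R`, telescoping
  `n^{−3/2} ≤ 2(1/√(n−1) − 1/√n)`).

* **Part R — Lemma 6, the split primes `Σ_{p ≤ y, χ(p)=1} p^{−σ}` ((4.6)–(4.13), pp. 302–303),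
  PROVED.** PRINT (pp. 302–303): "(4.6) `Σ_{p≤y, χ(p)=1} p^{−σ} = Σ_{p≤√D/2} + Σ_{√D/2<p≤D} +
  Σ_{D<p≤y} = Σ₁ + Σ₂ + Σ₃`. Analogously to (3.4) in [7] (4.7) `Σ₁ ≤ h(D/4)^{−σ/(2h)} …`. Further let
  `s₀ = σ₀ = ¾ + ε`; then analogously to (3.5) of [7] we have (4.8)–(4.9)
  `Σ₂² ≤ (Σ_{√D/2<p≤D, χ(p)=1} p^{−σ₀})² ≤ Σ_{D/4<n≤D²} g(n) a(n) n^{−σ₀} ≤ Σ_{D/4<n≤D²} g(n) n^{−σ₀}`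
  where `a(n)` denotes the number of solutions of `n = p₁p₂`, `χ(p₁) = χ(p₂) = 1` (`a(n) ≤ g(n)`). Now
  applying Lemma 4, which for real `s` is Lemma 2 of [6], with the values `x₁ = D/4`, `x₂ = D²`,
  subtracting the two equalities we get (4.10)–(4.11) `Σ₂² ≤ L(1)(D^{2τ₀} − (D/4)^{τ₀})/τ₀ + O(…) =
  O(h D^{−2ε}) + O(D^{−ε} log²D)`. (4.12)–(4.13): with `s₁ = σ₁ = 1 − ϱ`, `x₁ = D`, `x₂ = y`:
  `Σ₃ ≤ ½ Σ_{D<n≤y} g(n) n^{−σ₁} = ½ L(1)(y^ϱ − D^ϱ)/ϱ + O(…) = O(h D^{−ε} D^{ε/4}) + O(D^{−7ε/8}log²D)`."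
  HERE: `sum_rpow_smallSplitPrimes_le` ((4.7): `Σ₁ ≤ h (4/D)^{σ/(2h)}`, from the tree's (3.2)–(3.3)
  `card_le_classNumber_of_splitFactors`, `lt_four_mul_pow_classNumber_sq`); `sq_sum_rpow_le_sum_g_rpow`
  ((4.9), weights `n^{−σ}`, from the tree's `card_filter_mul_eq_le_g`); `sum_Ioc_g_rpow_le_of_lemma4`
  (Lemma 4 at a real point `1 − τ₀`, differenced between `x₁ ≤ x₂`: the `L(s₀)ζ(s₀)` terms cancel,
  `Σ_{x₁<n≤x₂} g(n) n^{−(1−τ₀)} ≤ L(1) x₂^{τ₀}/τ₀ + |C₄|(F(x₁) + F(x₂))`);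
  `sq_sum_rpow_midSplitPrimes_le` ((4.8)–(4.11): `Σ₂² ≤ 8πh D^{−2ε} + 12|C₄| D^{−ε} log²D`, `D ≥ 1024`);
  `sum_rpow_bigSplitPrimes_le` ((4.12)–(4.13): `Σ₃ ≤ ½πh D^{−3ε/4} + (3/2)|C₄| D^{−7ε/8} log²D` for
  `D^{−ε/4} ≤ τ ≤ ¼ − ε`, using `log y/√y ≤ 2 log D/D` for `y ≥ D² ≥ e²`). Throughout `L(1) = πh/√D`
  enters as a hypothesis `hL1` (the class number formula is applied once, in the assembly).

* **Part S — Lemma 6 assembled and §5: `theorem2_aux`, `pintz1976Deuring_theorem2_holds` (pp. 304–306),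
  PROVED.** PRINT (pp. 304–306): "(4.20) `Σ_{n≤y} g(n)/n^s = Σ_{r∈R,r≤y} g(r)/r^s Σ_{a∈A₁,a≤y/r} g(a)/a^s
  = Σ_{r∈R,r≤y} g(r)/r^s [1 + O(exp(−(3/10) log^{1/4}D))]` … (4.21) … (4.22) `Σ_{r∈R, r²≤y/b} r^{−2s} =
  ζ(2s) − Σ_{r>min((D/4)^{1/(2h)}, √(y/b))} r^{−2s} = ζ(2s) + O(Σ_{r>(D/4)^{1/(2h)}} r^{−3/2}) =
  ζ(2s) + O(exp(−¼ log^{1/4}D))` … (4.23) `Σ_{r∈R,r≤y} g(r)/r^s = ζ(2s)∏_{p∣D}(1 + p^{−s}) +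
  O(∏_{p∣D}(1 + p^{−σ}) exp(−¼ log^{1/4}D))` … (4.25) `∏_{p∣D}(1 + p^{−σ})^{−1} = exp(O(Σ_{p∣D}
  p^{−3/4})) = exp(O(Σ_{p<log D} p^{−3/4})) = e^{o(log^{1/4}D)}` … (4.28) `Σ_{n≤y} g(n)/n^s =
  ζ(2s)∏_{p∣D}(1 + p^{−s})[1 + O(exp(−⅛ log^{1/4}D))]`. 5. Now Lemmas 5 and 6 imply for `s ∈ H(ε, D)`
  the equality (5.1) `L(s)ζ(s) = ζ(2s)∏_{p∣D}(1 + p^{−s})[1 + O(exp(−⅛ log^{1/4}D))] + O(D^{−ε/2})` and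
  as for `s = σ + it`, `σ ≥ ¾` the inequality (5.2) `|ζ(2s)∏_{p∣D}(1 + p^{−s})| ≥ (1/ζ(3/2))∏_{p∣D}
  (1 − p^{−3/4}) ≫ exp(−c Σ_{p<log D} p^{−3/4}) ≫ e^{−log^{1/4}D}` holds, (5.1) implies `ζ(s) ≠ 0`,
  and so we can divide (5.1) by `ζ(s)`; thus we get formula (1.9), which implies `L(s) ≠ 0`. ∎"
  HERE (`L := log^{1/4}D`, `Π_D := ∏_{p∣D}(1 − p^{−σ})^{−1}`): `norm_sum_sub_zeta_mul_prod_le` is the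
  chain (4.20)–(4.23) with explicit error `‖Σ_{n≤N} g(n)n^{−s} − ζ(2s)∏_{p∣D}(1 + p^{−s})‖ ≤
  Π_D(3W + 2/√R)` (`W = Σ_{1<a≤N, a∈A₁} g(a)a^{−σ} ≤ e^{5S₁} − 1 ≤ 10 S₁` by (4.5) and
  `prod_inv_one_sub_sq_le_exp`; `R = ⌊(D/4)^{1/(2h)}⌋ ≥ ½e^{L/2−1}`; the kernel sum
  `Σ_b b^{−s} = ∏_{p∣D}(1 + p^{−s})` exactly, `sum_kernel_eq_prod`; the `ζ(2s)`-tail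
  `norm_sum_sq_sub_zeta_le`); `sum_rpow_splitPrimes_le` is (4.6) with Part R's three bounds, giving
  `S₁ = Σ_{p≤N, χ(p)=1} p^{−σ} ≤ 571 e^{−3L/16}`; (4.25) is `sum_primeFactors_le_L`:
  `Σ_{p∣D} p^{−3/4} ≤ L/80`, hence `Π_D ≤ e^{L/32}`; with Lemma 5 (`|C₅|D^{−ε/2} ≤ e^{−20L}`) the error
  `E = L(s)ζ(s) − ζ(2s)∏(1 + p^{−s})` has `3Π_D‖E‖ ≤ 51411 e^{−L/8} < 1`, while
  `‖ζ(2s)∏(1 + p^{−s})‖ ≥ 1/(3Π_D)` (`‖ζ(2s)‖ ≥ 1/3` from the tree's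
  `ZetaClassicalRegion.norm_riemannZeta_ge_of_one_lt_re`, `‖1 + p^{−s}‖ ≥ 1 − p^{−σ}`): so `ζ(s) ≠ 0`,
  `L(s) ≠ 0`, and `‖L(s) − M(s)‖ = ‖E‖/‖ζ(s)‖ ≤ ‖M(s)‖ · 52000 · e^{−L/8}` (`theorem2_aux`, then the
  `K`-pattern plumbing `pintz1976Deuring_theorem2_holds`).

DECLARED DEVIATIONS from print: none of substance in Part P; in Part Q, (4.16) is rendered with
`(1 − p^{−3/4})^{−1}` in place of the printed `1 + p^{−3/4}` (an upper bound of the same shape) and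
`ζ(3/2) ≤ 3` (the printed `log²D` in the second display
of p. 301 is `log⁴D · log^{3/4}D ≤ log⁵D` here; both are absorbed by `D^{−ε/2}`); the threshold
`D₁(ε)` is explicit but crude (the print only claims "effective"). In Part S the printed `o(1)`'s are
made effective in the crudest way: the constant `C = 52000` is absolute and every dependence on `ε`
and on the Lemma 4/5 constants is pushed into the threshold `D₁(ε) = max(D₄, D₅, 1024, ⌈exp(L*⁴)⌉)`,
`L* = max(640·e^{400·640³}, B/ε + 1)`, `B = 40 + 2 log(1 + |C₄|) + 2 log(1 + |C₅|)` (the size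
`640·e^{400·640³}` comes from bounding `Σ_{p∣D} p^{−3/4}` without Chebyshev: primes `≤ P₀` by
`Σ_{n≤P₀} n^{−3/4} ≤ 4P₀^{1/4}`, primes `> P₀` by their number `≤ log D/log P₀`); the split at `√D/2`,
`D` of (4.6) is kept, (4.22)'s `min` is replaced by `R ≤ √(N/b)` (as `N ≥ D²`, `b ≤ D`), and the
exponents `3/10`, `1/4` of (4.20), (4.22) appear as `3/16`, `1/4`. `theorem2_aux` is elaborated under
`set_option maxHeartbeats 2000000` (one long assembly proof).

LABEL (cell rule): instrument provenance (tools for a named hypothesis of the conditionals column);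
nothing here bears on parity; no claim that a field with `h(−D) ≤ log^{3/4}D` exists beyond an
effective bound. No instances, no notation, no axioms beyond the standard three.

## References

* [Pintz1976ElementaryIII] J. Pintz, Acta Arith. 31 (1976) 295–306: Theorem 2 pp. 296–297
  (1.7)–(1.9); (3.10), Lemma 5 (3.11)–(3.12) p. 300, proof pp. 300–301; Lemma 6 §4 pp. 301–305
  ((4.6)–(4.13) pp. 302–303, (4.14)–(4.28) pp. 303–306); §5 (5.1)–(5.2) p. 306 (journal scan `matwbn.icm.edu.pl/ksiazki/aa/aa31/aa31311.pdf`, pp. 300–306 rendered and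
  read by the discharging seat, 2026-08-29).
-/

noncomputable section

open Complex Finset Filter Topology Metric ArithmeticFunction

namespace Literature.NumberTheory.LFunctions

namespace Pintz1976Deuring

open Pintz1976 DirichletAbel RealChar

/-! ## Part P. Lemma 5 (p. 300, (3.10)–(3.12)): `Σ_{n ≤ y} g(n) n^{−s} = L(s)ζ(s) + O(D^{−ε/2})` on
`H(ε, D)`, `y = D^{(1/2 − ε)/ϱ}` -/

section LemmaFive

open Literature.NumberTheory.QuadraticFields

/-- `log⁵x ≤ x^{ε/4}` once `x ≥ (40/ε)^{40/ε}` (`log⁵x ≤ (40/ε)⁵ x^{ε/8}`). [folklore] -/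
private theorem log_pow_five_le_rpow {x ε : ℝ} (hε : 0 < ε) (hε1 : ε ≤ 1) (hx1 : 1 ≤ x)
    (hx : (40 / ε) ^ (40 / ε) ≤ x) : Real.log x ^ 5 ≤ x ^ (ε / 4) := by
  have hx0 : 0 ≤ x := by linarith
  have hlog0 : 0 ≤ Real.log x := Real.log_nonneg hx1
  have h := Real.log_le_rpow_div hx0 (show 0 < ε / 8 / 5 by positivity)
  have h5 : Real.log x ^ 5 ≤ (40 / ε) ^ 5 * x ^ (ε / 8) := by
    have h' : Real.log x ≤ (40 / ε) * x ^ (ε / 8 / 5) := by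
      calc Real.log x ≤ x ^ (ε / 8 / 5) / (ε / 8 / 5) := h
        _ = (40 / ε) * x ^ (ε / 8 / 5) := by field_simp; ring
    calc Real.log x ^ 5 ≤ ((40 / ε) * x ^ (ε / 8 / 5)) ^ 5 := pow_le_pow_left₀ hlog0 h' 5
      _ = (40 / ε) ^ 5 * (x ^ (ε / 8 / 5)) ^ 5 := mul_pow _ _ _
      _ = (40 / ε) ^ 5 * x ^ (ε / 8) := by
          rw [← Real.rpow_natCast (x ^ (ε / 8 / 5)) 5, ← Real.rpow_mul hx0]
          congr 2; push_cast; ring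
  -- `(40/ε)^5 ≤ x^{ε/8}`
  have h40 : 1 ≤ 40 / ε := by
    rw [le_div_iff₀ hε]; linarith
  have hK : ((40 / ε) ^ (40 / ε)) ^ (ε / 8) ≤ x ^ (ε / 8) :=
    Real.rpow_le_rpow (by positivity) hx (by positivity)
  have hK' : ((40 / ε) ^ (40 / ε)) ^ (ε / 8) = (40 / ε) ^ 5 := by
    rw [← Real.rpow_mul (by positivity)]
    rw [show (40 / ε) * (ε / 8) = ((5 : ℕ) : ℝ) by field_simp; ring]
    exact Real.rpow_natCast _ 5
  rw [hK'] at hK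
  have hx8 : 0 ≤ x ^ (ε / 8) := Real.rpow_nonneg hx0 _
  calc Real.log x ^ 5 ≤ (40 / ε) ^ 5 * x ^ (ε / 8) := h5
    _ ≤ x ^ (ε / 8) * x ^ (ε / 8) := mul_le_mul_of_nonneg_right hK hx8
    _ = x ^ (ε / 4) := by rw [← Real.rpow_add' hx0 (by positivity)]; ring_nf

/-- **Lemma 5, explicit.** For `0 < ε < 1/8` there is `D₁(ε)` such that, with the Lemma-4 constant
`C₄` and `C = max(C₄,0)/2 + 4`: for an imaginary quadratic field `K` with `D = |d_K| > D₁`,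
`h_K ≤ log^{3/4}D`, `χ` the odd real primitive character mod `D`, and `s ∈ H(ε, D)`,
`‖Σ_{n ≤ y} g(n) n^{−s} − L(s, χ)ζ(s)‖ ≤ C D^{−ε/2}`, `y = D^{(1/2 − ε)/ϱ}`, `ϱ = max(τ, D^{−ε/4})`.
(Lemma 4 at `x = y`: `A_s ≤ log⁴D`, `|s|²√A_s D^{1/4} ≤ y log⁴D/D ≤ y`, error
`≪ D^{−3ε/4} log⁴D`; and `|y^{1−s}L(1)/(1 − s)| ≤ y^τ A_s L(1) ≤ π log⁵D · D^{−ε}` by the class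
number formula.) [cite: Pintz1976ElementaryIII, Lemma 5 p. 300 (3.10)–(3.12), proof pp. 300–301] -/
theorem lemma5 {ε : ℝ} (hε : 0 < ε) (hε8 : ε < 1 / 8) :
    ∃ C : ℝ, ∃ D₁ : ℕ, ∀ (D : ℕ) [NeZero D] (K : Type) [Field K] [NumberField K],
      Module.finrank ℚ K = 2 → NumberField.discr K < 0 → (NumberField.discr K).natAbs = D →
      D₁ < D → (NumberField.classNumber K : ℝ) ≤ Real.log D ^ (3 / 4 : ℝ) →
      ∀ χ : DirichletCharacter ℂ D, χ.IsQuadratic → χ.IsPrimitive → χ.Odd →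
      ∀ s : ℂ, s ∈ region ε D →
        ‖(∑ n ∈ Icc 1 ⌊(D : ℝ) ^ ((1 / 2 - ε) / max (1 - s.re) ((D : ℝ) ^ (-ε / 4)))⌋₊,
            (∑ d ∈ n.divisors, χ (d : ZMod D)) * (n : ℂ) ^ (-s)) -
          χ.LFunction s * riemannZeta s‖ ≤ C * (D : ℝ) ^ (-ε / 2) := by
  obtain ⟨C₄, D₄, hL4⟩ := pintz1976Deuring_lemma4_largeD_holds
  refine ⟨max C₄ 0 / 2 + 4, max D₄ (max 16777216 ⌈(40 / ε) ^ (40 / ε)⌉₊), ?_⟩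
  intro D _ K _ _ h2 hd hKD hD1 hh χ hquad hprim hodd s hs
  -- thresholds
  have hDD₄ : D₄ < D := lt_of_le_of_lt (le_max_left _ _) hD1
  have hD1' := hD1.le
  have hDbig : 16777216 ≤ D := le_trans (le_trans (le_max_left _ _) (le_max_right _ _)) hD1'
  have hDε : ⌈(40 / ε) ^ (40 / ε)⌉₊ ≤ D :=
    le_trans (le_trans (le_max_right _ _) (le_max_right _ _)) hD1'
  have hD3r : (3 : ℝ) ≤ D := by exact_mod_cast (le_trans (by norm_num) hDbig)
  have hD0r : (0 : ℝ) < D := by linarith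
  have hD1r : (1 : ℝ) ≤ D := by linarith
  have hlog1 : 1 ≤ Real.log D := by
    rw [Real.le_log_iff_exp_le hD0r]
    exact le_trans (le_of_lt (lt_trans Real.exp_one_lt_d9 (by norm_num))) hD3r
  have hlog0 : 0 < Real.log D := by linarith
  have hDεr : (40 / ε) ^ (40 / ε) ≤ (D : ℝ) := le_trans (Nat.le_ceil _) (by exact_mod_cast hDε)
  have hlog5 : Real.log D ^ 5 ≤ (D : ℝ) ^ (ε / 4) :=
    log_pow_five_le_rpow hε (by linarith) hD1r hDεr
  have hlog4D : Real.log D ^ 4 ≤ D := by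
    -- `log⁴D ≤ 8⁴ √D ≤ D` for `D ≥ 4096²`
    have h := Real.log_le_rpow_div hD0r.le (show (0 : ℝ) < 1 / 2 / 4 by norm_num)
    have h4 : Real.log D ^ 4 ≤ 4096 * Real.sqrt D := by
      have h' : Real.log D ≤ 8 * (D : ℝ) ^ ((1 : ℝ) / 2 / 4) := by
        calc Real.log D ≤ (D : ℝ) ^ ((1 : ℝ) / 2 / 4) / (1 / 2 / 4) := h
          _ = 8 * (D : ℝ) ^ ((1 : ℝ) / 2 / 4) := by ring
      calc Real.log D ^ 4 ≤ (8 * (D : ℝ) ^ ((1 : ℝ) / 2 / 4)) ^ 4 := pow_le_pow_left₀ hlog0.le h' 4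
        _ = 4096 * ((D : ℝ) ^ ((1 : ℝ) / 2 / 4)) ^ 4 := by rw [mul_pow]; norm_num
        _ = 4096 * Real.sqrt D := by
            rw [← Real.rpow_natCast ((D : ℝ) ^ ((1 : ℝ) / 2 / 4)) 4, ← Real.rpow_mul hD0r.le,
              Real.sqrt_eq_rpow]; norm_num
    have hsqrt : 4096 ≤ Real.sqrt D := by
      rw [show (4096 : ℝ) = Real.sqrt (4096 ^ 2) by rw [Real.sqrt_sq (by norm_num)]]
      exact Real.sqrt_le_sqrt (by exact_mod_cast hDbig)
    calc Real.log D ^ 4 ≤ 4096 * Real.sqrt D := h4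
      _ ≤ Real.sqrt D * Real.sqrt D := mul_le_mul_of_nonneg_right hsqrt (Real.sqrt_nonneg _)
      _ = D := Real.mul_self_sqrt hD0r.le
  -- the region
  obtain ⟨hfar, hτ0, hτε, hsize⟩ := hs
  set τ := 1 - s.re with hτ_def
  set ϱ := max τ ((D : ℝ) ^ (-ε / 4)) with hϱ_def
  have hDε4 : 0 < (D : ℝ) ^ (-ε / 4) := Real.rpow_pos_of_pos hD0r _
  have hϱ0 : 0 < ϱ := lt_of_lt_of_le hDε4 (le_max_right _ _)
  have hτϱ : τ ≤ ϱ := le_max_left _ _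
  have hϱinv : 1 / ϱ ≤ (D : ℝ) ^ (ε / 4) := by
    rw [div_le_iff₀ hϱ0]
    have : (D : ℝ) ^ (ε / 4) * (D : ℝ) ^ (-ε / 4) = 1 := by
      rw [← Real.rpow_add hD0r, show ε / 4 + -ε / 4 = 0 by ring, Real.rpow_zero]
    calc (1 : ℝ) = (D : ℝ) ^ (ε / 4) * (D : ℝ) ^ (-ε / 4) := this.symm
      _ ≤ (D : ℝ) ^ (ε / 4) * ϱ := mul_le_mul_of_nonneg_left (le_max_right _ _) (by positivity)
  have hs1 : s ≠ 1 := by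
    intro h1
    rw [h1, sub_self, norm_zero] at hfar
    have : 0 < 1 / Real.log D ^ 4 := by positivity
    linarith
  have h1s : 0 < ‖1 - s‖ := norm_pos_iff.mpr (sub_ne_zero.mpr (Ne.symm hs1))
  have hτhalf : τ ≤ 1 / 2 := by linarith
  -- `y`
  set e := (1 / 2 - ε) / ϱ with he_def
  have he0 : 0 ≤ e := by rw [he_def]; exact div_nonneg (by linarith) hϱ0.le
  set y := (D : ℝ) ^ e with hy_def
  have hy0 : 0 < y := Real.rpow_pos_of_pos hD0r _
  have hy1 : 1 ≤ y := Real.one_le_rpow hD1r he0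
  -- `A_s ≤ log⁴D`
  set A := max 1 (1 / ‖1 - s‖) with hA_def
  have hA1 : 1 ≤ A := le_max_left _ _
  have hA0 : 0 < A := by linarith
  have hAlog : A ≤ Real.log D ^ 4 := by
    refine max_le (by nlinarith [pow_le_pow_left₀ zero_le_one hlog1 4]) ?_
    calc 1 / ‖1 - s‖ ≤ 1 / (1 / Real.log D ^ 4) := one_div_le_one_div_of_le (by positivity) hfar
      _ = Real.log D ^ 4 := one_div_one_div _
  -- `‖s‖ ≤ √y · D^{-3/4}`
  have hsqrt_y : Real.sqrt y = (D : ℝ) ^ ((1 / 4 - ε / 2) / ϱ) := by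
    rw [Real.sqrt_eq_rpow, hy_def, ← Real.rpow_mul hD0r.le, he_def]
    congr 1; field_simp; ring
  have hs_le : ‖s‖ ≤ Real.sqrt y * (D : ℝ) ^ (-(3 / 4) : ℝ) := by
    rw [hsqrt_y, ← Real.rpow_add hD0r]
    convert hsize using 2
    ring
  have hsqrt_y0 : 0 < Real.sqrt y := Real.sqrt_pos.mpr hy0
  -- Lemma 4 applies at `x = y`
  have hx : ‖s‖ ^ 2 * max 1 (1 / ‖1 - s‖) * Real.sqrt D ≤ y := by
    rw [← hA_def]
    have h1 : ‖s‖ ^ 2 ≤ y * (D : ℝ) ^ (-(3 / 2) : ℝ) := by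
      calc ‖s‖ ^ 2 ≤ (Real.sqrt y * (D : ℝ) ^ (-(3 / 4) : ℝ)) ^ 2 :=
            pow_le_pow_left₀ (norm_nonneg _) hs_le 2
        _ = Real.sqrt y ^ 2 * ((D : ℝ) ^ (-(3 / 4) : ℝ)) ^ 2 := mul_pow _ _ _
        _ = y * (D : ℝ) ^ (-(3 / 2) : ℝ) := by
            rw [Real.sq_sqrt hy0.le, ← Real.rpow_natCast ((D : ℝ) ^ (-(3 / 4) : ℝ)) 2,
              ← Real.rpow_mul hD0r.le]; norm_num
    have h2 : (D : ℝ) ^ (-(3 / 2) : ℝ) * Real.log D ^ 4 * Real.sqrt D ≤ 1 := by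
      rw [Real.sqrt_eq_rpow]
      calc (D : ℝ) ^ (-(3 / 2) : ℝ) * Real.log D ^ 4 * (D : ℝ) ^ ((1 : ℝ) / 2)
          ≤ (D : ℝ) ^ (-(3 / 2) : ℝ) * D * (D : ℝ) ^ ((1 : ℝ) / 2) := by
            gcongr
        _ = 1 := by
            rw [show (D : ℝ) ^ (-(3 / 2) : ℝ) * D = (D : ℝ) ^ (-(3 / 2) : ℝ) * (D : ℝ) ^ (1 : ℝ) by
                rw [Real.rpow_one], ← Real.rpow_add hD0r, ← Real.rpow_add hD0r]
            norm_num
    calc ‖s‖ ^ 2 * A * Real.sqrt D ≤ (y * (D : ℝ) ^ (-(3 / 2) : ℝ)) * Real.log D ^ 4 * Real.sqrt D := by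
          gcongr
      _ = y * ((D : ℝ) ^ (-(3 / 2) : ℝ) * Real.log D ^ 4 * Real.sqrt D) := by ring
      _ ≤ y * 1 := mul_le_mul_of_nonneg_left h2 hy0.le
      _ = y := mul_one _
  -- the character
  have hq : χ ^ 2 = 1 := MulChar.IsQuadratic.sq_eq_one hquad
  have hΔ : NumberField.discr K = -(D : ℤ) := by rw [← hKD]; omega
  have hne : χ ≠ 1 := by
    intro h1
    have h := hodd
    rw [DirichletCharacter.Odd, h1, MulChar.one_apply isUnit_one.neg] at h
    norm_num at h
  have hmain := hL4 D hDD₄ χ hne s hs1 hτ0 hτhalf y hx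
  -- the class number formula `L(1) = π h/√D`
  have hD5 : 5 ≤ D := le_trans (by norm_num) hDbig
  have hd4 : NumberField.discr K < -4 := by have := hD5; omega
  have hcnf := Quadratic.LFunction_one_eq_of_discr_neg_of_eq h2 hd hne (fun s hs => by
    rw [← DirichletCharacter.LFunction_eq_LSeries χ (show 1 < (s : ℂ).re by simpa using hs)]
    exact Quadratic.dedekindZeta_eq_riemannZeta_mul_LFunction_of_odd_primitive hprim hquad hodd
      h2 hΔ (by simpa using hs))
  have hw : (NumberField.Units.torsionOrder K : ℝ) = 2 := by
    exact_mod_cast Quadratic.torsionOrder_eq_two_of_discr_lt_neg_four h2 hd4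
  have habs : |(NumberField.discr K : ℝ)| = (D : ℝ) := by
    rw [← hKD, Nat.cast_natAbs, Int.cast_abs]
  obtain ⟨h, hh_def⟩ : ∃ h : ℝ, h = (NumberField.classNumber K : ℝ) := ⟨_, rfl⟩
  rw [← hh_def] at hh
  have hh0 : 0 ≤ h := by rw [hh_def]; positivity
  have hsqrtD : 0 < Real.sqrt D := Real.sqrt_pos.2 hD0r
  have hπ := Real.pi_pos
  have hL1 : χ.LFunction 1 = ((Real.pi * h / Real.sqrt D : ℝ) : ℂ) := by
    rw [hcnf, hw, habs, hh_def, mul_assoc, mul_div_mul_left _ _ (two_ne_zero' ℝ)]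
  have hL1norm : ‖χ.LFunction 1‖ = Real.pi * h / Real.sqrt D := by
    rw [hL1, Complex.norm_real, Real.norm_eq_abs, abs_of_nonneg (by positivity)]
  -- `h ≤ log^{3/4} D ≤ log D`
  have hhlog : h ≤ Real.log D := by
    refine hh.trans ?_
    calc Real.log D ^ (3 / 4 : ℝ) ≤ Real.log D ^ (1 : ℝ) :=
          Real.rpow_le_rpow_of_exponent_le hlog1 (by norm_num)
      _ = Real.log D := Real.rpow_one _
  -- (i) the Lemma-4 error: `F ≤ ½ D^{-3ε/4} log⁴D`
  have hyτ : y ^ (1 - s.re) ≤ (D : ℝ) ^ (1 / 2 - ε) := by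
    calc y ^ (1 - s.re) = y ^ τ := by rw [hτ_def]
      _ ≤ y ^ ϱ := Real.rpow_le_rpow_of_exponent_le hy1 hτϱ
      _ = (D : ℝ) ^ (1 / 2 - ε) := by
          rw [hy_def, ← Real.rpow_mul hD0r.le, he_def]; congr 1; field_simp
  have hsqrtA : Real.sqrt A ≤ Real.log D ^ 2 := by
    calc Real.sqrt A ≤ Real.sqrt (Real.log D ^ 4) := Real.sqrt_le_sqrt hAlog
      _ = Real.log D ^ 2 := by
          rw [show Real.log D ^ 4 = (Real.log D ^ 2) ^ 2 by ring, Real.sqrt_sq (by positivity)]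
  have hlogy : Real.log y ≤ 1 / 2 * ((D : ℝ) ^ (ε / 4) * Real.log D) := by
    rw [hy_def, Real.log_rpow hD0r, he_def]
    have : (1 / 2 - ε) / ϱ ≤ 1 / 2 * (D : ℝ) ^ (ε / 4) := by
      calc (1 / 2 - ε) / ϱ = (1 / 2 - ε) * (1 / ϱ) := by ring
        _ ≤ (1 / 2) * (1 / ϱ) := mul_le_mul_of_nonneg_right (by linarith) (by positivity)
        _ ≤ 1 / 2 * (D : ℝ) ^ (ε / 4) := mul_le_mul_of_nonneg_left hϱinv (by norm_num)
    calc (1 / 2 - ε) / ϱ * Real.log D ≤ 1 / 2 * (D : ℝ) ^ (ε / 4) * Real.log D :=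
          mul_le_mul_of_nonneg_right this hlog0.le
      _ = _ := by ring
  have hlogy0 : 0 ≤ Real.log y := Real.log_nonneg hy1
  have hF : y ^ (1 - s.re) * ‖s‖ * (D : ℝ) ^ (1 / 4 : ℝ) * Real.sqrt (max 1 (1 / ‖1 - s‖)) *
      Real.log D * Real.log y / Real.sqrt y ≤
      1 / 2 * ((D : ℝ) ^ (-(3 * ε / 4)) * Real.log D ^ 4) := by
    rw [← hA_def]
    have hsy : ‖s‖ / Real.sqrt y ≤ (D : ℝ) ^ (-(3 / 4) : ℝ) := by
      rw [div_le_iff₀ hsqrt_y0]; rw [mul_comm]; exact hs_le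
    have hexp : (D : ℝ) ^ (1 / 2 - ε) * (D : ℝ) ^ (-(3 / 4) : ℝ) * (D : ℝ) ^ (1 / 4 : ℝ) *
        (D : ℝ) ^ (ε / 4) = (D : ℝ) ^ (-(3 * ε / 4)) := by
      rw [← Real.rpow_add hD0r, ← Real.rpow_add hD0r, ← Real.rpow_add hD0r]; congr 1; ring
    have hre : y ^ (1 - s.re) * ‖s‖ * (D : ℝ) ^ (1 / 4 : ℝ) * Real.sqrt A * Real.log D *
        Real.log y / Real.sqrt y =
        y ^ (1 - s.re) * (‖s‖ / Real.sqrt y) * (D : ℝ) ^ (1 / 4 : ℝ) * Real.sqrt A *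
          Real.log D * Real.log y := by
      field_simp
    rw [hre]
    have hP1 : y ^ (1 - s.re) * (‖s‖ / Real.sqrt y) ≤
        (D : ℝ) ^ (1 / 2 - ε) * (D : ℝ) ^ (-(3 / 4) : ℝ) :=
      mul_le_mul hyτ hsy (div_nonneg (norm_nonneg _) hsqrt_y0.le) (Real.rpow_nonneg hD0r.le _)
    have hP2 : y ^ (1 - s.re) * (‖s‖ / Real.sqrt y) * (D : ℝ) ^ (1 / 4 : ℝ) ≤
        (D : ℝ) ^ (1 / 2 - ε) * (D : ℝ) ^ (-(3 / 4) : ℝ) * (D : ℝ) ^ (1 / 4 : ℝ) :=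
      mul_le_mul_of_nonneg_right hP1 (Real.rpow_nonneg hD0r.le _)
    have hP3 : y ^ (1 - s.re) * (‖s‖ / Real.sqrt y) * (D : ℝ) ^ (1 / 4 : ℝ) * Real.sqrt A ≤
        (D : ℝ) ^ (1 / 2 - ε) * (D : ℝ) ^ (-(3 / 4) : ℝ) * (D : ℝ) ^ (1 / 4 : ℝ) * Real.log D ^ 2 :=
      mul_le_mul hP2 hsqrtA (Real.sqrt_nonneg _) (by positivity)
    have hP4 : y ^ (1 - s.re) * (‖s‖ / Real.sqrt y) * (D : ℝ) ^ (1 / 4 : ℝ) * Real.sqrt A *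
        Real.log D ≤
        (D : ℝ) ^ (1 / 2 - ε) * (D : ℝ) ^ (-(3 / 4) : ℝ) * (D : ℝ) ^ (1 / 4 : ℝ) * Real.log D ^ 2 *
          Real.log D :=
      mul_le_mul_of_nonneg_right hP3 hlog0.le
    have hP5 : y ^ (1 - s.re) * (‖s‖ / Real.sqrt y) * (D : ℝ) ^ (1 / 4 : ℝ) * Real.sqrt A *
        Real.log D * Real.log y ≤
        (D : ℝ) ^ (1 / 2 - ε) * (D : ℝ) ^ (-(3 / 4) : ℝ) * (D : ℝ) ^ (1 / 4 : ℝ) * Real.log D ^ 2 *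
          Real.log D * (1 / 2 * ((D : ℝ) ^ (ε / 4) * Real.log D)) :=
      mul_le_mul hP4 hlogy hlogy0 (by positivity)
    calc _ ≤ _ := hP5
      _ = 1 / 2 * (((D : ℝ) ^ (1 / 2 - ε) * (D : ℝ) ^ (-(3 / 4) : ℝ) * (D : ℝ) ^ (1 / 4 : ℝ) *
            (D : ℝ) ^ (ε / 4)) * Real.log D ^ 4) := by ring
      _ = 1 / 2 * ((D : ℝ) ^ (-(3 * ε / 4)) * Real.log D ^ 4) := by rw [hexp]
  -- `D^{-3ε/4} log⁴D ≤ D^{-ε/2}` and `D^{-3ε/4} ≤ D^{-ε/2}`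
  have hlog4 : Real.log D ^ 4 ≤ (D : ℝ) ^ (ε / 4) := by
    calc Real.log D ^ 4 ≤ Real.log D ^ 5 := pow_le_pow_right₀ hlog1 (by norm_num)
      _ ≤ (D : ℝ) ^ (ε / 4) := hlog5
  have hcombine : (D : ℝ) ^ (-(3 * ε / 4)) * (D : ℝ) ^ (ε / 4) = (D : ℝ) ^ (-ε / 2) := by
    rw [← Real.rpow_add hD0r]; congr 1; ring
  have h34 : (D : ℝ) ^ (-(3 * ε / 4)) * Real.log D ^ 4 ≤ (D : ℝ) ^ (-ε / 2) := by
    rw [← hcombine]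
    exact mul_le_mul_of_nonneg_left hlog4 (Real.rpow_nonneg hD0r.le _)
  have h34' : (D : ℝ) ^ (-(3 * ε / 4)) ≤ (D : ℝ) ^ (-ε / 2) :=
    Real.rpow_le_rpow_of_exponent_le hD1r (by linarith)
  -- (i) assembled
  have herr1 : ‖(∑ n ∈ Icc 1 ⌊y⌋₊, (∑ d ∈ n.divisors, χ (d : ZMod D)) * (n : ℂ) ^ (-s)) -
      χ.LFunction s * riemannZeta s - χ.LFunction 1 * (y : ℂ) ^ (1 - s) / (1 - s)‖ ≤
      max C₄ 0 / 2 * (D : ℝ) ^ (-ε / 2) := by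
    refine hmain.trans ?_
    have hF0 : 0 ≤ y ^ (1 - s.re) * ‖s‖ * (D : ℝ) ^ (1 / 4 : ℝ) * Real.sqrt (max 1 (1 / ‖1 - s‖)) *
        Real.log D * Real.log y / Real.sqrt y := by positivity
    calc C₄ * (y ^ (1 - s.re) * ‖s‖ * (D : ℝ) ^ (1 / 4 : ℝ) * Real.sqrt (max 1 (1 / ‖1 - s‖)) *
          Real.log D * Real.log y / Real.sqrt y)
        ≤ max C₄ 0 * (y ^ (1 - s.re) * ‖s‖ * (D : ℝ) ^ (1 / 4 : ℝ) *
            Real.sqrt (max 1 (1 / ‖1 - s‖)) * Real.log D * Real.log y / Real.sqrt y) :=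
          mul_le_mul_of_nonneg_right (le_max_left _ _) hF0
      _ ≤ max C₄ 0 * (1 / 2 * ((D : ℝ) ^ (-(3 * ε / 4)) * Real.log D ^ 4)) :=
          mul_le_mul_of_nonneg_left hF (le_max_right _ _)
      _ ≤ max C₄ 0 * (1 / 2 * (D : ℝ) ^ (-ε / 2)) :=
          mul_le_mul_of_nonneg_left (mul_le_mul_of_nonneg_left h34 (by norm_num)) (le_max_right _ _)
      _ = max C₄ 0 / 2 * (D : ℝ) ^ (-ε / 2) := by ring
  -- (ii) the term `L(1) y^{1-s}/(1-s)`
  have herr2 : ‖χ.LFunction 1 * (y : ℂ) ^ (1 - s) / (1 - s)‖ ≤ 4 * (D : ℝ) ^ (-ε / 2) := by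
    rw [norm_div, norm_mul, hL1norm, Complex.norm_cpow_eq_rpow_re_of_pos hy0, Complex.sub_re,
      Complex.one_re]
    have h1s' : 1 / ‖1 - s‖ ≤ Real.log D ^ 4 := by
      calc 1 / ‖1 - s‖ ≤ 1 / (1 / Real.log D ^ 4) := one_div_le_one_div_of_le (by positivity) hfar
        _ = Real.log D ^ 4 := one_div_one_div _
    have hsqrt_rpow : Real.sqrt D = (D : ℝ) ^ ((1 : ℝ) / 2) := Real.sqrt_eq_rpow _
    have hexp2 : (D : ℝ) ^ (1 / 2 - ε) / Real.sqrt D = (D : ℝ) ^ (-ε) := by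
      rw [hsqrt_rpow, ← Real.rpow_sub hD0r]; congr 1; ring
    have hexp3 : (D : ℝ) ^ (-ε) * (D : ℝ) ^ (ε / 4) = (D : ℝ) ^ (-(3 * ε / 4)) := by
      rw [← Real.rpow_add hD0r]; congr 1; ring
    calc Real.pi * h / Real.sqrt D * y ^ (1 - s.re) / ‖1 - s‖
        = Real.pi * h * y ^ (1 - s.re) / Real.sqrt D * (1 / ‖1 - s‖) := by ring
      _ ≤ Real.pi * Real.log D * (D : ℝ) ^ (1 / 2 - ε) / Real.sqrt D * Real.log D ^ 4 := by
          refine mul_le_mul ?_ h1s' (by positivity) (by positivity)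
          refine div_le_div_of_nonneg_right ?_ hsqrtD.le
          exact mul_le_mul (mul_le_mul_of_nonneg_left hhlog hπ.le) hyτ
            (Real.rpow_nonneg hy0.le _) (by positivity)
      _ = Real.pi * Real.log D ^ 5 * ((D : ℝ) ^ (1 / 2 - ε) / Real.sqrt D) := by ring
      _ = Real.pi * Real.log D ^ 5 * (D : ℝ) ^ (-ε) := by rw [hexp2]
      _ ≤ 4 * (D : ℝ) ^ (ε / 4) * (D : ℝ) ^ (-ε) := by
          refine mul_le_mul_of_nonneg_right ?_ (Real.rpow_nonneg hD0r.le _)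
          exact mul_le_mul Real.pi_le_four hlog5 (by positivity) (by norm_num)
      _ = 4 * (D : ℝ) ^ (-(3 * ε / 4)) := by rw [mul_assoc, mul_comm ((D : ℝ) ^ (ε / 4)), hexp3]
      _ ≤ 4 * (D : ℝ) ^ (-ε / 2) := mul_le_mul_of_nonneg_left h34' (by norm_num)
  -- conclusion
  have hsplit : (∑ n ∈ Icc 1 ⌊y⌋₊, (∑ d ∈ n.divisors, χ (d : ZMod D)) * (n : ℂ) ^ (-s)) -
      χ.LFunction s * riemannZeta s =
      ((∑ n ∈ Icc 1 ⌊y⌋₊, (∑ d ∈ n.divisors, χ (d : ZMod D)) * (n : ℂ) ^ (-s)) -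
        χ.LFunction s * riemannZeta s - χ.LFunction 1 * (y : ℂ) ^ (1 - s) / (1 - s)) +
        χ.LFunction 1 * (y : ℂ) ^ (1 - s) / (1 - s) := by ring
  rw [hsplit]
  calc _ ≤ ‖(∑ n ∈ Icc 1 ⌊y⌋₊, (∑ d ∈ n.divisors, χ (d : ZMod D)) * (n : ℂ) ^ (-s)) -
        χ.LFunction s * riemannZeta s - χ.LFunction 1 * (y : ℂ) ^ (1 - s) / (1 - s)‖ +
        ‖χ.LFunction 1 * (y : ℂ) ^ (1 - s) / (1 - s)‖ := norm_add_le _ _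
    _ ≤ max C₄ 0 / 2 * (D : ℝ) ^ (-ε / 2) + 4 * (D : ℝ) ^ (-ε / 2) := add_le_add herr1 herr2
    _ = (max C₄ 0 / 2 + 4) * (D : ℝ) ^ (-ε / 2) := by ring

end LemmaFive

/-! ## Part Q. Lemma 6, the multiplicative skeleton (pp. 301–305): `n = a · r` with `a` composed of
split primes (`χ(p) = 1`) and `r ∈ R` free of them ((4.3)–(4.4), (4.20)); `g(r) = [r = bℓ²]`,
`b ∣ D` squarefree ((4.15), (4.21)); Euler-product bounds ((4.5), (4.16)) -/

section Skeleton

variable {D : ℕ} (χ : DirichletCharacter ℂ D)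

/-- A weight `[P n] · r(n) · n^{−s}` with a "multiplicative" predicate `P` (`P 1`, and
`P(mn) ↔ P m ∧ P n` for coprime `m, n`) is a multiplicative arithmetic function. [folklore] -/
private theorem isMultiplicative_indicator_weight (hq : χ ^ 2 = 1) (P : ℕ → Prop)
    [DecidablePred P] (hP1 : P 1) (hP : ∀ {m n : ℕ}, m ≠ 0 → n ≠ 0 → m.Coprime n →
      (P (m * n) ↔ P m ∧ P n)) (s : ℂ) :
    IsMultiplicative (⟨fun n => if P n then (charDivisorSum χ n : ℂ) * (n : ℂ) ^ (-s) else 0,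
      by simp⟩ : ArithmeticFunction ℂ) := by
  refine ⟨?_, ?_⟩
  · simp [hP1]
  · intro m n hmn
    rcases eq_or_ne m 0 with rfl | hm
    · simp
    rcases eq_or_ne n 0 with rfl | hn
    · simp
    simp only [ArithmeticFunction.coe_mk]
    rw [(isMultiplicative_charDivisorSum χ hq).map_mul_of_coprime hmn, Nat.cast_mul,
      Complex.ofReal_mul, natCast_mul_natCast_cpow]
    by_cases hPm : P m <;> by_cases hPn : P n
    · rw [if_pos ((hP hm hn hmn).mpr ⟨hPm, hPn⟩), if_pos hPm, if_pos hPn]; ring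
    · rw [if_neg (fun h => hPn ((hP hm hn hmn).mp h).2), if_neg hPn]; ring
    · rw [if_neg (fun h => hPm ((hP hm hn hmn).mp h).1), if_neg hPm]; ring
    · rw [if_neg (fun h => hPm ((hP hm hn hmn).mp h).1), if_neg hPm]; ring

/-- "All prime factors satisfy `Q`" is a multiplicative predicate. [folklore] -/
private theorem forall_primeFactors_mul_iff {Q : ℕ → Prop} {m n : ℕ} (hm : m ≠ 0) (hn : n ≠ 0) :
    (∀ p ∈ (m * n).primeFactors, Q p) ↔ (∀ p ∈ m.primeFactors, Q p) ∧ ∀ p ∈ n.primeFactors, Q p := by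
  rw [Nat.primeFactors_mul hm hn]
  simp only [Finset.mem_union]
  constructor
  · intro h; exact ⟨fun p hp => h p (Or.inl hp), fun p hp => h p (Or.inr hp)⟩
  · rintro ⟨h1, h2⟩ p (hp | hp); exacts [h1 p hp, h2 p hp]

/-- A Dirichlet product at a prime power: `(F * G)(p^k) = Σ_{i ≤ k} F(p^i) G(p^{k−i})`. [folklore] -/
private theorem mul_apply_prime_pow (F G : ArithmeticFunction ℂ) {p : ℕ} (hp : p.Prime) (k : ℕ) :
    (F * G) (p ^ k) = ∑ i ∈ range (k + 1), F (p ^ i) * G (p ^ (k - i)) := by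
  rw [mul_apply, Nat.sum_divisorsAntidiagonal fun a b => F a * G b, Nat.sum_divisors_prime_pow hp]
  refine sum_congr rfl fun i hi => ?_
  rw [Nat.pow_div (Nat.lt_succ_iff.mp (mem_range.mp hi)) hp.pos]

/-- **(4.20): the split part factors off.** For every `N` and `s`:
`Σ_{n ≤ N} g(n) n^{−s} = Σ_{r ≤ N, r ∈ R} g(r) r^{−s} · Σ_{a ≤ N/r, a ∈ A₁} g(a) a^{−s}`, where `A₁` =
integers all of whose prime factors `p` have `χ(p) = 1` and `R` = integers with no such prime factor
(Pintz's `R = {bm : b ∈ A₀, m ∈ A_{−1}}`). [cite: Pintz1976ElementaryIII, §4 (4.3)–(4.4), (4.20) pp. 301, 304] -/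
theorem sum_eq_sum_free_mul_sum_split (hq : χ ^ 2 = 1) (s : ℂ) (N : ℕ) :
    ∑ n ∈ Ioc 0 N, (charDivisorSum χ n : ℂ) * (n : ℂ) ^ (-s) =
      ∑ r ∈ (Ioc 0 N).filter (fun r => ∀ p ∈ r.primeFactors, reChar χ p ≠ 1),
        (charDivisorSum χ r : ℂ) * (r : ℂ) ^ (-s) *
          ∑ a ∈ (Ioc 0 (N / r)).filter (fun a => ∀ p ∈ a.primeFactors, reChar χ p = 1),
            (charDivisorSum χ a : ℂ) * (a : ℂ) ^ (-s) := by
  classical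
  -- the three multiplicative functions
  set F : ArithmeticFunction ℂ := ⟨fun a => if (∀ p ∈ a.primeFactors, reChar χ p = 1) then
      (charDivisorSum χ a : ℂ) * (a : ℂ) ^ (-s) else 0, by simp⟩ with hF
  set G : ArithmeticFunction ℂ := ⟨fun r => if (∀ p ∈ r.primeFactors, reChar χ p ≠ 1) then
      (charDivisorSum χ r : ℂ) * (r : ℂ) ^ (-s) else 0, by simp⟩ with hG
  set H : ArithmeticFunction ℂ := ⟨fun n => if True then
      (charDivisorSum χ n : ℂ) * (n : ℂ) ^ (-s) else 0, by simp⟩ with hH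
  have hFm : IsMultiplicative F := isMultiplicative_indicator_weight χ hq _ (by simp)
    (fun hm hn _ => forall_primeFactors_mul_iff hm hn) s
  have hGm : IsMultiplicative G := isMultiplicative_indicator_weight χ hq _ (by simp)
    (fun hm hn _ => forall_primeFactors_mul_iff hm hn) s
  have hHm : IsMultiplicative H := isMultiplicative_indicator_weight χ hq _ trivial
    (fun _ _ _ => by simp) s
  -- `G * F = H` on prime powers
  have hGF : G * F = H := by
    rw [IsMultiplicative.eq_iff_eq_on_prime_powers _ (hGm.mul hFm) _ hHm]
    intro p k hp
    rw [mul_apply_prime_pow G F hp k]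
    have hppf : ∀ i : ℕ, i ≠ 0 → (p ^ i).primeFactors = {p} := fun i hi =>
      Nat.primeFactors_prime_pow hi hp
    have hH' : H (p ^ k) = (charDivisorSum χ (p ^ k) : ℂ) * ((p ^ k : ℕ) : ℂ) ^ (-s) := by
      show (if True then (charDivisorSum χ (p ^ k) : ℂ) * ((p ^ k : ℕ) : ℂ) ^ (-s) else 0) = _
      rw [if_pos trivial]
    have hFpow : ∀ i : ℕ, i ≠ 0 → F (p ^ i) = if reChar χ p = 1 then
        (charDivisorSum χ (p ^ i) : ℂ) * ((p ^ i : ℕ) : ℂ) ^ (-s) else 0 := by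
      intro i hi
      show (if (∀ q ∈ (p ^ i).primeFactors, reChar χ q = 1) then
        (charDivisorSum χ (p ^ i) : ℂ) * ((p ^ i : ℕ) : ℂ) ^ (-s) else 0) = _
      rw [hppf i hi]; simp only [Finset.mem_singleton, forall_eq]
    have hGpow : ∀ i : ℕ, i ≠ 0 → G (p ^ i) = if reChar χ p ≠ 1 then
        (charDivisorSum χ (p ^ i) : ℂ) * ((p ^ i : ℕ) : ℂ) ^ (-s) else 0 := by
      intro i hi
      show (if (∀ q ∈ (p ^ i).primeFactors, reChar χ q ≠ 1) then
        (charDivisorSum χ (p ^ i) : ℂ) * ((p ^ i : ℕ) : ℂ) ^ (-s) else 0) = _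
      rw [hppf i hi]; simp only [Finset.mem_singleton, forall_eq]
    have hF1 : F 1 = 1 := hFm.map_one
    have hG1 : G 1 = 1 := hGm.map_one
    rw [hH']
    rcases eq_or_ne k 0 with rfl | hk
    · rw [zero_add, Finset.sum_range_one]
      simp only [pow_zero, Nat.sub_self, hF1, hG1, mul_one, charDivisorSum_one, Complex.ofReal_one,
        Nat.cast_one, one_cpow]
    by_cases hc : reChar χ p = 1
    · -- split prime: only `i = 0` contributes, `G(1) = 1`
      rw [Finset.sum_eq_single 0]
      · rw [pow_zero, hG1, one_mul, Nat.sub_zero, hFpow k hk, if_pos hc]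
      · intro i hi hi0
        rw [hGpow i hi0, if_neg (fun h => h hc), zero_mul]
      · intro h; exact absurd (mem_range.mpr (Nat.succ_pos k)) h
    · -- non-split prime: only `i = k` contributes, `F(1) = 1`
      rw [Finset.sum_eq_single k]
      · rw [Nat.sub_self, pow_zero, hF1, mul_one, hGpow k hk, if_pos hc]
      · intro i hi hik
        have hki : k - i ≠ 0 := by
          have := mem_range.mp hi; omega
        rw [hFpow (k - i) hki, if_neg hc, mul_zero]
      · intro h; exact absurd (mem_range.mpr (Nat.lt_succ_self k)) h
  -- the hyperbola identity for `G * F`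
  have h := sum_Ioc_mul_eq_sum_sum G F N
  rw [hGF] at h
  have hHn : ∀ n, H n = (charDivisorSum χ n : ℂ) * (n : ℂ) ^ (-s) := fun n => by simp [hH]
  simp_rw [hHn] at h
  rw [h, Finset.sum_filter]
  refine sum_congr rfl fun r hr => ?_
  simp only [hG, hF, ArithmeticFunction.coe_mk]
  split_ifs with hfree
  · congr 1
    rw [Finset.sum_filter]
  · rw [zero_mul]

/-- A natural number `n ≠ 0` is a square iff every exponent in its factorisation is even.
[folklore] -/
private theorem isSquare_iff_even_factorization' {n : ℕ} (hn : n ≠ 0) :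
    IsSquare n ↔ ∀ p ∈ n.primeFactors, Even (n.factorization p) := by
  constructor
  · rintro ⟨r, rfl⟩ p _
    have hr : r ≠ 0 := by rintro rfl; simp at hn
    rw [Nat.factorization_mul hr hr]
    simp
  · intro h
    refine ⟨n.factorization.prod fun p k => p ^ (k / 2), ?_⟩
    rw [← Finsupp.prod_mul]
    conv_lhs => rw [← Nat.prod_factorization_pow_eq_self hn]
    apply Finsupp.prod_congr
    intro p hp
    rw [← pow_add]
    congr 1
    have := h p (by simpa using hp)
    obtain ⟨t, ht⟩ := this
    omega

/-- `g(p^k) = 1` for a ramified prime (`χ(p) = 0`), `g(p^k) = [k even]` for an inert one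
(`χ(p) = −1`), `g(p^k) = k + 1` for a split one. [cite: Pintz1976ElementaryIII, §4 (4.2), (4.15) pp. 301, 304] -/
theorem charDivisorSum_prime_pow_values (hq : χ ^ 2 = 1) {p : ℕ} (hp : p.Prime) (k : ℕ) :
    (reChar χ p = 0 → charDivisorSum χ (p ^ k) = 1) ∧
    (reChar χ p = -1 → charDivisorSum χ (p ^ k) = if Even k then 1 else 0) ∧
    (reChar χ p = 1 → charDivisorSum χ (p ^ k) = k + 1) := by
  refine ⟨fun hc => ?_, fun hc => ?_, fun hc => ?_⟩
  · rw [charDivisorSum_prime_pow χ hq hp, hc, zero_geom_sum, if_neg (Nat.succ_ne_zero k)]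
  · rw [charDivisorSum_prime_pow χ hq hp, hc, neg_one_geom_sum]
    by_cases hk : Even k
    · rw [if_pos hk, if_neg (by rw [Nat.even_add_one]; exact not_not.mpr hk)]
    · rw [if_neg hk, if_pos (by rw [Nat.even_add_one]; exact hk)]
  · rw [charDivisorSum_prime_pow χ hq hp, hc]; simp

/-- `g(b) = 1` for squarefree `b` composed of ramified primes, and `g(ℓ²) = 1` for `ℓ` free of
split primes. [cite: Pintz1976ElementaryIII, §4 (4.15) p. 304] -/
theorem charDivisorSum_eq_one_of (hq : χ ^ 2 = 1) :
    (∀ {b : ℕ}, b ≠ 0 → Squarefree b → (∀ p ∈ b.primeFactors, reChar χ p = 0) →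
      charDivisorSum χ b = 1) ∧
    (∀ {l : ℕ}, l ≠ 0 → (∀ p ∈ l.primeFactors, reChar χ p ≠ 1) →
      charDivisorSum χ (l ^ 2) = 1) := by
  constructor
  · intro b hb hsq hram
    rw [(isMultiplicative_charDivisorSum χ hq).multiplicative_factorization _ hb, Finsupp.prod,
      Nat.support_factorization]
    refine Finset.prod_eq_one fun p hp => ?_
    have hpp := Nat.prime_of_mem_primeFactors hp
    have h1 : b.factorization p = 1 := by
      have hle := Squarefree.natFactorization_le_one p hsq
      have hpos : 0 < b.factorization p := Nat.Prime.factorization_pos_of_dvd hpp hb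
        (Nat.dvd_of_mem_primeFactors hp)
      omega
    rw [h1, ((charDivisorSum_prime_pow_values χ hq hpp 1).1 (hram p hp))]
  · intro l hl hfree
    have hl2 : l ^ 2 ≠ 0 := pow_ne_zero 2 hl
    rw [(isMultiplicative_charDivisorSum χ hq).multiplicative_factorization _ hl2, Finsupp.prod,
      Nat.support_factorization, Nat.primeFactors_pow _ two_ne_zero]
    refine Finset.prod_eq_one fun p hp => ?_
    have hpp := Nat.prime_of_mem_primeFactors hp
    rw [Nat.factorization_pow, Finsupp.smul_apply, smul_eq_mul]
    rcases reChar_trichotomy χ hq p with hc | hc | hc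
    · exact (charDivisorSum_prime_pow_values χ hq hpp _).1 hc
    · exact absurd hc (hfree p hp)
    · rw [(charDivisorSum_prime_pow_values χ hq hpp _).2.1 hc, if_pos (even_two_mul _)]

/-- **(4.21): `Σ_{r ≤ N, r ∈ R} g(r) r^{−s} = Σ_{b ∣ D, μ(b) ≠ 0} b^{−s} Σ_{ℓ ∈ R, bℓ² ≤ N} ℓ^{−2s}`**
(for `r = bm ∈ R`, `g(r) = g(m) = [m = ℓ²]`, (4.15)); here `b` runs over the squarefree integers
`≤ N` composed of ramified primes (`χ(p) = 0`, i.e. `p ∣ D`).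
[cite: Pintz1976ElementaryIII, §4 (4.15), (4.21) pp. 304–305] -/
theorem sum_free_eq_sum_kernel_mul_sum_sq (hq : χ ^ 2 = 1) (s : ℂ) (N : ℕ) :
    ∑ r ∈ (Ioc 0 N).filter (fun r => ∀ p ∈ r.primeFactors, reChar χ p ≠ 1),
        (charDivisorSum χ r : ℂ) * (r : ℂ) ^ (-s) =
      ∑ b ∈ (Ioc 0 N).filter (fun b => Squarefree b ∧ ∀ p ∈ b.primeFactors, reChar χ p = 0),
        (b : ℂ) ^ (-s) *
          ∑ l ∈ (Ioc 0 (Nat.sqrt (N / b))).filter (fun l => ∀ p ∈ l.primeFactors, reChar χ p ≠ 1),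
            ((l : ℂ) ^ (-s)) ^ 2 := by
  classical
  set U : ArithmeticFunction ℂ := ⟨fun b => if (Squarefree b ∧ ∀ p ∈ b.primeFactors, reChar χ p = 0)
      then (charDivisorSum χ b : ℂ) * (b : ℂ) ^ (-s) else 0, by simp⟩ with hU
  set V : ArithmeticFunction ℂ := ⟨fun m =>
      if (∀ p ∈ m.primeFactors, reChar χ p ≠ 1 ∧ Even (m.factorization p))
      then (charDivisorSum χ m : ℂ) * (m : ℂ) ^ (-s) else 0, by simp⟩ with hV
  set G : ArithmeticFunction ℂ := ⟨fun r => if (∀ p ∈ r.primeFactors, reChar χ p ≠ 1) then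
      (charDivisorSum χ r : ℂ) * (r : ℂ) ^ (-s) else 0, by simp⟩ with hG
  have hUm : IsMultiplicative U := by
    refine isMultiplicative_indicator_weight χ hq _ ⟨squarefree_one, by simp⟩ (fun hm hn hmn => ?_) s
    rw [Nat.squarefree_mul_iff, forall_primeFactors_mul_iff hm hn]
    tauto
  have hVm : IsMultiplicative V := by
    refine isMultiplicative_indicator_weight χ hq _ (by simp) (fun {m n} hm hn hmn => ?_) s
    rw [Nat.primeFactors_mul hm hn]
    have hdisj := Nat.Coprime.disjoint_primeFactors hmn
    constructor
    · intro h
      constructor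
      · intro p hp
        obtain ⟨h1, h2⟩ := h p (Finset.mem_union_left _ hp)
        have hn0 : n.factorization p = 0 :=
          Finsupp.notMem_support_iff.mp (by
            rw [Nat.support_factorization]; exact Finset.disjoint_left.mp hdisj hp)
        rw [Nat.factorization_mul hm hn, Finsupp.add_apply, hn0, add_zero] at h2
        exact ⟨h1, h2⟩
      · intro p hp
        obtain ⟨h1, h2⟩ := h p (Finset.mem_union_right _ hp)
        have hm0 : m.factorization p = 0 :=
          Finsupp.notMem_support_iff.mp (by
            rw [Nat.support_factorization]; exact Finset.disjoint_right.mp hdisj hp)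
        rw [Nat.factorization_mul hm hn, Finsupp.add_apply, hm0, zero_add] at h2
        exact ⟨h1, h2⟩
    · rintro ⟨h1, h2⟩ p hp
      rw [Nat.factorization_mul hm hn, Finsupp.add_apply]
      rcases Finset.mem_union.mp hp with hp' | hp'
      · have hn0 : n.factorization p = 0 :=
          Finsupp.notMem_support_iff.mp (by
            rw [Nat.support_factorization]; exact Finset.disjoint_left.mp hdisj hp')
        rw [hn0, add_zero]; exact h1 p hp'
      · have hm0 : m.factorization p = 0 :=
          Finsupp.notMem_support_iff.mp (by
            rw [Nat.support_factorization]; exact Finset.disjoint_right.mp hdisj hp')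
        rw [hm0, zero_add]; exact h2 p hp'
  have hGm : IsMultiplicative G := isMultiplicative_indicator_weight χ hq _ (by simp)
    (fun hm hn _ => forall_primeFactors_mul_iff hm hn) s
  -- `U * V = G` on prime powers
  have hUV : U * V = G := by
    rw [IsMultiplicative.eq_iff_eq_on_prime_powers _ (hUm.mul hVm) _ hGm]
    intro p k hp
    rw [mul_apply_prime_pow U V hp k]
    have hppf : ∀ i : ℕ, i ≠ 0 → (p ^ i).primeFactors = {p} := fun i hi =>
      Nat.primeFactors_prime_pow hi hp
    have hfac : ∀ i : ℕ, (p ^ i).factorization p = i := fun i => by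
      rw [Nat.Prime.factorization_pow hp, Finsupp.single_eq_same]
    have hUpow : ∀ i : ℕ, i ≠ 0 → U (p ^ i) = if (Squarefree (p ^ i) ∧ reChar χ p = 0) then
        (charDivisorSum χ (p ^ i) : ℂ) * ((p ^ i : ℕ) : ℂ) ^ (-s) else 0 := by
      intro i hi
      show (if (Squarefree (p ^ i) ∧ ∀ q ∈ (p ^ i).primeFactors, reChar χ q = 0) then
        (charDivisorSum χ (p ^ i) : ℂ) * ((p ^ i : ℕ) : ℂ) ^ (-s) else 0) = _
      rw [hppf i hi]; simp only [Finset.mem_singleton, forall_eq]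
    have hVpow : ∀ i : ℕ, i ≠ 0 → V (p ^ i) = if (reChar χ p ≠ 1 ∧ Even i) then
        (charDivisorSum χ (p ^ i) : ℂ) * ((p ^ i : ℕ) : ℂ) ^ (-s) else 0 := by
      intro i hi
      show (if (∀ q ∈ (p ^ i).primeFactors, reChar χ q ≠ 1 ∧ Even ((p ^ i).factorization q)) then
        (charDivisorSum χ (p ^ i) : ℂ) * ((p ^ i : ℕ) : ℂ) ^ (-s) else 0) = _
      rw [hppf i hi]; simp only [Finset.mem_singleton, forall_eq, hfac]
    have hGpow : ∀ i : ℕ, i ≠ 0 → G (p ^ i) = if reChar χ p ≠ 1 then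
        (charDivisorSum χ (p ^ i) : ℂ) * ((p ^ i : ℕ) : ℂ) ^ (-s) else 0 := by
      intro i hi
      show (if (∀ q ∈ (p ^ i).primeFactors, reChar χ q ≠ 1) then
        (charDivisorSum χ (p ^ i) : ℂ) * ((p ^ i : ℕ) : ℂ) ^ (-s) else 0) = _
      rw [hppf i hi]; simp only [Finset.mem_singleton, forall_eq]
    have hU1 : U 1 = 1 := hUm.map_one
    have hV1 : V 1 = 1 := hVm.map_one
    rcases eq_or_ne k 0 with rfl | hk
    · simp only [zero_add, Finset.sum_range_one, pow_zero, Nat.sub_zero, hU1, hV1, hGm.map_one,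
        mul_one]
    have hvals := charDivisorSum_prime_pow_values χ hq hp
    rcases reChar_trichotomy χ hq p with hc | hc | hc
    · -- ramified: the terms `i = 0` and `i = 1` contribute `[k even] + [k−1 even] = 1`
      have hne1 : reChar χ p ≠ 1 := by rw [hc]; norm_num
      rw [hGpow k hk, if_pos hne1, (hvals k).1 hc]
      have hsq1 : Squarefree (p ^ 1) := by rw [pow_one]; exact hp.squarefree
      have hnsq : ∀ i : ℕ, 2 ≤ i → ¬ Squarefree (p ^ i) := by
        intro i hi hsq
        have := Squarefree.natFactorization_le_one p hsq
        rw [hfac i] at this; omega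
      have hVall : ∀ j : ℕ, V (p ^ j) = if Even j then ((p ^ j : ℕ) : ℂ) ^ (-s) else 0 := by
        intro j
        rcases eq_or_ne j 0 with rfl | hj
        · rw [pow_zero, hV1, if_pos Even.zero]; simp
        · rw [hVpow j hj, (hvals j).1 hc, Complex.ofReal_one, one_mul]
          by_cases hje : Even j
          · rw [if_pos ⟨hne1, hje⟩, if_pos hje]
          · rw [if_neg (fun h => hje h.2), if_neg hje]
      have hpk : ((p ^ k : ℕ) : ℂ) ^ (-s) =
          ((p ^ 1 : ℕ) : ℂ) ^ (-s) * ((p ^ (k - 1) : ℕ) : ℂ) ^ (-s) := by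
        rw [← natCast_mul_natCast_cpow, ← Nat.cast_mul, ← pow_add, Nat.add_sub_cancel' (by omega)]
      rw [Finset.sum_eq_add_of_mem 0 1 (Finset.mem_range.mpr (Nat.succ_pos k))
        (Finset.mem_range.mpr (by omega)) zero_ne_one ?_]
      · rw [pow_zero, hU1, one_mul, Nat.sub_zero, hUpow 1 one_ne_zero, if_pos ⟨hsq1, hc⟩,
          (hvals 1).1 hc, Complex.ofReal_one, one_mul, hVall k, hVall (k - 1), one_mul]
        by_cases hke : Even k
        · have hko : ¬ Even (k - 1) := by rw [Nat.even_iff] at hke ⊢; omega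
          rw [if_pos hke, if_neg hko, mul_zero, add_zero]
        · have hko : Even (k - 1) := by rw [Nat.even_iff] at hke ⊢; omega
          rw [if_neg hke, if_pos hko, zero_add, hpk]
      · intro c hc' hne
        have hc2 : 2 ≤ c := by obtain ⟨h0, h1⟩ := hne; omega
        rw [hUpow c (by omega), if_neg (fun h => hnsq c hc2 h.1), zero_mul]
    · -- split: everything vanishes
      rw [hGpow k hk, if_neg (not_not.mpr hc)]
      refine Finset.sum_eq_zero fun i hi => ?_
      rcases eq_or_ne i 0 with rfl | hi0
      · rw [Nat.sub_zero, hVpow k hk, if_neg (fun h => h.1 hc), mul_zero]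
      · rw [hUpow i hi0, if_neg (fun h => by rw [hc] at h; norm_num at h), zero_mul]
    · -- inert: only `i = 0` contributes, `V(p^k) = [k even] (p^k)^{-s} = g(p^k)(p^k)^{-s}`
      have hne1 : reChar χ p ≠ 1 := by rw [hc]; norm_num
      rw [hGpow k hk, if_pos hne1, (hvals k).2.1 hc, Finset.sum_eq_single 0]
      · rw [pow_zero, hU1, one_mul, Nat.sub_zero, hVpow k hk, (hvals k).2.1 hc]
        by_cases hke : Even k
        · rw [if_pos ⟨hne1, hke⟩, if_pos hke]
        · rw [if_neg (fun h => hke h.2), if_neg hke]; simp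
      · intro i _ hi0
        rw [hUpow i hi0, if_neg (fun h => by rw [hc] at h; norm_num at h), zero_mul]
      · intro h; exact absurd (mem_range.mpr (Nat.succ_pos k)) h
  -- the hyperbola identity for `U * V`
  have h := sum_Ioc_mul_eq_sum_sum U V N
  rw [hUV] at h
  have hGsum : ∑ n ∈ Ioc 0 N, G n = ∑ r ∈ (Ioc 0 N).filter (fun r => ∀ p ∈ r.primeFactors, reChar χ p ≠ 1),
      (charDivisorSum χ r : ℂ) * (r : ℂ) ^ (-s) := by
    rw [Finset.sum_filter]; rfl
  rw [← hGsum, h, Finset.sum_filter]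
  refine sum_congr rfl fun b hb => ?_
  have hb0 : b ≠ 0 := (mem_Ioc.mp hb).1.ne'
  simp only [hU, ArithmeticFunction.coe_mk]
  split_ifs with hP
  · rw [(charDivisorSum_eq_one_of χ hq).1 hb0 hP.1 hP.2, Complex.ofReal_one, one_mul]
    congr 1
    -- `Σ_{m ≤ M} V(m) = Σ_{ℓ ≤ √M, ℓ free} ℓ^{-2s}`
    set M := N / b with hM
    have hVval : ∀ m ∈ Ioc 0 M, V m = if (∀ p ∈ m.primeFactors, reChar χ p ≠ 1 ∧ Even (m.factorization p))
        then (charDivisorSum χ m : ℂ) * (m : ℂ) ^ (-s) else 0 := fun m _ => rfl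
    rw [Finset.sum_congr rfl hVval, ← Finset.sum_filter]
    -- reindex by `ℓ ↦ ℓ²`
    have hinj : Set.InjOn (fun l : ℕ => l ^ 2)
        ((Ioc 0 (Nat.sqrt M)).filter (fun l => ∀ p ∈ l.primeFactors, reChar χ p ≠ 1) : Finset ℕ) :=
      fun x _ y _ hxy => by simpa using (Nat.pow_left_injective two_ne_zero) hxy
    have himage : ((Ioc 0 (Nat.sqrt M)).filter (fun l => ∀ p ∈ l.primeFactors, reChar χ p ≠ 1)).image
        (fun l : ℕ => l ^ 2) =
        (Ioc 0 M).filter (fun m => ∀ p ∈ m.primeFactors, reChar χ p ≠ 1 ∧ Even (m.factorization p)) := by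
      ext m
      simp only [Finset.mem_image, Finset.mem_filter, Finset.mem_Ioc]
      constructor
      · rintro ⟨l, ⟨⟨hl0, hlM⟩, hlfree⟩, rfl⟩
        refine ⟨⟨pow_pos hl0 2, Nat.le_sqrt'.mp hlM⟩, fun p hp => ?_⟩
        rw [Nat.primeFactors_pow _ two_ne_zero] at hp
        refine ⟨hlfree p hp, ?_⟩
        rw [Nat.factorization_pow, Finsupp.smul_apply, smul_eq_mul]; exact even_two_mul _
      · rintro ⟨⟨hm0, hmM⟩, hpred⟩
        have hm0' : m ≠ 0 := hm0.ne'
        obtain ⟨l, hl⟩ := (isSquare_iff_even_factorization' hm0').mpr fun p hp => (hpred p hp).2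
        have hl0 : l ≠ 0 := by rintro rfl; simp at hl; exact hm0' hl
        have hl2 : m = l ^ 2 := by rw [hl, sq]
        refine ⟨l, ⟨⟨Nat.pos_of_ne_zero hl0, Nat.le_sqrt'.mpr (hl2 ▸ hmM)⟩, fun p hp => ?_⟩, hl2.symm⟩
        have : p ∈ m.primeFactors := by
          rw [hl2, Nat.primeFactors_pow _ two_ne_zero]; exact hp
        exact (hpred p this).1
    rw [← himage, Finset.sum_image hinj]
    refine sum_congr rfl fun l hl => ?_
    obtain ⟨hl', hlfree⟩ := Finset.mem_filter.mp hl
    have hl0 : l ≠ 0 := (mem_Ioc.mp hl').1.ne'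
    rw [(charDivisorSum_eq_one_of χ hq).2 hl0 hlfree, Complex.ofReal_one, one_mul,
      sq l, Nat.cast_mul, natCast_mul_natCast_cpow, sq]
  · rw [zero_mul]

end Skeleton

section EulerBounds

variable {D : ℕ} (χ : DirichletCharacter ℂ D)

/-- `((p^n : ℕ) : ℝ)^{−σ} = (p^{−σ})^n`. [folklore] -/
private theorem natCast_pow_rpow_neg {p : ℕ} (hp : 0 < p) (n : ℕ) (σ : ℝ) :
    ((p ^ n : ℕ) : ℝ) ^ (-σ) = ((p : ℝ) ^ (-σ)) ^ n := by
  have hp0 : (0 : ℝ) ≤ p := by positivity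
  rw [Nat.cast_pow, ← Real.rpow_natCast ((p : ℝ) ^ (-σ)) n, ← Real.rpow_mul hp0, mul_comm,
    Real.rpow_mul hp0, Real.rpow_natCast]

/-- For a prime `p` and `σ > 0`: `0 ≤ p^{−σ} < 1`. [folklore] -/
private theorem prime_rpow_neg_lt_one {p : ℕ} (hp : p.Prime) {σ : ℝ} (hσ : 0 < σ) :
    0 ≤ (p : ℝ) ^ (-σ) ∧ (p : ℝ) ^ (-σ) < 1 := by
  have hp1 : (1 : ℝ) < p := by exact_mod_cast hp.one_lt
  refine ⟨Real.rpow_nonneg (by linarith) _, ?_⟩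
  rw [Real.rpow_neg (by linarith)]
  exact inv_lt_one_of_one_lt₀ (Real.one_lt_rpow hp1 hσ)

/-- **(4.5): the split-smooth part is dominated by its Euler product.** For `σ > 0` and `M ≥ 0`:
`Σ_{a ≤ M, a ∈ A₁} g(a) a^{−σ} ≤ ∏_{p ≤ M, χ(p) = 1} (1 − p^{−σ})^{−2}` (`g(p^k) = k + 1` at split
primes, `Σ_k (k+1)x^k = (1 − x)^{−2}`). [cite: Pintz1976ElementaryIII, §4 (4.5) p. 302] -/
theorem sum_split_le_prod (hq : χ ^ 2 = 1) {σ : ℝ} (hσ : 0 < σ) (M : ℕ) :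
    ∑ a ∈ (Ioc 0 M).filter (fun a => ∀ p ∈ a.primeFactors, reChar χ p = 1),
        charDivisorSum χ a * (a : ℝ) ^ (-σ) ≤
      ∏ p ∈ (M + 1).primesBelow.filter (fun p => reChar χ p = 1), (1 - (p : ℝ) ^ (-σ))⁻¹ ^ 2 := by
  classical
  set f : ℕ → ℝ := fun a => if (∀ p ∈ a.primeFactors, reChar χ p = 1) then
      charDivisorSum χ a * (a : ℝ) ^ (-σ) else 0 with hf
  have hf0 : ∀ n, 0 ≤ f n := fun n => by
    simp only [hf]; split_ifs
    · exact mul_nonneg (charDivisorSum_nonneg χ hq n) (Real.rpow_nonneg (Nat.cast_nonneg n) _)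
    · exact le_rfl
  have hf1 : f 1 = 1 := by simp [hf, Nat.not_prime_one]
  have hfmul : ∀ {m n : ℕ}, m.Coprime n → f (m * n) = f m * f n := by
    intro m n hmn
    rcases eq_or_ne m 0 with rfl | hm
    · simp [hf]
    rcases eq_or_ne n 0 with rfl | hn
    · simp [hf]
    simp only [hf]
    rw [(isMultiplicative_charDivisorSum χ hq).map_mul_of_coprime hmn, Nat.cast_mul,
      Real.mul_rpow (Nat.cast_nonneg m) (Nat.cast_nonneg n), Nat.primeFactors_mul hm hn]
    simp only [Finset.mem_union]
    by_cases hPm : ∀ p ∈ m.primeFactors, reChar χ p = 1 <;>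
      by_cases hPn : ∀ p ∈ n.primeFactors, reChar χ p = 1
    · rw [if_pos (by rintro p (hp | hp); exacts [hPm p hp, hPn p hp]), if_pos hPm, if_pos hPn]; ring
    · rw [if_neg (fun h => hPn fun p hp => h p (Or.inr hp)), if_neg hPn]; ring
    · rw [if_neg (fun h => hPm fun p hp => h p (Or.inl hp)), if_neg hPm]; ring
    · rw [if_neg (fun h => hPm fun p hp => h p (Or.inl hp)), if_neg hPm]; ring
  -- local factors
  have hloc : ∀ {p : ℕ}, p.Prime → HasSum (fun n : ℕ => f (p ^ n))
      (if reChar χ p = 1 then (1 - (p : ℝ) ^ (-σ))⁻¹ ^ 2 else 1) := by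
    intro p hp
    obtain ⟨hx0, hx1⟩ := prime_rpow_neg_lt_one hp hσ
    have hfp : ∀ n : ℕ, f (p ^ n) = if reChar χ p = 1 then (n + 1) * ((p : ℝ) ^ (-σ)) ^ n
        else if n = 0 then 1 else 0 := by
      intro n
      rcases eq_or_ne n 0 with rfl | hn
      · simp [hf1]
      simp only [hf, Nat.primeFactors_prime_pow hn hp, Finset.mem_singleton, forall_eq]
      by_cases hc : reChar χ p = 1
      · rw [if_pos hc, if_pos hc, (charDivisorSum_prime_pow_values χ hq hp n).2.2 hc,
          natCast_pow_rpow_neg hp.pos]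
      · rw [if_neg hc, if_neg hc, if_neg hn]
    simp_rw [hfp]
    by_cases hc : reChar χ p = 1
    · simp only [if_pos hc]
      have hxn : ‖(p : ℝ) ^ (-σ)‖ < 1 := by rw [Real.norm_of_nonneg hx0]; exact hx1
      have h3 : HasSum (fun n : ℕ => n * ((p : ℝ) ^ (-σ)) ^ n + ((p : ℝ) ^ (-σ)) ^ n)
          ((p : ℝ) ^ (-σ) / (1 - (p : ℝ) ^ (-σ)) ^ 2 + (1 - (p : ℝ) ^ (-σ))⁻¹) :=
        (hasSum_coe_mul_geometric_of_norm_lt_one hxn).add (hasSum_geometric_of_lt_one hx0 hx1)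
      have he : (p : ℝ) ^ (-σ) / (1 - (p : ℝ) ^ (-σ)) ^ 2 + (1 - (p : ℝ) ^ (-σ))⁻¹ =
          (1 - (p : ℝ) ^ (-σ))⁻¹ ^ 2 := by
        have h1 : 1 - (p : ℝ) ^ (-σ) ≠ 0 := by linarith
        field_simp
        ring
      rw [← he]
      convert h3 using 1
      funext n; ring
    · simp only [if_neg hc]
      convert hasSum_ite_eq 0 (1 : ℝ) using 1
  have hE := (EulerProduct.summable_and_hasSum_smoothNumbers_prod_primesBelow_tsum
    (f := f) hf1 (fun {m n} hmn => hfmul hmn)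
    (fun {p} hp => by
      refine (hloc hp).summable.congr fun n => ?_
      rw [Real.norm_of_nonneg (hf0 _)]) (M + 1)).2
  -- the finite sum is a sub-sum
  have hS : ∑ a ∈ (Ioc 0 M).filter (fun a => ∀ p ∈ a.primeFactors, reChar χ p = 1),
      charDivisorSum χ a * (a : ℝ) ^ (-σ) ≤ ∏ p ∈ (M + 1).primesBelow, ∑' n : ℕ, f (p ^ n) := by
    have hsub : ∀ n ∈ Ioc 0 M, n ∈ Nat.smoothNumbers (M + 1) := fun n hn => by
      rw [Finset.mem_Ioc] at hn
      exact Nat.mem_smoothNumbers_of_lt hn.1 (by omega)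
    have hE' := (hasSum_subtype_iff_indicator (f := f)).mp hE
    have heq : ∑ a ∈ (Ioc 0 M).filter (fun a => ∀ p ∈ a.primeFactors, reChar χ p = 1),
        charDivisorSum χ a * (a : ℝ) ^ (-σ) =
        ∑ n ∈ Ioc 0 M, (Nat.smoothNumbers (M + 1)).indicator f n := by
      rw [Finset.sum_filter]
      refine Finset.sum_congr rfl fun n hn => ?_
      rw [Set.indicator_of_mem (hsub n hn)]
    rw [heq]
    exact sum_le_hasSum _ (fun n _ => Set.indicator_nonneg (fun m _ => hf0 m) _) hE'
  have hfac : ∀ p ∈ (M + 1).primesBelow, ∑' n : ℕ, f (p ^ n) =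
      (if reChar χ p = 1 then (1 - (p : ℝ) ^ (-σ))⁻¹ ^ 2 else 1) := fun p hp =>
    (hloc (Nat.prime_of_mem_primesBelow hp)).tsum_eq
  rw [Finset.prod_congr rfl hfac, ← Finset.prod_filter] at hS
  exact hS

/-- `Σ_n n^{−3/2}`-type tails: for `R ≥ 1`, `Σ_{R < n ≤ M} n^{−2σ} ≤ 2/√R` whenever `σ ≥ 3/4`
(`n^{−3/2} ≤ 2(1/√(n−1) − 1/√n)`, telescoping). [folklore] -/
private theorem sum_Ioc_rpow_le_two_div_sqrt {σ : ℝ} (hσ : 3 / 4 ≤ σ) {R : ℕ} (hR : 1 ≤ R) (M : ℕ) :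
    ∑ n ∈ Ioc R M, (n : ℝ) ^ (-(2 * σ)) ≤ 2 / Real.sqrt R := by
  have hR0 : (0 : ℝ) < R := by exact_mod_cast hR
  -- each term `n^{-2σ} ≤ n^{-3/2} ≤ 2(1/√(n-1) − 1/√n)`
  have hterm : ∀ n ∈ Ioc R M, (n : ℝ) ^ (-(2 * σ)) ≤
      2 * (1 / Real.sqrt ((n : ℝ) - 1) - 1 / Real.sqrt n) := by
    intro n hn
    have hn2 : 2 ≤ n := by have := (mem_Ioc.mp hn).1; omega
    have hn2r : (2 : ℝ) ≤ n := by exact_mod_cast hn2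
    have hn0 : (0 : ℝ) < n := by linarith
    set a := Real.sqrt ((n : ℝ) - 1) with ha
    set b := Real.sqrt n with hb
    have ha0 : 0 < a := Real.sqrt_pos.mpr (by linarith)
    have hb0 : 0 < b := Real.sqrt_pos.mpr hn0
    have ha2 : a ^ 2 = n - 1 := Real.sq_sqrt (by linarith)
    have hb2 : b ^ 2 = n := Real.sq_sqrt hn0.le
    have hab : a ≤ b := Real.sqrt_le_sqrt (by linarith)
    have h1 : (n : ℝ) ^ (-(2 * σ)) ≤ (n : ℝ) ^ (-(3 / 2 : ℝ)) :=
      Real.rpow_le_rpow_of_exponent_le (by linarith) (by linarith)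
    have h2 : (n : ℝ) ^ (-(3 / 2 : ℝ)) = 1 / (b ^ 2 * b) := by
      rw [hb2, Real.rpow_neg hn0.le, show (3 / 2 : ℝ) = 1 + 1 / 2 by norm_num, Real.rpow_add hn0,
        Real.rpow_one, hb, Real.sqrt_eq_rpow, inv_eq_one_div]
    rw [h2] at h1
    refine h1.trans ?_
    have hba : (b - a) * (b + a) = 1 := by nlinarith
    have key : a ≤ 2 * b ^ 2 * (b - a) := by
      have h3 : a * (a + b) ≤ 2 * b ^ 2 := by nlinarith
      have h4 : a = (b - a) * (a * (a + b)) := by linear_combination (-a) * hba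
      have h5 : (b - a) * (a * (a + b)) ≤ (b - a) * (2 * b ^ 2) :=
        mul_le_mul_of_nonneg_left h3 (by linarith)
      linarith [h4, h5]
    rw [show 2 * (1 / a - 1 / b) = 2 * (b - a) / (a * b) by field_simp,
      div_le_div_iff₀ (by positivity) (by positivity)]
    nlinarith [mul_le_mul_of_nonneg_right key hb0.le]
  refine (Finset.sum_le_sum hterm).trans ?_
  rw [← Finset.mul_sum]
  -- telescoping
  have htel : ∑ n ∈ Ioc R M, (1 / Real.sqrt ((n : ℝ) - 1) - 1 / Real.sqrt n) ≤ 1 / Real.sqrt R := by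
    have hIoc : Finset.Ioc R M = Finset.Ico (R + 1) (M + 1) := by
      ext x; simp only [Finset.mem_Ioc, Finset.mem_Ico]; omega
    rw [hIoc, Finset.sum_Ico_eq_sum_range]
    have hg : ∀ k : ℕ, (1 / Real.sqrt (((R + 1 + k : ℕ) : ℝ) - 1) - 1 / Real.sqrt ((R + 1 + k : ℕ) : ℝ)) =
        (fun j : ℕ => 1 / Real.sqrt ((R : ℝ) + j)) k - (fun j : ℕ => 1 / Real.sqrt ((R : ℝ) + j)) (k + 1) := by
      intro k
      simp only []
      push_cast
      ring_nf
    rw [Finset.sum_congr rfl fun k _ => hg k, Finset.sum_range_sub']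
    simp only [Nat.cast_zero, add_zero]
    have : 0 ≤ 1 / Real.sqrt ((R : ℝ) + ((M + 1 - (R + 1) : ℕ) : ℝ)) := by positivity
    linarith
  calc 2 * ∑ n ∈ Ioc R M, (1 / Real.sqrt ((n : ℝ) - 1) - 1 / Real.sqrt n)
      ≤ 2 * (1 / Real.sqrt R) := mul_le_mul_of_nonneg_left htel (by norm_num)
    _ = 2 / Real.sqrt R := by ring

/-- For a real character `χ` mod `D` and a prime `p`: `χ(p) = 0 ⟺ p ∣ D`. [folklore] -/
private theorem reChar_prime_eq_zero_iff' (hq : χ ^ 2 = 1) {p : ℕ} (hp : p.Prime) :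
    reChar χ p = 0 ↔ p ∣ D := by
  rw [reChar_apply χ hp.ne_zero]
  constructor
  · intro h0
    by_contra hnd
    have hu : IsUnit ((p : ℕ) : ZMod D) := (ZMod.isUnit_prime_iff_not_dvd hp).mpr hnd
    have hne : χ (p : ZMod D) ≠ 0 := (hu.map χ).ne_zero
    rcases MulChar.isQuadratic_iff_sq_eq_one.mpr hq (p : ZMod D) with h | h | h
    · exact hne h
    · rw [h] at h0; norm_num at h0
    · rw [h] at h0; norm_num at h0
  · intro hdvd
    have hunit : ¬ IsUnit ((p : ℕ) : ZMod D) := by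
      rw [ZMod.isUnit_prime_iff_not_dvd hp]; exact not_not.mpr hdvd
    rw [χ.map_nonunit hunit, Complex.zero_re]

/-- `Σ'_n n^{−2σ} ≤ 3` for `σ ≥ 3/4` (`1 + Σ_{n ≥ 2} n^{−3/2} ≤ 1 + 2`). [folklore] -/
private theorem tsum_rpow_neg_le_three {σ : ℝ} (hσ : 3 / 4 ≤ σ) :
    ∑' n : ℕ, (n : ℝ) ^ (-(2 * σ)) ≤ 3 := by
  have hne : -(2 * σ) ≠ 0 := by linarith
  have h2 : ∑ i ∈ Finset.range 2, ((i : ℕ) : ℝ) ^ (-(2 * σ)) = 1 := by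
    rw [Finset.sum_range_succ, Finset.sum_range_one, Nat.cast_zero, Real.zero_rpow hne,
      Nat.cast_one, Real.one_rpow, zero_add]
  refine Real.tsum_le_of_sum_range_le (fun n => Real.rpow_nonneg (Nat.cast_nonneg n) _) fun n => ?_
  rcases Nat.lt_or_ge n 2 with hn | hn
  · calc ∑ i ∈ Finset.range n, ((i : ℕ) : ℝ) ^ (-(2 * σ))
        ≤ ∑ i ∈ Finset.range 2, ((i : ℕ) : ℝ) ^ (-(2 * σ)) :=
          Finset.sum_le_sum_of_subset_of_nonneg (Finset.range_mono hn.le)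
            (fun i _ _ => Real.rpow_nonneg (Nat.cast_nonneg i) _)
      _ = 1 := h2
      _ ≤ 3 := by norm_num
  · rw [Finset.range_eq_Ico, ← Finset.sum_Ico_consecutive _ (Nat.zero_le 2) hn,
      ← Finset.range_eq_Ico, h2]
    have hIco : Finset.Ico 2 n = Finset.Ioc 1 (n - 1) := by
      ext x; simp only [Finset.mem_Ico, Finset.mem_Ioc]; omega
    rw [hIco]
    have := sum_Ioc_rpow_le_two_div_sqrt hσ le_rfl (n - 1)
    rw [Nat.cast_one, Real.sqrt_one, div_one] at this
    linarith

/-- **(4.16): the split-free part is dominated by its Euler product.** For `σ ≥ 3/4` and `N ≥ 0`: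
`Σ_{r ≤ N, r ∈ R} g(r) r^{−σ} ≤ 3 ∏_{p ∣ D}(1 − p^{−σ})^{−1}` (local factors `(1 − p^{−σ})^{−1}` at
the ramified primes, `(1 − p^{−2σ})^{−1}` at the inert ones, whose product is `≤ Σ_n n^{−2σ} ≤ 3`).
[cite: Pintz1976ElementaryIII, §4 (4.16) p. 304] -/
theorem sum_free_le_prod [NeZero D] (hq : χ ^ 2 = 1) {σ : ℝ} (hσ : 3 / 4 ≤ σ) (N : ℕ) :
    ∑ r ∈ (Ioc 0 N).filter (fun r => ∀ p ∈ r.primeFactors, reChar χ p ≠ 1),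
        charDivisorSum χ r * (r : ℝ) ^ (-σ) ≤
      3 * ∏ p ∈ D.primeFactors, (1 - (p : ℝ) ^ (-σ))⁻¹ := by
  classical
  have hσ0 : 0 < σ := by linarith
  set f : ℕ → ℝ := fun a => if (∀ p ∈ a.primeFactors, reChar χ p ≠ 1) then
      charDivisorSum χ a * (a : ℝ) ^ (-σ) else 0 with hf
  have hf0 : ∀ n, 0 ≤ f n := fun n => by
    simp only [hf]; split_ifs
    · exact mul_nonneg (charDivisorSum_nonneg χ hq n) (Real.rpow_nonneg (Nat.cast_nonneg n) _)
    · exact le_rfl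
  have hf1 : f 1 = 1 := by simp [hf, Nat.not_prime_one]
  have hfmul : ∀ {m n : ℕ}, m.Coprime n → f (m * n) = f m * f n := by
    intro m n hmn
    rcases eq_or_ne m 0 with rfl | hm
    · simp [hf]
    rcases eq_or_ne n 0 with rfl | hn
    · simp [hf]
    simp only [hf]
    rw [(isMultiplicative_charDivisorSum χ hq).map_mul_of_coprime hmn, Nat.cast_mul,
      Real.mul_rpow (Nat.cast_nonneg m) (Nat.cast_nonneg n), Nat.primeFactors_mul hm hn]
    simp only [Finset.mem_union]
    by_cases hPm : ∀ p ∈ m.primeFactors, reChar χ p ≠ 1 <;>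
      by_cases hPn : ∀ p ∈ n.primeFactors, reChar χ p ≠ 1
    · rw [if_pos (by rintro p (hp | hp); exacts [hPm p hp, hPn p hp]), if_pos hPm, if_pos hPn]; ring
    · rw [if_neg (fun h => hPn fun p hp => h p (Or.inr hp)), if_neg hPn]; ring
    · rw [if_neg (fun h => hPm fun p hp => h p (Or.inl hp)), if_neg hPm]; ring
    · rw [if_neg (fun h => hPm fun p hp => h p (Or.inl hp)), if_neg hPm]; ring
  -- local factors `L_p`
  have hloc : ∀ {p : ℕ}, p.Prime → HasSum (fun n : ℕ => f (p ^ n))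
      ((if reChar χ p = 0 then (1 - (p : ℝ) ^ (-σ))⁻¹ else 1) *
        (if reChar χ p = -1 then (1 - ((p : ℝ) ^ (-σ)) ^ 2)⁻¹ else 1)) := by
    intro p hp
    obtain ⟨hx0, hx1⟩ := prime_rpow_neg_lt_one hp hσ0
    have hvals := charDivisorSum_prime_pow_values χ hq hp
    have hfp : ∀ n : ℕ, n ≠ 0 → f (p ^ n) = if reChar χ p ≠ 1 then
        charDivisorSum χ (p ^ n) * ((p : ℝ) ^ (-σ)) ^ n else 0 := by
      intro n hn
      simp only [hf, Nat.primeFactors_prime_pow hn hp, Finset.mem_singleton, forall_eq]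
      rw [natCast_pow_rpow_neg hp.pos]
    rcases reChar_trichotomy χ hq p with hc | hc | hc
    · -- ramified: geometric series
      rw [if_pos hc, if_neg (by rw [hc]; norm_num), mul_one]
      have hF : (fun n : ℕ => f (p ^ n)) = fun n : ℕ => ((p : ℝ) ^ (-σ)) ^ n := by
        funext n
        rcases eq_or_ne n 0 with rfl | hn
        · simp [hf1]
        · rw [hfp n hn, if_pos (by rw [hc]; norm_num), (hvals n).1 hc, one_mul]
      rw [hF]; exact hasSum_geometric_of_lt_one hx0 hx1
    · -- split: only `n = 0`
      rw [if_neg (by rw [hc]; norm_num), if_neg (by rw [hc]; norm_num), mul_one]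
      have hF : (fun n : ℕ => f (p ^ n)) = fun n : ℕ => if n = 0 then (1 : ℝ) else 0 := by
        funext n
        rcases eq_or_ne n 0 with rfl | hn
        · simp [hf1]
        · rw [hfp n hn, if_neg (not_not.mpr hc), if_neg hn]
      rw [hF]; exact hasSum_ite_eq 0 1
    · -- inert: even powers
      rw [if_neg (by rw [hc]; norm_num), if_pos hc, one_mul]
      have hF : ∀ n : ℕ, f (p ^ n) = if Even n then ((p : ℝ) ^ (-σ)) ^ n else 0 := by
        intro n
        rcases eq_or_ne n 0 with rfl | hn
        · simp [hf1]
        · rw [hfp n hn, if_pos (by rw [hc]; norm_num), (hvals n).2.1 hc]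
          split_ifs <;> simp
      have he : HasSum (fun k : ℕ => f (p ^ (2 * k))) (1 - ((p : ℝ) ^ (-σ)) ^ 2)⁻¹ := by
        have hF' : (fun k : ℕ => f (p ^ (2 * k))) = fun k : ℕ => (((p : ℝ) ^ (-σ)) ^ 2) ^ k := by
          funext k; rw [hF, if_pos (even_two_mul k), pow_mul]
        rw [hF']
        exact hasSum_geometric_of_lt_one (pow_nonneg hx0 2) (pow_lt_one₀ hx0 hx1 two_ne_zero)
      have ho : HasSum (fun k : ℕ => f (p ^ (2 * k + 1))) 0 := by
        have hF' : (fun k : ℕ => f (p ^ (2 * k + 1))) = fun _ : ℕ => (0 : ℝ) := by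
          funext k; rw [hF, if_neg (by rw [Nat.even_add_one, not_not]; exact even_two_mul k)]
        rw [hF']; exact hasSum_zero
      have := HasSum.even_add_odd (f := fun n : ℕ => f (p ^ n)) he ho
      rwa [add_zero] at this
  have hE := (EulerProduct.summable_and_hasSum_smoothNumbers_prod_primesBelow_tsum
    (f := f) hf1 (fun {m n} hmn => hfmul hmn)
    (fun {p} hp => by
      refine (hloc hp).summable.congr fun n => ?_
      rw [Real.norm_of_nonneg (hf0 _)]) (N + 1)).2
  -- the finite sum is a sub-sum
  have hS : ∑ r ∈ (Ioc 0 N).filter (fun r => ∀ p ∈ r.primeFactors, reChar χ p ≠ 1),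
      charDivisorSum χ r * (r : ℝ) ^ (-σ) ≤ ∏ p ∈ (N + 1).primesBelow, ∑' n : ℕ, f (p ^ n) := by
    have hsub : ∀ n ∈ Ioc 0 N, n ∈ Nat.smoothNumbers (N + 1) := fun n hn => by
      rw [Finset.mem_Ioc] at hn
      exact Nat.mem_smoothNumbers_of_lt hn.1 (by omega)
    have hE' := (hasSum_subtype_iff_indicator (f := f)).mp hE
    have heq : ∑ r ∈ (Ioc 0 N).filter (fun r => ∀ p ∈ r.primeFactors, reChar χ p ≠ 1),
        charDivisorSum χ r * (r : ℝ) ^ (-σ) =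
        ∑ n ∈ Ioc 0 N, (Nat.smoothNumbers (N + 1)).indicator f n := by
      rw [Finset.sum_filter]
      refine Finset.sum_congr rfl fun n hn => ?_
      rw [Set.indicator_of_mem (hsub n hn)]
    rw [heq]
    exact sum_le_hasSum _ (fun n _ => Set.indicator_nonneg (fun m _ => hf0 m) _) hE'
  have hfac : ∀ p ∈ (N + 1).primesBelow, ∑' n : ℕ, f (p ^ n) =
      (if reChar χ p = 0 then (1 - (p : ℝ) ^ (-σ))⁻¹ else 1) *
        (if reChar χ p = -1 then (1 - ((p : ℝ) ^ (-σ)) ^ 2)⁻¹ else 1) := fun p hp =>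
    (hloc (Nat.prime_of_mem_primesBelow hp)).tsum_eq
  rw [Finset.prod_congr rfl hfac, Finset.prod_mul_distrib] at hS
  -- the ramified factor: `≤ ∏_{p ∣ D} (1 − p^{−σ})^{−1}`
  have hfac1 : ∀ {p : ℕ}, p.Prime → 1 ≤ (1 - (p : ℝ) ^ (-σ))⁻¹ := by
    intro p hp
    obtain ⟨hx0, hx1⟩ := prime_rpow_neg_lt_one hp hσ0
    rw [← one_div]; exact one_le_one_div (by linarith) (by linarith)
  have hram : ∏ p ∈ (N + 1).primesBelow, (if reChar χ p = 0 then (1 - (p : ℝ) ^ (-σ))⁻¹ else 1) ≤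
      ∏ p ∈ D.primeFactors, (1 - (p : ℝ) ^ (-σ))⁻¹ := by
    set S := (N + 1).primesBelow.filter (fun p => reChar χ p = 0) with hS_def
    have hsub : S ⊆ D.primeFactors := by
      intro p hp
      obtain ⟨hp', hc⟩ := Finset.mem_filter.mp hp
      have hpp := Nat.prime_of_mem_primesBelow hp'
      exact Nat.mem_primeFactors.mpr ⟨hpp, (reChar_prime_eq_zero_iff' χ hq hpp).mp hc, NeZero.ne D⟩
    calc ∏ p ∈ (N + 1).primesBelow, (if reChar χ p = 0 then (1 - (p : ℝ) ^ (-σ))⁻¹ else 1)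
        = ∏ p ∈ S, (1 - (p : ℝ) ^ (-σ))⁻¹ := (Finset.prod_filter _ _).symm
      _ = ∏ p ∈ D.primeFactors.filter (· ∈ S), (1 - (p : ℝ) ^ (-σ))⁻¹ := by
          rw [Finset.filter_mem_eq_inter, Finset.inter_eq_right.mpr hsub]
      _ = ∏ p ∈ D.primeFactors, (if p ∈ S then (1 - (p : ℝ) ^ (-σ))⁻¹ else 1) :=
          Finset.prod_filter _ _
      _ ≤ ∏ p ∈ D.primeFactors, (1 - (p : ℝ) ^ (-σ))⁻¹ := by
          refine Finset.prod_le_prod (fun p hp => ?_) (fun p hp => ?_)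
          · split_ifs
            · exact le_trans zero_le_one (hfac1 (Nat.prime_of_mem_primeFactors hp))
            · exact zero_le_one
          · split_ifs
            · exact le_rfl
            · exact hfac1 (Nat.prime_of_mem_primeFactors hp)
  -- the inert factor: `≤ ∏_{p < N+1} (1 − p^{−2σ})^{−1} ≤ Σ_n n^{−2σ} ≤ 3`
  have hgeom : ∀ {p : ℕ}, p.Prime →
      HasSum (fun n : ℕ => (((p ^ n : ℕ) : ℝ)) ^ (-(2 * σ))) (1 - ((p : ℝ) ^ (-σ)) ^ 2)⁻¹ := by
    intro p hp
    obtain ⟨hx0, hx1⟩ := prime_rpow_neg_lt_one hp hσ0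
    have hF : (fun n : ℕ => (((p ^ n : ℕ) : ℝ)) ^ (-(2 * σ))) = fun n : ℕ => (((p : ℝ) ^ (-σ)) ^ 2) ^ n := by
      funext n
      rw [natCast_pow_rpow_neg hp.pos]
      congr 1
      rw [← Real.rpow_natCast ((p : ℝ) ^ (-σ)) 2, ← Real.rpow_mul (Nat.cast_nonneg p)]
      congr 1; push_cast; ring
    rw [hF]
    exact hasSum_geometric_of_lt_one (pow_nonneg hx0 2) (pow_lt_one₀ hx0 hx1 two_ne_zero)
  have hinert : ∏ p ∈ (N + 1).primesBelow, (if reChar χ p = -1 then (1 - ((p : ℝ) ^ (-σ)) ^ 2)⁻¹ else 1)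
      ≤ 3 := by
    have hfac2 : ∀ {p : ℕ}, p.Prime → 1 ≤ (1 - ((p : ℝ) ^ (-σ)) ^ 2)⁻¹ := by
      intro p hp
      obtain ⟨hx0, hx1⟩ := prime_rpow_neg_lt_one hp hσ0
      have : ((p : ℝ) ^ (-σ)) ^ 2 < 1 := pow_lt_one₀ hx0 hx1 two_ne_zero
      rw [← one_div]; exact one_le_one_div (by nlinarith) (by nlinarith)
    have h1 : ∏ p ∈ (N + 1).primesBelow, (if reChar χ p = -1 then (1 - ((p : ℝ) ^ (-σ)) ^ 2)⁻¹ else 1)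
        ≤ ∏ p ∈ (N + 1).primesBelow, (1 - ((p : ℝ) ^ (-σ)) ^ 2)⁻¹ := by
      refine Finset.prod_le_prod (fun p hp => ?_) (fun p hp => ?_)
      · split_ifs
        · exact le_trans zero_le_one (hfac2 (Nat.prime_of_mem_primesBelow hp))
        · exact zero_le_one
      · split_ifs
        · exact le_rfl
        · exact hfac2 (Nat.prime_of_mem_primesBelow hp)
    have hE2 := EulerProduct.summable_and_hasSum_smoothNumbers_prod_primesBelow_tsum
      (f := fun n : ℕ => (n : ℝ) ^ (-(2 * σ))) (by simp)
      (fun {m n} _ => by rw [Nat.cast_mul, Real.mul_rpow (Nat.cast_nonneg m) (Nat.cast_nonneg n)])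
      (fun {p} hp => by
        refine (hgeom hp).summable.congr fun n => ?_
        rw [Real.norm_of_nonneg (Real.rpow_nonneg (Nat.cast_nonneg _) _)]) (N + 1)
    have hfac3 : ∀ p ∈ (N + 1).primesBelow, ∑' n : ℕ, (((p ^ n : ℕ) : ℝ)) ^ (-(2 * σ)) =
        (1 - ((p : ℝ) ^ (-σ)) ^ 2)⁻¹ := fun p hp => (hgeom (Nat.prime_of_mem_primesBelow hp)).tsum_eq
    have hsum : Summable (fun n : ℕ => (n : ℝ) ^ (-(2 * σ))) :=
      Real.summable_nat_rpow.mpr (by linarith)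
    calc _ ≤ ∏ p ∈ (N + 1).primesBelow, (1 - ((p : ℝ) ^ (-σ)) ^ 2)⁻¹ := h1
      _ = ∏ p ∈ (N + 1).primesBelow, ∑' n : ℕ, (((p ^ n : ℕ) : ℝ)) ^ (-(2 * σ)) :=
          (Finset.prod_congr rfl hfac3).symm
      _ = ∑' m : (N + 1).smoothNumbers, ((m : ℕ) : ℝ) ^ (-(2 * σ)) := hE2.2.tsum_eq.symm
      _ ≤ ∑' m : ℕ, (m : ℝ) ^ (-(2 * σ)) :=
          Summable.tsum_subtype_le (fun n : ℕ => (n : ℝ) ^ (-(2 * σ))) _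
            (fun n => Real.rpow_nonneg (Nat.cast_nonneg n) _) hsum
      _ ≤ 3 := tsum_rpow_neg_le_three hσ
  have hP0 : 0 ≤ ∏ p ∈ D.primeFactors, (1 - (p : ℝ) ^ (-σ))⁻¹ :=
    Finset.prod_nonneg fun p hp => le_trans zero_le_one (hfac1 (Nat.prime_of_mem_primeFactors hp))
  have hI0 : 0 ≤ ∏ p ∈ (N + 1).primesBelow,
      (if reChar χ p = 0 then (1 - (p : ℝ) ^ (-σ))⁻¹ else 1) :=
    Finset.prod_nonneg fun p hp => by
      split_ifs
      · exact le_trans zero_le_one (hfac1 (Nat.prime_of_mem_primesBelow hp))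
      · exact zero_le_one
  calc _ ≤ _ := hS
    _ ≤ (∏ p ∈ D.primeFactors, (1 - (p : ℝ) ^ (-σ))⁻¹) * 3 :=
        mul_le_mul hram hinert (Finset.prod_nonneg fun p hp => by
          split_ifs
          · obtain ⟨hx0, hx1⟩ := prime_rpow_neg_lt_one (Nat.prime_of_mem_primesBelow hp) hσ0
            have : ((p : ℝ) ^ (-σ)) ^ 2 < 1 := pow_lt_one₀ hx0 hx1 two_ne_zero
            exact inv_nonneg.mpr (by linarith)
          · exact zero_le_one) hP0
    _ = 3 * ∏ p ∈ D.primeFactors, (1 - (p : ℝ) ^ (-σ))⁻¹ := mul_comm _ _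

end EulerBounds

/-! ## Part R. The split primes `Σ_{p ≤ y, χ(p)=1} p^{−σ}` ((4.6)–(4.13)) -/

section SplitPrimeSumsK

open Literature.NumberTheory.QuadraticFields

variable {K : Type} [Field K] [NumberField K] {D : ℕ} [NeZero D] (χ : DirichletCharacter ℂ D)

omit [NeZero D] in
/-- `reChar χ n = 1 ↔ χ(n) = 1` for `n ≥ 1` (quadratic `χ`). [folklore] -/
private theorem reChar_eq_one_iff_apply (hq : χ ^ 2 = 1) {n : ℕ} (hn : n ≠ 0) :
    reChar χ n = 1 ↔ χ (n : ZMod D) = 1 := by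
  rw [← ofReal_reChar χ hq hn]
  constructor
  · intro h; rw [h]; simp
  · intro h; exact_mod_cast h

/-- **(3.3) of part II as a real inequality**: a split prime `p` (`χ(p) = 1`) exceeds
`(D/4)^{1/(2h)}`, `h = h_K` (`D < 4p^{2h}`, `lt_four_mul_pow_classNumber_sq`).
[cite: Pintz1976ElementaryIII, §4 (4.7) p. 302] -/
theorem root_lt_splitPrime (h2 : Module.finrank ℚ K = 2)
    (hd : NumberField.discr K < 0) (hKD : (NumberField.discr K).natAbs = D)
    (hprim : χ.IsPrimitive) (hquad : χ.IsQuadratic) (hodd : χ.Odd) {p : ℕ} (hp : p.Prime)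
    (h1 : reChar χ p = 1) :
    ((D : ℝ) / 4) ^ (1 / (2 * (NumberField.classNumber K : ℝ))) < p := by
  have hq : χ ^ 2 = 1 := MulChar.IsQuadratic.sq_eq_one hquad
  have hχ : χ (p : ZMod D) = 1 := (reChar_eq_one_iff_apply χ hq hp.ne_zero).mp h1
  have hh0 : 0 < NumberField.classNumber K := NumberField.classNumber_pos K
  have hlt := lt_four_mul_pow_classNumber_sq h2 hd hKD hprim hquad hodd hp hχ
  have hp0 : (0 : ℝ) < p := by exact_mod_cast hp.pos
  have hltr : (D : ℝ) / 4 < (p : ℝ) ^ (2 * NumberField.classNumber K) := by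
    have : (D : ℝ) < 4 * ((p : ℝ) ^ NumberField.classNumber K) ^ 2 := by exact_mod_cast hlt
    rw [pow_mul']; linarith
  have h2h : 2 * NumberField.classNumber K ≠ 0 := by omega
  have hz : 0 < 1 / (2 * (NumberField.classNumber K : ℝ)) := by positivity
  have hexq : (1 : ℝ) / (2 * (NumberField.classNumber K : ℝ)) =
      ((2 * NumberField.classNumber K : ℕ) : ℝ)⁻¹ := by push_cast; ring
  have := Real.rpow_lt_rpow (by positivity) hltr hz
  rw [hexq, Real.pow_rpow_inv_natCast hp0.le h2h] at this
  rwa [hexq]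

/-- **(4.7), weighted (3.4)**: the split primes `p ≤ √D/2` (`4p² ≤ D`) number at most `h = h_K`
((3.2), `card_le_classNumber_of_splitFactors`) and each exceeds `(D/4)^{1/(2h)}` ((3.3),
`lt_four_mul_pow_classNumber_sq`), so `Σ_{p ≤ √D/2, χ(p)=1} p^{−σ} ≤ h (4/D)^{σ/(2h)}` (`σ > 0`).
[cite: Pintz1976ElementaryIII, §4 (4.7) p. 302] -/
theorem sum_rpow_smallSplitPrimes_le (h2 : Module.finrank ℚ K = 2)
    (hd : NumberField.discr K < 0) (hKD : (NumberField.discr K).natAbs = D)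
    (hprim : χ.IsPrimitive) (hquad : χ.IsQuadratic) (hodd : χ.Odd) {σ : ℝ} (hσ : 0 < σ)
    (P : Finset ℕ) (hP : ∀ p ∈ P, p.Prime ∧ 4 * p ^ 2 ≤ D ∧ reChar χ p = 1) :
    ∑ p ∈ P, (p : ℝ) ^ (-σ) ≤
      (NumberField.classNumber K : ℝ) *
        (4 / (D : ℝ)) ^ (σ / (2 * (NumberField.classNumber K : ℝ))) := by
  have hq : χ ^ 2 = 1 := MulChar.IsQuadratic.sq_eq_one hquad
  have hh0 : 0 < NumberField.classNumber K := NumberField.classNumber_pos K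
  have hD0 : (0 : ℝ) < D := by exact_mod_cast NeZero.pos D
  have hb0 : 0 ≤ (4 / (D : ℝ)) ^ (σ / (2 * (NumberField.classNumber K : ℝ))) :=
    Real.rpow_nonneg (by positivity) _
  have hP' : ∀ p ∈ P, p.Prime ∧ 4 * p ^ 2 ≤ D ∧ χ (p : ZMod D) = 1 := fun p hp =>
    ⟨(hP p hp).1, (hP p hp).2.1, (reChar_eq_one_iff_apply χ hq (hP p hp).1.ne_zero).mp (hP p hp).2.2⟩
  -- at most `h` primes
  have hcard : P.card ≤ NumberField.classNumber K := by
    refine card_le_classNumber_of_splitFactors h2 hd hKD hprim hquad hodd P fun p hp => ?_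
    obtain ⟨hpp, hle, hχ⟩ := hP' p hp
    refine ⟨hpp.pos, hle, fun q hq' => ?_⟩
    obtain ⟨hqp, hqdvd, -⟩ := Nat.mem_primeFactors.mp hq'
    rw [(Nat.prime_dvd_prime_iff_eq hqp hpp).mp hqdvd]
    exact hχ
  -- each `p^{-σ} ≤ (4/D)^{σ/(2h)}`
  have hterm : ∀ p ∈ P, (p : ℝ) ^ (-σ) ≤
      (4 / (D : ℝ)) ^ (σ / (2 * (NumberField.classNumber K : ℝ))) := by
    intro p hp
    have hroot := root_lt_splitPrime χ h2 hd hKD hprim hquad hodd (hP p hp).1 (hP p hp).2.2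
    have hpos : 0 < ((D : ℝ) / 4) ^ (1 / (2 * (NumberField.classNumber K : ℝ))) :=
      Real.rpow_pos_of_pos (by positivity) _
    calc (p : ℝ) ^ (-σ)
        ≤ (((D : ℝ) / 4) ^ (1 / (2 * (NumberField.classNumber K : ℝ)))) ^ (-σ) :=
          Real.rpow_le_rpow_of_nonpos hpos hroot.le (by linarith)
      _ = (4 / (D : ℝ)) ^ (σ / (2 * (NumberField.classNumber K : ℝ))) := by
          rw [← Real.rpow_mul (by positivity),
            show 1 / (2 * (NumberField.classNumber K : ℝ)) * -σ =
              -(σ / (2 * (NumberField.classNumber K : ℝ))) by ring,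
            Real.rpow_neg (by positivity), ← Real.inv_rpow (by positivity), inv_div]
  calc ∑ p ∈ P, (p : ℝ) ^ (-σ)
      ≤ P.card • (4 / (D : ℝ)) ^ (σ / (2 * (NumberField.classNumber K : ℝ))) :=
        Finset.sum_le_card_nsmul _ _ _ hterm
    _ = (P.card : ℝ) * (4 / (D : ℝ)) ^ (σ / (2 * (NumberField.classNumber K : ℝ))) := by
        rw [nsmul_eq_mul]
    _ ≤ (NumberField.classNumber K : ℝ) *
        (4 / (D : ℝ)) ^ (σ / (2 * (NumberField.classNumber K : ℝ))) :=
        mul_le_mul_of_nonneg_right (by exact_mod_cast hcard) hb0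

end SplitPrimeSumsK


section SplitPrimeSums

variable {D : ℕ} [NeZero D] (χ : DirichletCharacter ℂ D)

omit [NeZero D] in
/-- `Σ_{d ∣ n} χ(d) = g(n)` as a complex number (real character). [folklore] -/
private theorem sum_divisors_eq_charDivisorSum (hq : χ ^ 2 = 1) (n : ℕ) :
    (∑ d ∈ n.divisors, χ (d : ZMod D)) = ((charDivisorSum χ n : ℝ) : ℂ) := by
  rw [charDivisorSum_apply, Complex.ofReal_sum]
  refine sum_congr rfl fun d hd => ?_
  rw [ofReal_reChar χ hq (Nat.pos_of_mem_divisors hd).ne']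

/-- **(4.9), left-hand side, weighted**: for a finite set `P` of primes with `χ(p) = 1` whose pairwise
products lie in `(N₁, N₂]`, `(Σ_{p∈P} p^{−σ})² ≤ Σ_{N₁ < n ≤ N₂} g(n) n^{−σ}`.
[cite: Pintz1976ElementaryIII, §4 (4.9) p. 302] -/
theorem sq_sum_rpow_le_sum_g_rpow (hq : χ ^ 2 = 1) {P : Finset ℕ} (hP : ∀ p ∈ P, p.Prime)
    (hχP : ∀ p ∈ P, reChar χ p = 1) {N₁ N₂ : ℕ}
    (hprod : ∀ p ∈ P, ∀ p' ∈ P, N₁ < p * p' ∧ p * p' ≤ N₂) (σ : ℝ) :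
    (∑ p ∈ P, (p : ℝ) ^ (-σ)) ^ 2 ≤
      ∑ n ∈ Finset.Ioc N₁ N₂, charDivisorSum χ n * (n : ℝ) ^ (-σ) := by
  classical
  have hmaps : ∀ x ∈ P ×ˢ P, x.1 * x.2 ∈ Finset.Ioc N₁ N₂ := by
    intro x hx
    rw [Finset.mem_product] at hx
    rw [Finset.mem_Ioc]
    exact hprod _ hx.1 _ hx.2
  calc (∑ p ∈ P, (p : ℝ) ^ (-σ)) ^ 2
      = ∑ x ∈ P ×ˢ P, (((x.1 * x.2 : ℕ) : ℝ)) ^ (-σ) := by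
        rw [pow_two, sum_mul_sum, sum_product]
        refine sum_congr rfl fun p _ => sum_congr rfl fun p' _ => ?_
        push_cast
        rw [Real.mul_rpow (Nat.cast_nonneg p) (Nat.cast_nonneg p')]
    _ = ∑ n ∈ Finset.Ioc N₁ N₂, ∑ x ∈ P ×ˢ P with x.1 * x.2 = n, ((n : ℕ) : ℝ) ^ (-σ) :=
        (sum_fiberwise_of_maps_to' hmaps (fun n : ℕ => (n : ℝ) ^ (-σ))).symm
    _ = ∑ n ∈ Finset.Ioc N₁ N₂, (#{x ∈ P ×ˢ P | x.1 * x.2 = n} : ℝ) * ((n : ℝ) ^ (-σ)) := by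
        refine sum_congr rfl fun n _ => ?_
        rw [sum_const, nsmul_eq_mul]
    _ ≤ ∑ n ∈ Finset.Ioc N₁ N₂, charDivisorSum χ n * (n : ℝ) ^ (-σ) := by
        refine sum_le_sum fun n _ => ?_
        have h := card_filter_mul_eq_le_g χ hq hP hχP n
        rw [g_eq_charDivisorSum] at h
        exact mul_le_mul_of_nonneg_right h (Real.rpow_nonneg (Nat.cast_nonneg n) _)

/-- **Lemma 4 at a real point, differenced**: with `s₀ = 1 − τ₀` real, `0 < τ₀ ≤ 1/2`, and
`x₁ ≤ x₂` both `≥ A√D` (`A = max(1, 1/τ₀)`), the `L(s₀)ζ(s₀)` terms cancel and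
`Σ_{x₁ < n ≤ x₂} g(n) n^{−(1−τ₀)} ≤ L(1) x₂^{τ₀}/τ₀ + C₄ (F(x₁) + F(x₂))`,
`F(x) = x^{τ₀} D^{1/4} √A log D log x/√x`. ("Now applying Lemma 4 which for real `s` is Lemma 2 of
[6] … with the values `x₁ = D/4`, `x₂ = D²`, subtracting the two equalities", p. 302–303.)
[cite: Pintz1976ElementaryIII, §4 (4.10), (4.12) pp. 302–303] -/
theorem sum_Ioc_g_rpow_le_of_lemma4 (hq : χ ^ 2 = 1) {C₄ : ℝ}
    (hL4 : ∀ s : ℂ, s ≠ 1 → 0 ≤ 1 - s.re → 1 - s.re ≤ 1 / 2 →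
      ∀ x : ℝ, ‖s‖ ^ 2 * max 1 (1 / ‖1 - s‖) * Real.sqrt D ≤ x →
        ‖(∑ n ∈ Icc 1 ⌊x⌋₊, (∑ d ∈ n.divisors, χ (d : ZMod D)) * (n : ℂ) ^ (-s)) -
            χ.LFunction s * riemannZeta s - χ.LFunction 1 * (x : ℂ) ^ (1 - s) / (1 - s)‖ ≤
          C₄ * (x ^ (1 - s.re) * ‖s‖ * (D : ℝ) ^ (1 / 4 : ℝ) * Real.sqrt (max 1 (1 / ‖1 - s‖)) *
            Real.log D * Real.log x / Real.sqrt x))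
    {L1 : ℝ} (hL1 : χ.LFunction 1 = (L1 : ℂ)) (hL10 : 0 ≤ L1)
    {τ₀ : ℝ} (hτ0 : 0 < τ₀) (hτhalf : τ₀ ≤ 1 / 2) {x₁ x₂ : ℝ}
    (hx₁ : max 1 (1 / τ₀) * Real.sqrt D ≤ x₁) (hx₁₂ : x₁ ≤ x₂) (hx₁pos : 1 ≤ x₁) :
    ∑ n ∈ Finset.Ioc ⌊x₁⌋₊ ⌊x₂⌋₊, charDivisorSum χ n * (n : ℝ) ^ (-(1 - τ₀)) ≤
      L1 * x₂ ^ τ₀ / τ₀ +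
        |C₄| * ((x₁ ^ τ₀ * (D : ℝ) ^ (1 / 4 : ℝ) * Real.sqrt (max 1 (1 / τ₀)) * Real.log D *
            Real.log x₁ / Real.sqrt x₁) +
          (x₂ ^ τ₀ * (D : ℝ) ^ (1 / 4 : ℝ) * Real.sqrt (max 1 (1 / τ₀)) * Real.log D *
            Real.log x₂ / Real.sqrt x₂)) := by
  set s₀ : ℂ := ((1 - τ₀ : ℝ) : ℂ) with hs₀
  have hs₀re : s₀.re = 1 - τ₀ := by simp [hs₀]
  have hs₀1 : s₀ ≠ 1 := by
    intro h
    have h1 : s₀.re = 1 := by rw [h, Complex.one_re]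
    rw [hs₀re] at h1
    linarith
  have h1s : 1 - s₀ = ((τ₀ : ℝ) : ℂ) := by simp [hs₀]
  have hnorm1s : ‖1 - s₀‖ = τ₀ := by rw [h1s, Complex.norm_real, Real.norm_eq_abs, abs_of_pos hτ0]
  have hnorms : ‖s₀‖ = 1 - τ₀ := by
    rw [hs₀, Complex.norm_real, Real.norm_eq_abs, abs_of_nonneg (by linarith)]
  have hnorms1 : ‖s₀‖ ≤ 1 := by rw [hnorms]; linarith
  have hτre : 1 - s₀.re = τ₀ := by rw [hs₀re]; ring
  have hx₂pos : 1 ≤ x₂ := hx₁pos.trans hx₁₂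
  -- Lemma 4 hypotheses at `x₁`, `x₂`
  have hA : max 1 (1 / ‖1 - s₀‖) = max 1 (1 / τ₀) := by rw [hnorm1s]
  have hhyp : ∀ x : ℝ, max 1 (1 / τ₀) * Real.sqrt D ≤ x →
      ‖s₀‖ ^ 2 * max 1 (1 / ‖1 - s₀‖) * Real.sqrt D ≤ x := by
    intro x hx
    rw [hA]
    have hM : 0 ≤ max 1 (1 / τ₀) * Real.sqrt D :=
      mul_nonneg (le_trans zero_le_one (le_max_left _ _)) (Real.sqrt_nonneg _)
    have hsq : ‖s₀‖ ^ 2 ≤ 1 := by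
      calc ‖s₀‖ ^ 2 ≤ 1 ^ 2 := pow_le_pow_left₀ (norm_nonneg _) hnorms1 2
        _ = 1 := one_pow 2
    calc ‖s₀‖ ^ 2 * max 1 (1 / τ₀) * Real.sqrt D = ‖s₀‖ ^ 2 * (max 1 (1 / τ₀) * Real.sqrt D) := by
          ring
      _ ≤ 1 * (max 1 (1 / τ₀) * Real.sqrt D) := mul_le_mul_of_nonneg_right hsq hM
      _ = max 1 (1 / τ₀) * Real.sqrt D := one_mul _
      _ ≤ x := hx
  have h₁ := hL4 s₀ hs₀1 (by rw [hτre]; exact hτ0.le) (by rw [hτre]; exact hτhalf) x₁ (hhyp x₁ hx₁)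
  have h₂ := hL4 s₀ hs₀1 (by rw [hτre]; exact hτ0.le) (by rw [hτre]; exact hτhalf) x₂
    (hhyp x₂ (hx₁.trans hx₁₂))
  rw [hτre, hA] at h₁ h₂
  -- the real sums
  have hreal : ∀ N : ℕ, (∑ n ∈ Icc 1 N, (∑ d ∈ n.divisors, χ (d : ZMod D)) * (n : ℂ) ^ (-s₀)) =
      ((∑ n ∈ Icc 1 N, charDivisorSum χ n * (n : ℝ) ^ (-(1 - τ₀)) : ℝ) : ℂ) := by
    intro N
    rw [Complex.ofReal_sum]
    refine sum_congr rfl fun n hn => ?_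
    have hn0 : (0 : ℝ) ≤ n := Nat.cast_nonneg n
    rw [sum_divisors_eq_charDivisorSum χ hq, Complex.ofReal_mul, hs₀, ← Complex.ofReal_neg,
      ← Complex.ofReal_natCast, ← Complex.ofReal_cpow hn0]
  -- subtracting
  set S₁ := ∑ n ∈ Icc 1 ⌊x₁⌋₊, charDivisorSum χ n * (n : ℝ) ^ (-(1 - τ₀)) with hS₁
  set S₂ := ∑ n ∈ Icc 1 ⌊x₂⌋₊, charDivisorSum χ n * (n : ℝ) ^ (-(1 - τ₀)) with hS₂
  have hfloor : ⌊x₁⌋₊ ≤ ⌊x₂⌋₊ := Nat.floor_le_floor hx₁₂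
  have hdiff : ∑ n ∈ Finset.Ioc ⌊x₁⌋₊ ⌊x₂⌋₊, charDivisorSum χ n * (n : ℝ) ^ (-(1 - τ₀)) = S₂ - S₁ := by
    rw [hS₁, hS₂]
    have e1 : Icc 1 ⌊x₂⌋₊ = Ioc 0 ⌊x₂⌋₊ := rfl
    have e2 : Icc 1 ⌊x₁⌋₊ = Ioc 0 ⌊x₁⌋₊ := rfl
    rw [e1, e2, ← Finset.sum_Ioc_consecutive _ (Nat.zero_le _) hfloor]
    ring
  rw [hreal] at h₁ h₂
  rw [← hS₁] at h₁
  rw [← hS₂] at h₂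
  -- the `x^{1-s₀}/(1-s₀)` terms
  have hT : ∀ {x : ℝ}, 1 ≤ x → χ.LFunction 1 * (x : ℂ) ^ (1 - s₀) / (1 - s₀) =
      ((L1 * x ^ τ₀ / τ₀ : ℝ) : ℂ) := by
    intro x hx
    rw [hL1, h1s, ← Complex.ofReal_cpow (by linarith), Complex.ofReal_div, Complex.ofReal_mul]
  rw [hT hx₁pos] at h₁
  rw [hT hx₂pos] at h₂
  -- `S₂ − S₁ = (A₂ − A₁) + L1 (x₂^τ₀ − x₁^τ₀)/τ₀` with `‖Aᵢ‖ ≤ C₄ Fᵢ`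
  set Z := χ.LFunction s₀ * riemannZeta s₀ with hZ
  set F₁ := x₁ ^ τ₀ * (D : ℝ) ^ (1 / 4 : ℝ) * Real.sqrt (max 1 (1 / τ₀)) * Real.log D *
    Real.log x₁ / Real.sqrt x₁ with hF₁
  set F₂ := x₂ ^ τ₀ * (D : ℝ) ^ (1 / 4 : ℝ) * Real.sqrt (max 1 (1 / τ₀)) * Real.log D *
    Real.log x₂ / Real.sqrt x₂ with hF₂
  have hF₁0 : 0 ≤ F₁ := by
    rw [hF₁]; have := Real.log_nonneg hx₁pos; positivity
  have hF₂0 : 0 ≤ F₂ := by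
    rw [hF₂]; have := Real.log_nonneg hx₂pos; positivity
  have hn1 : ‖(S₁ : ℂ) - Z - ((L1 * x₁ ^ τ₀ / τ₀ : ℝ) : ℂ)‖ ≤ |C₄| * F₁ := by
    refine h₁.trans ?_
    rw [hnorms]
    calc C₄ * (x₁ ^ τ₀ * (1 - τ₀) * (D : ℝ) ^ (1 / 4 : ℝ) * Real.sqrt (max 1 (1 / τ₀)) * Real.log D *
          Real.log x₁ / Real.sqrt x₁)
        ≤ |C₄| * (x₁ ^ τ₀ * (1 - τ₀) * (D : ℝ) ^ (1 / 4 : ℝ) * Real.sqrt (max 1 (1 / τ₀)) *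
            Real.log D * Real.log x₁ / Real.sqrt x₁) := by
          refine mul_le_mul_of_nonneg_right (le_abs_self _) ?_
          have := Real.log_nonneg hx₁pos; have : 0 ≤ 1 - τ₀ := by linarith
          positivity
      _ ≤ |C₄| * F₁ := by
          refine mul_le_mul_of_nonneg_left ?_ (abs_nonneg _)
          rw [hF₁]
          have hl := Real.log_nonneg hx₁pos
          have h1 : x₁ ^ τ₀ * (1 - τ₀) ≤ x₁ ^ τ₀ * 1 :=
            mul_le_mul_of_nonneg_left (by linarith) (by positivity)
          rw [mul_one] at h1
          gcongr
  have hn2 : ‖(S₂ : ℂ) - Z - ((L1 * x₂ ^ τ₀ / τ₀ : ℝ) : ℂ)‖ ≤ |C₄| * F₂ := by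
    refine h₂.trans ?_
    rw [hnorms]
    calc C₄ * (x₂ ^ τ₀ * (1 - τ₀) * (D : ℝ) ^ (1 / 4 : ℝ) * Real.sqrt (max 1 (1 / τ₀)) * Real.log D *
          Real.log x₂ / Real.sqrt x₂)
        ≤ |C₄| * (x₂ ^ τ₀ * (1 - τ₀) * (D : ℝ) ^ (1 / 4 : ℝ) * Real.sqrt (max 1 (1 / τ₀)) *
            Real.log D * Real.log x₂ / Real.sqrt x₂) := by
          refine mul_le_mul_of_nonneg_right (le_abs_self _) ?_
          have := Real.log_nonneg hx₂pos; have : 0 ≤ 1 - τ₀ := by linarith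
          positivity
      _ ≤ |C₄| * F₂ := by
          refine mul_le_mul_of_nonneg_left ?_ (abs_nonneg _)
          rw [hF₂]
          have hl := Real.log_nonneg hx₂pos
          have h1 : x₂ ^ τ₀ * (1 - τ₀) ≤ x₂ ^ τ₀ * 1 :=
            mul_le_mul_of_nonneg_left (by linarith) (by positivity)
          rw [mul_one] at h1
          gcongr
  -- combine (everything is real)
  have hkey : ((S₂ - S₁ : ℝ) : ℂ) =
      (((S₂ : ℂ) - Z - ((L1 * x₂ ^ τ₀ / τ₀ : ℝ) : ℂ)) - ((S₁ : ℂ) - Z - ((L1 * x₁ ^ τ₀ / τ₀ : ℝ) : ℂ)))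
        + (((L1 * x₂ ^ τ₀ / τ₀ - L1 * x₁ ^ τ₀ / τ₀ : ℝ)) : ℂ) := by
    push_cast; ring
  have hxpow : x₁ ^ τ₀ ≤ x₂ ^ τ₀ := Real.rpow_le_rpow (by linarith) hx₁₂ hτ0.le
  have hx1pow : 0 ≤ x₁ ^ τ₀ := Real.rpow_nonneg (by linarith) _
  calc ∑ n ∈ Finset.Ioc ⌊x₁⌋₊ ⌊x₂⌋₊, charDivisorSum χ n * (n : ℝ) ^ (-(1 - τ₀))
      = S₂ - S₁ := hdiff
    _ ≤ ‖((S₂ - S₁ : ℝ) : ℂ)‖ := by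
        rw [Complex.norm_real, Real.norm_eq_abs]; exact le_abs_self _
    _ ≤ ‖((S₂ : ℂ) - Z - ((L1 * x₂ ^ τ₀ / τ₀ : ℝ) : ℂ)) -
          ((S₁ : ℂ) - Z - ((L1 * x₁ ^ τ₀ / τ₀ : ℝ) : ℂ))‖ +
          ‖(((L1 * x₂ ^ τ₀ / τ₀ - L1 * x₁ ^ τ₀ / τ₀ : ℝ)) : ℂ)‖ := by
        rw [hkey]; exact norm_add_le _ _
    _ ≤ (|C₄| * F₂ + |C₄| * F₁) + (L1 * x₂ ^ τ₀ / τ₀) := by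
        refine add_le_add ((norm_sub_le _ _).trans (add_le_add hn2 hn1)) ?_
        rw [Complex.norm_real, Real.norm_eq_abs, abs_of_nonneg]
        · have : 0 ≤ L1 * x₁ ^ τ₀ / τ₀ := by positivity
          linarith
        · rw [← sub_div]; refine div_nonneg ?_ hτ0.le
          nlinarith
    _ = L1 * x₂ ^ τ₀ / τ₀ + |C₄| * (F₁ + F₂) := by ring

/-- `√(max(1, 1/τ₀)) ≤ 3` for `τ₀ ≥ 1/8`. [folklore] -/
private theorem sqrt_max_le_three {τ₀ : ℝ} (hτ0 : 0 < τ₀) (hτ8 : 1 / 8 ≤ τ₀) :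
    Real.sqrt (max 1 (1 / τ₀)) ≤ 3 := by
  have h8 : max 1 (1 / τ₀) ≤ 9 := by
    refine max_le (by norm_num) ?_
    rw [div_le_iff₀ hτ0]; linarith
  calc Real.sqrt (max 1 (1 / τ₀)) ≤ Real.sqrt 9 := Real.sqrt_le_sqrt h8
    _ = 3 := by rw [show (9 : ℝ) = 3 ^ 2 by norm_num, Real.sqrt_sq (by norm_num)]

omit [NeZero D] in
/-- `r(p) = 2` at a split prime. [folklore] -/
private theorem charDivisorSum_splitPrime (hq : χ ^ 2 = 1) {p : ℕ} (hp : p.Prime)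
    (h1 : reChar χ p = 1) : charDivisorSum χ p = 2 := by
  have h := (charDivisorSum_prime_pow_values χ hq hp 1).2.2 h1
  rw [pow_one] at h
  rw [h]; norm_num

/-- **(4.8)–(4.11): the split primes `√D/2 < p ≤ D`.** Pairs `pp'` of such primes lie in
`(D/4, D²]` and `#{(p,p') : pp' = n} ≤ g(n)`, so `(Σ p^{−σ₀})² ≤ Σ_{D/4 < n ≤ D²} g(n) n^{−σ₀}`
(`σ₀ = ¾ + ε`), and Lemma 4 at the real point `σ₀` with `x = D/4`, `x = D²` (differenced) bounds the
right-hand side by `L(1)·8D^{½−2ε} + O(D^{−ε} log²D) = 8πh D^{−2ε} + O(D^{−ε} log²D)`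
(`L(1) = πh/√D`). [cite: Pintz1976ElementaryIII, §4 (4.8)–(4.11) pp. 302–303] -/
theorem sq_sum_rpow_midSplitPrimes_le (hq : χ ^ 2 = 1) {C₄ : ℝ}
    (hL4 : ∀ s : ℂ, s ≠ 1 → 0 ≤ 1 - s.re → 1 - s.re ≤ 1 / 2 →
      ∀ x : ℝ, ‖s‖ ^ 2 * max 1 (1 / ‖1 - s‖) * Real.sqrt D ≤ x →
        ‖(∑ n ∈ Icc 1 ⌊x⌋₊, (∑ d ∈ n.divisors, χ (d : ZMod D)) * (n : ℂ) ^ (-s)) -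
            χ.LFunction s * riemannZeta s - χ.LFunction 1 * (x : ℂ) ^ (1 - s) / (1 - s)‖ ≤
          C₄ * (x ^ (1 - s.re) * ‖s‖ * (D : ℝ) ^ (1 / 4 : ℝ) * Real.sqrt (max 1 (1 / ‖1 - s‖)) *
            Real.log D * Real.log x / Real.sqrt x))
    {h : ℝ} (hh0 : 0 ≤ h) (hL1 : χ.LFunction 1 = ((Real.pi * h / Real.sqrt D : ℝ) : ℂ))
    {ε : ℝ} (hε : 0 < ε) (hε8 : ε < 1 / 8) (hD : 1024 ≤ D) (P : Finset ℕ)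
    (hP : ∀ p ∈ P, p.Prime ∧ D < 4 * p ^ 2 ∧ p ≤ D ∧ reChar χ p = 1) :
    (∑ p ∈ P, (p : ℝ) ^ (-(3 / 4 + ε))) ^ 2 ≤
      8 * Real.pi * h * (D : ℝ) ^ (-(2 * ε)) + 12 * |C₄| * ((D : ℝ) ^ (-ε) * Real.log D ^ 2) := by
  have hD0 : (0 : ℝ) < D := by exact_mod_cast NeZero.pos D
  have hD1 : (1 : ℝ) ≤ D := by exact_mod_cast NeZero.one_le
  have hD1024 : (1024 : ℝ) ≤ D := by exact_mod_cast hD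
  have hlog0 : 0 ≤ Real.log D := Real.log_nonneg hD1
  have hπ := Real.pi_pos
  set τ₀ : ℝ := 1 / 4 - ε with hτ₀
  have hτ0 : 0 < τ₀ := by rw [hτ₀]; linarith
  have hτ8 : 1 / 8 ≤ τ₀ := by rw [hτ₀]; linarith
  have hτhalf : τ₀ ≤ 1 / 2 := by rw [hτ₀]; linarith
  have hinvτ : 1 / τ₀ ≤ 8 := by rw [div_le_iff₀ hτ0]; linarith
  have hM8 : max 1 (1 / τ₀) ≤ 8 := max_le (by norm_num) hinvτ
  have hM0 : 0 ≤ max 1 (1 / τ₀) := le_trans zero_le_one (le_max_left _ _)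
  have hsqrtM : Real.sqrt (max 1 (1 / τ₀)) ≤ 3 := sqrt_max_le_three hτ0 hτ8
  have hsqrtD : 32 ≤ Real.sqrt D := by
    rw [show (32 : ℝ) = Real.sqrt (32 ^ 2) by rw [Real.sqrt_sq (by norm_num)]]
    exact Real.sqrt_le_sqrt (by linarith)
  have hsqD : Real.sqrt D * Real.sqrt D = D := Real.mul_self_sqrt hD0.le
  -- the pairs
  have hprod : ∀ p ∈ P, ∀ p' ∈ P, ⌊(D : ℝ) / 4⌋₊ < p * p' ∧ p * p' ≤ ⌊((D : ℝ) ^ 2)⌋₊ := by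
    intro p hp p' hp'
    obtain ⟨-, hpD, hple, -⟩ := hP p hp
    obtain ⟨-, hp'D, hp'le, -⟩ := hP p' hp'
    constructor
    · have h16 : D * D < (4 * (p * p')) * (4 * (p * p')) := by
        calc D * D < (4 * p ^ 2) * (4 * p' ^ 2) := Nat.mul_lt_mul'' hpD hp'D
          _ = (4 * (p * p')) * (4 * (p * p')) := by ring
      have h4 : D < 4 * (p * p') := Nat.mul_self_lt_mul_self_iff.mp h16
      rw [Nat.floor_lt (by positivity)]
      have : (D : ℝ) < 4 * ((p * p' : ℕ) : ℝ) := by exact_mod_cast h4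
      linarith
    · rw [show ((D : ℝ) ^ 2) = ((D ^ 2 : ℕ) : ℝ) by push_cast; ring, Nat.floor_natCast]
      calc p * p' ≤ D * D := Nat.mul_le_mul hple hp'le
        _ = D ^ 2 := (sq D).symm
  have hpairs := sq_sum_rpow_le_sum_g_rpow χ hq (fun p hp => (hP p hp).1) (fun p hp => (hP p hp).2.2.2)
    hprod (3 / 4 + ε)
  -- Lemma 4, differenced, at `σ₀ = 1 - τ₀`
  have hL10 : 0 ≤ Real.pi * h / Real.sqrt D := by positivity
  have hx₁ : max 1 (1 / τ₀) * Real.sqrt D ≤ (D : ℝ) / 4 := by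
    calc max 1 (1 / τ₀) * Real.sqrt D ≤ 8 * Real.sqrt D :=
          mul_le_mul_of_nonneg_right hM8 (Real.sqrt_nonneg _)
      _ ≤ Real.sqrt D / 4 * Real.sqrt D := by
          refine mul_le_mul_of_nonneg_right ?_ (Real.sqrt_nonneg _); linarith
      _ = (D : ℝ) / 4 := by rw [div_mul_eq_mul_div, hsqD]
  have hx₁₂ : (D : ℝ) / 4 ≤ (D : ℝ) ^ 2 := by nlinarith
  have hx₁pos : 1 ≤ (D : ℝ) / 4 := by linarith
  have hdiff := sum_Ioc_g_rpow_le_of_lemma4 χ hq hL4 hL1 hL10 hτ0 hτhalf hx₁ hx₁₂ hx₁pos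
  have e1 : (1 : ℝ) - τ₀ = 3 / 4 + ε := by rw [hτ₀]; ring
  rw [e1] at hdiff
  -- (i) the main term
  have hDpow2 : ((D : ℝ) ^ 2) ^ τ₀ = (D : ℝ) ^ (1 / 2 - 2 * ε) := by
    rw [show ((D : ℝ) ^ 2) = (D : ℝ) ^ (2 : ℝ) by norm_num, ← Real.rpow_mul hD0.le]
    congr 1; rw [hτ₀]; ring
  have hsqrt_rpow : Real.sqrt D = (D : ℝ) ^ (1 / 2 : ℝ) := Real.sqrt_eq_rpow _
  have hmainT : Real.pi * h / Real.sqrt D * ((D : ℝ) ^ 2) ^ τ₀ / τ₀ ≤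
      8 * Real.pi * h * (D : ℝ) ^ (-(2 * ε)) := by
    have hq' : Real.pi * h / Real.sqrt D * ((D : ℝ) ^ 2) ^ τ₀ =
        Real.pi * h * (D : ℝ) ^ (-(2 * ε)) := by
      rw [hDpow2, hsqrt_rpow, div_mul_eq_mul_div, mul_div_assoc, ← Real.rpow_sub hD0]
      congr 2; ring
    rw [hq', div_eq_mul_one_div]
    calc Real.pi * h * (D : ℝ) ^ (-(2 * ε)) * (1 / τ₀)
        ≤ Real.pi * h * (D : ℝ) ^ (-(2 * ε)) * 8 :=
          mul_le_mul_of_nonneg_left hinvτ (by positivity)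
      _ = 8 * Real.pi * h * (D : ℝ) ^ (-(2 * ε)) := by ring
  -- (ii) `F(D²) ≤ 6 D^{-ε} log²D`
  have hF₂ : ((D : ℝ) ^ 2) ^ τ₀ * (D : ℝ) ^ (1 / 4 : ℝ) * Real.sqrt (max 1 (1 / τ₀)) * Real.log D *
      Real.log ((D : ℝ) ^ 2) / Real.sqrt ((D : ℝ) ^ 2) ≤ 6 * ((D : ℝ) ^ (-ε) * Real.log D ^ 2) := by
    rw [Real.sqrt_sq hD0.le, Real.log_pow, hDpow2]
    have hG : (D : ℝ) ^ (1 / 2 - 2 * ε) * (D : ℝ) ^ (1 / 4 : ℝ) / (D : ℝ) ≤ (D : ℝ) ^ (-ε) := by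
      rw [← Real.rpow_add hD0, show (D : ℝ) ^ (1 / 2 - 2 * ε + 1 / 4) / (D : ℝ) =
        (D : ℝ) ^ (1 / 2 - 2 * ε + 1 / 4) / (D : ℝ) ^ (1 : ℝ) by rw [Real.rpow_one],
        ← Real.rpow_sub hD0]
      exact Real.rpow_le_rpow_of_exponent_le hD1 (by linarith)
    have hG0 : 0 ≤ (D : ℝ) ^ (1 / 2 - 2 * ε) * (D : ℝ) ^ (1 / 4 : ℝ) / (D : ℝ) := by positivity
    calc (D : ℝ) ^ (1 / 2 - 2 * ε) * (D : ℝ) ^ (1 / 4 : ℝ) * Real.sqrt (max 1 (1 / τ₀)) * Real.log D *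
          ((2 : ℕ) * Real.log D) / (D : ℝ)
        = ((D : ℝ) ^ (1 / 2 - 2 * ε) * (D : ℝ) ^ (1 / 4 : ℝ) / (D : ℝ)) *
            Real.sqrt (max 1 (1 / τ₀)) * (2 * Real.log D ^ 2) := by push_cast; ring
      _ ≤ (D : ℝ) ^ (-ε) * 3 * (2 * Real.log D ^ 2) := by gcongr
      _ = 6 * ((D : ℝ) ^ (-ε) * Real.log D ^ 2) := by ring
  -- (iii) `F(D/4) ≤ 6 D^{-ε} log²D`
  have hF₁ : ((D : ℝ) / 4) ^ τ₀ * (D : ℝ) ^ (1 / 4 : ℝ) * Real.sqrt (max 1 (1 / τ₀)) * Real.log D *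
      Real.log ((D : ℝ) / 4) / Real.sqrt ((D : ℝ) / 4) ≤ 6 * ((D : ℝ) ^ (-ε) * Real.log D ^ 2) := by
    have hx0 : (0 : ℝ) < (D : ℝ) / 4 := by positivity
    have hlogx : Real.log ((D : ℝ) / 4) ≤ Real.log D := Real.log_le_log hx0 (by linarith)
    have hlogx0 : 0 ≤ Real.log ((D : ℝ) / 4) := Real.log_nonneg hx₁pos
    -- `(D/4)^{τ₀}/√(D/4) = (D/4)^{-(1/4+ε)} ≤ 2 D^{-(1/4+ε)}`
    have hG : ((D : ℝ) / 4) ^ τ₀ / Real.sqrt ((D : ℝ) / 4) ≤ 2 * (D : ℝ) ^ (-(1 / 4 + ε)) := by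
      rw [Real.sqrt_eq_rpow, ← Real.rpow_sub hx0, show τ₀ - 1 / 2 = -(1 / 4 + ε) by rw [hτ₀]; ring,
        Real.div_rpow hD0.le (by norm_num), div_eq_mul_inv, ← Real.rpow_neg (by norm_num), neg_neg,
        mul_comm]
      refine mul_le_mul_of_nonneg_right ?_ (Real.rpow_nonneg hD0.le _)
      calc (4 : ℝ) ^ (1 / 4 + ε) ≤ (4 : ℝ) ^ (1 / 2 : ℝ) :=
            Real.rpow_le_rpow_of_exponent_le (by norm_num) (by linarith)
        _ = 2 := by
            rw [← Real.sqrt_eq_rpow, show (4 : ℝ) = 2 ^ 2 by norm_num, Real.sqrt_sq (by norm_num)]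
    have hG' : (D : ℝ) ^ (-(1 / 4 + ε)) * (D : ℝ) ^ (1 / 4 : ℝ) = (D : ℝ) ^ (-ε) := by
      rw [← Real.rpow_add hD0]; congr 1; ring
    have hG0 : 0 ≤ ((D : ℝ) / 4) ^ τ₀ / Real.sqrt ((D : ℝ) / 4) := by positivity
    calc ((D : ℝ) / 4) ^ τ₀ * (D : ℝ) ^ (1 / 4 : ℝ) * Real.sqrt (max 1 (1 / τ₀)) * Real.log D *
          Real.log ((D : ℝ) / 4) / Real.sqrt ((D : ℝ) / 4)
        = (((D : ℝ) / 4) ^ τ₀ / Real.sqrt ((D : ℝ) / 4)) * (D : ℝ) ^ (1 / 4 : ℝ) *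
            Real.sqrt (max 1 (1 / τ₀)) * (Real.log D * Real.log ((D : ℝ) / 4)) := by ring
      _ ≤ (2 * (D : ℝ) ^ (-(1 / 4 + ε))) * (D : ℝ) ^ (1 / 4 : ℝ) * 3 * (Real.log D * Real.log D) := by
          gcongr
      _ = 6 * (((D : ℝ) ^ (-(1 / 4 + ε)) * (D : ℝ) ^ (1 / 4 : ℝ)) * Real.log D ^ 2) := by ring
      _ = 6 * ((D : ℝ) ^ (-ε) * Real.log D ^ 2) := by rw [hG']
  -- assemble
  calc (∑ p ∈ P, (p : ℝ) ^ (-(3 / 4 + ε))) ^ 2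
      ≤ ∑ n ∈ Finset.Ioc ⌊(D : ℝ) / 4⌋₊ ⌊(D : ℝ) ^ 2⌋₊, charDivisorSum χ n * (n : ℝ) ^ (-(3 / 4 + ε)) :=
        hpairs
    _ ≤ _ := hdiff
    _ ≤ 8 * Real.pi * h * (D : ℝ) ^ (-(2 * ε)) +
          |C₄| * (6 * ((D : ℝ) ^ (-ε) * Real.log D ^ 2) + 6 * ((D : ℝ) ^ (-ε) * Real.log D ^ 2)) := by
        gcongr
    _ = _ := by ring

/-- **(4.12)–(4.13): the split primes `D < p ≤ y`.** With `N = ⌊y⌋`, `y = D^{(½−ε)/τ}`,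
`D^{−ε/4} ≤ τ ≤ ¼ − ε`: `Σ_{D<p≤N, χ(p)=1} p^{−(1−τ)} ≤ ½ Σ_{D<n≤N} g(n) n^{−(1−τ)}`, and Lemma 4
at the real point `1 − τ` with `x = D`, `x = y` (differenced) bounds this by
`½[L(1) y^τ/τ + O(D^{−7ε/8} log²D)] ≤ ½[πh D^{−3ε/4} + O(D^{−7ε/8} log²D)]`.
[cite: Pintz1976ElementaryIII, §4 (4.12)–(4.13) p. 303] -/
theorem sum_rpow_bigSplitPrimes_le (hq : χ ^ 2 = 1) {C₄ : ℝ}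
    (hL4 : ∀ s : ℂ, s ≠ 1 → 0 ≤ 1 - s.re → 1 - s.re ≤ 1 / 2 →
      ∀ x : ℝ, ‖s‖ ^ 2 * max 1 (1 / ‖1 - s‖) * Real.sqrt D ≤ x →
        ‖(∑ n ∈ Icc 1 ⌊x⌋₊, (∑ d ∈ n.divisors, χ (d : ZMod D)) * (n : ℂ) ^ (-s)) -
            χ.LFunction s * riemannZeta s - χ.LFunction 1 * (x : ℂ) ^ (1 - s) / (1 - s)‖ ≤
          C₄ * (x ^ (1 - s.re) * ‖s‖ * (D : ℝ) ^ (1 / 4 : ℝ) * Real.sqrt (max 1 (1 / ‖1 - s‖)) *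
            Real.log D * Real.log x / Real.sqrt x))
    {h : ℝ} (hh0 : 0 ≤ h) (hL1 : χ.LFunction 1 = ((Real.pi * h / Real.sqrt D : ℝ) : ℂ))
    {ε : ℝ} (hε : 0 < ε) (hε8 : ε < 1 / 8) {τ : ℝ} (hτD : (D : ℝ) ^ (-ε / 4) ≤ τ)
    (hτ : τ ≤ 1 / 4 - ε) (hD : 3 ≤ D) (P : Finset ℕ)
    (hP : ∀ p ∈ P, p.Prime ∧ D < p ∧ p ≤ ⌊(D : ℝ) ^ ((1 / 2 - ε) / τ)⌋₊ ∧ reChar χ p = 1) :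
    ∑ p ∈ P, (p : ℝ) ^ (-(1 - τ)) ≤
      Real.pi * h * (D : ℝ) ^ (-(3 * ε / 4)) / 2 +
        3 / 2 * |C₄| * ((D : ℝ) ^ (-(7 * ε / 8)) * Real.log D ^ 2) := by
  have hD0 : (0 : ℝ) < D := by exact_mod_cast NeZero.pos D
  have hD1 : (1 : ℝ) ≤ D := by exact_mod_cast NeZero.one_le
  have hD3 : (3 : ℝ) ≤ D := by exact_mod_cast hD
  have hlog0 : 0 ≤ Real.log D := Real.log_nonneg hD1
  have hπ := Real.pi_pos
  have hDε0 : 0 < (D : ℝ) ^ (-ε / 4) := Real.rpow_pos_of_pos hD0 _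
  have hτ0 : 0 < τ := lt_of_lt_of_le hDε0 hτD
  have hτhalf : τ ≤ 1 / 2 := by linarith
  have hinvτ : 1 / τ ≤ (D : ℝ) ^ (ε / 4) := by
    calc 1 / τ ≤ 1 / (D : ℝ) ^ (-ε / 4) := one_div_le_one_div_of_le hDε0 hτD
      _ = (D : ℝ) ^ (ε / 4) := by
          rw [show -ε / 4 = -(ε / 4) by ring, Real.rpow_neg hD0.le, one_div, inv_inv]
  have hM : max 1 (1 / τ) ≤ (D : ℝ) ^ (ε / 4) :=
    max_le (Real.one_le_rpow hD1 (by positivity)) hinvτ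
  have hM0 : 0 ≤ max 1 (1 / τ) := le_trans zero_le_one (le_max_left _ _)
  have hsqrtM : Real.sqrt (max 1 (1 / τ)) ≤ (D : ℝ) ^ (ε / 8) := by
    calc Real.sqrt (max 1 (1 / τ)) ≤ Real.sqrt ((D : ℝ) ^ (ε / 4)) := Real.sqrt_le_sqrt hM
      _ = (D : ℝ) ^ (ε / 8) := by
          rw [Real.sqrt_eq_rpow, ← Real.rpow_mul hD0.le]; congr 1; ring
  have hsqrt_rpow : Real.sqrt D = (D : ℝ) ^ (1 / 2 : ℝ) := Real.sqrt_eq_rpow _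
  -- `y ≥ D² ≥ D`
  set y : ℝ := (D : ℝ) ^ ((1 / 2 - ε) / τ) with hy
  have hexp2 : 2 ≤ (1 / 2 - ε) / τ := by
    rw [le_div_iff₀ hτ0]; linarith
  have hyD2 : (D : ℝ) ^ 2 ≤ y := by
    rw [hy, show ((D : ℝ) ^ 2) = (D : ℝ) ^ (2 : ℝ) by norm_num]
    exact Real.rpow_le_rpow_of_exponent_le hD1 hexp2
  have hDy : (D : ℝ) ≤ y := le_trans (by nlinarith) hyD2
  have hy1 : 1 ≤ y := hD1.trans hDy
  have hy0 : 0 < y := by linarith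
  have hyτ : y ^ τ = (D : ℝ) ^ (1 / 2 - ε) := by
    rw [hy, ← Real.rpow_mul hD0.le]; congr 1; field_simp
  -- Step 1: `Σ_P p^{-(1-τ)} ≤ ½ Σ_{D<n≤N} g(n) n^{-(1-τ)}`
  have hstep1 : 2 * ∑ p ∈ P, (p : ℝ) ^ (-(1 - τ)) ≤
      ∑ n ∈ Finset.Ioc ⌊(D : ℝ)⌋₊ ⌊y⌋₊, charDivisorSum χ n * (n : ℝ) ^ (-(1 - τ)) := by
    rw [Nat.floor_natCast, Finset.mul_sum]
    have hsub : P ⊆ Finset.Ioc D ⌊y⌋₊ := by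
      intro p hp
      obtain ⟨-, hDp, hpy, -⟩ := hP p hp
      exact Finset.mem_Ioc.mpr ⟨hDp, hpy⟩
    calc ∑ p ∈ P, 2 * (p : ℝ) ^ (-(1 - τ)) = ∑ p ∈ P, charDivisorSum χ p * (p : ℝ) ^ (-(1 - τ)) := by
          refine sum_congr rfl fun p hp => ?_
          rw [charDivisorSum_splitPrime χ hq (hP p hp).1 (hP p hp).2.2.2]
      _ ≤ ∑ n ∈ Finset.Ioc D ⌊y⌋₊, charDivisorSum χ n * (n : ℝ) ^ (-(1 - τ)) := by
          refine sum_le_sum_of_subset_of_nonneg hsub fun n _ _ => ?_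
          have := g_nonneg χ hq n
          rw [g_eq_charDivisorSum] at this
          exact mul_nonneg this (Real.rpow_nonneg (Nat.cast_nonneg n) _)
  -- Step 2: Lemma 4 differenced with `x₁ = D`, `x₂ = y`
  have hL10 : 0 ≤ Real.pi * h / Real.sqrt D := by positivity
  have hx₁ : max 1 (1 / τ) * Real.sqrt D ≤ (D : ℝ) := by
    have hε4 : (D : ℝ) ^ (ε / 4) ≤ Real.sqrt D := by
      rw [hsqrt_rpow]; exact Real.rpow_le_rpow_of_exponent_le hD1 (by linarith)
    calc max 1 (1 / τ) * Real.sqrt D ≤ Real.sqrt D * Real.sqrt D :=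
          mul_le_mul_of_nonneg_right (hM.trans hε4) (Real.sqrt_nonneg _)
      _ = D := Real.mul_self_sqrt hD0.le
  have hdiff := sum_Ioc_g_rpow_le_of_lemma4 χ hq hL4 hL1 hL10 hτ0 hτhalf hx₁ hDy hD1
  -- (i) main term `πh/√D · y^τ/τ ≤ πh D^{-3ε/4}`
  have hmainT : Real.pi * h / Real.sqrt D * y ^ τ / τ ≤ Real.pi * h * (D : ℝ) ^ (-(3 * ε / 4)) := by
    have hq' : Real.pi * h / Real.sqrt D * y ^ τ = Real.pi * h * (D : ℝ) ^ (-ε) := by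
      rw [hyτ, hsqrt_rpow, div_mul_eq_mul_div, mul_div_assoc, ← Real.rpow_sub hD0]
      congr 2; ring
    rw [hq', div_eq_mul_one_div]
    calc Real.pi * h * (D : ℝ) ^ (-ε) * (1 / τ) ≤ Real.pi * h * (D : ℝ) ^ (-ε) * (D : ℝ) ^ (ε / 4) :=
          mul_le_mul_of_nonneg_left hinvτ (by positivity)
      _ = Real.pi * h * (D : ℝ) ^ (-(3 * ε / 4)) := by
          rw [mul_assoc, ← Real.rpow_add hD0]; congr 2; ring
  -- (ii) `F(D) ≤ D^{-7ε/8} log²D`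
  have hF₁ : (D : ℝ) ^ τ * (D : ℝ) ^ (1 / 4 : ℝ) * Real.sqrt (max 1 (1 / τ)) * Real.log D *
      Real.log D / Real.sqrt D ≤ (D : ℝ) ^ (-(7 * ε / 8)) * Real.log D ^ 2 := by
    have hDτ : (D : ℝ) ^ τ ≤ (D : ℝ) ^ (1 / 4 - ε) := Real.rpow_le_rpow_of_exponent_le hD1 hτ
    have hE : (D : ℝ) ^ (1 / 4 - ε) * (D : ℝ) ^ (1 / 4 : ℝ) * (D : ℝ) ^ (ε / 8) / Real.sqrt D =
        (D : ℝ) ^ (-(7 * ε / 8)) := by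
      rw [hsqrt_rpow, ← Real.rpow_add hD0, ← Real.rpow_add hD0, ← Real.rpow_sub hD0]
      congr 1; ring
    calc (D : ℝ) ^ τ * (D : ℝ) ^ (1 / 4 : ℝ) * Real.sqrt (max 1 (1 / τ)) * Real.log D *
          Real.log D / Real.sqrt D
        = ((D : ℝ) ^ τ * (D : ℝ) ^ (1 / 4 : ℝ) * Real.sqrt (max 1 (1 / τ)) / Real.sqrt D) *
            Real.log D ^ 2 := by ring
      _ ≤ ((D : ℝ) ^ (1 / 4 - ε) * (D : ℝ) ^ (1 / 4 : ℝ) * (D : ℝ) ^ (ε / 8) / Real.sqrt D) *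
            Real.log D ^ 2 := by gcongr
      _ = (D : ℝ) ^ (-(7 * ε / 8)) * Real.log D ^ 2 := by rw [hE]
  -- (iii) `F(y) ≤ 2 D^{-7ε/8} log²D`
  have hF₂ : y ^ τ * (D : ℝ) ^ (1 / 4 : ℝ) * Real.sqrt (max 1 (1 / τ)) * Real.log D *
      Real.log y / Real.sqrt y ≤ 2 * ((D : ℝ) ^ (-(7 * ε / 8)) * Real.log D ^ 2) := by
    have he2 : Real.exp 2 ≤ (D : ℝ) ^ 2 := by
      have := Real.exp_one_lt_d9
      calc Real.exp 2 = Real.exp 1 ^ 2 := by rw [← Real.exp_nat_mul]; norm_num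
        _ ≤ 3 ^ 2 := by gcongr; linarith
        _ ≤ (D : ℝ) ^ 2 := by gcongr
    have hanti : Real.log y / Real.sqrt y ≤ Real.log ((D : ℝ) ^ 2) / Real.sqrt ((D : ℝ) ^ 2) :=
      Real.log_div_sqrt_antitoneOn he2 (le_trans he2 hyD2) hyD2
    rw [Real.sqrt_sq hD0.le, Real.log_pow] at hanti
    have hls0 : 0 ≤ Real.log y / Real.sqrt y := div_nonneg (Real.log_nonneg hy1) (Real.sqrt_nonneg _)
    have hE : (D : ℝ) ^ (1 / 2 - ε) * (D : ℝ) ^ (1 / 4 : ℝ) * (D : ℝ) ^ (ε / 8) / (D : ℝ) =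
        (D : ℝ) ^ (-(1 / 4 + 7 * ε / 8)) := by
      rw [← Real.rpow_add hD0, ← Real.rpow_add hD0,
        show (D : ℝ) ^ (1 / 2 - ε + 1 / 4 + ε / 8) / (D : ℝ) =
          (D : ℝ) ^ (1 / 2 - ε + 1 / 4 + ε / 8) / (D : ℝ) ^ (1 : ℝ) by rw [Real.rpow_one],
        ← Real.rpow_sub hD0]
      congr 1; ring
    have hE' : (D : ℝ) ^ (-(1 / 4 + 7 * ε / 8)) ≤ (D : ℝ) ^ (-(7 * ε / 8)) :=
      Real.rpow_le_rpow_of_exponent_le hD1 (by linarith)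
    calc y ^ τ * (D : ℝ) ^ (1 / 4 : ℝ) * Real.sqrt (max 1 (1 / τ)) * Real.log D *
          Real.log y / Real.sqrt y
        = y ^ τ * (D : ℝ) ^ (1 / 4 : ℝ) * Real.sqrt (max 1 (1 / τ)) * Real.log D *
            (Real.log y / Real.sqrt y) := by ring
      _ ≤ (D : ℝ) ^ (1 / 2 - ε) * (D : ℝ) ^ (1 / 4 : ℝ) * (D : ℝ) ^ (ε / 8) * Real.log D *
            (((2 : ℕ) * Real.log D) / (D : ℝ)) := by
          rw [hyτ]; gcongr
      _ = 2 * (((D : ℝ) ^ (1 / 2 - ε) * (D : ℝ) ^ (1 / 4 : ℝ) * (D : ℝ) ^ (ε / 8) / (D : ℝ)) *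
            Real.log D ^ 2) := by push_cast; ring
      _ ≤ 2 * ((D : ℝ) ^ (-(7 * ε / 8)) * Real.log D ^ 2) := by rw [hE]; gcongr
  -- assemble
  have hfin : 2 * ∑ p ∈ P, (p : ℝ) ^ (-(1 - τ)) ≤
      Real.pi * h * (D : ℝ) ^ (-(3 * ε / 4)) +
        |C₄| * ((D : ℝ) ^ (-(7 * ε / 8)) * Real.log D ^ 2 +
          2 * ((D : ℝ) ^ (-(7 * ε / 8)) * Real.log D ^ 2)) := by
    refine hstep1.trans (hdiff.trans ?_)
    gcongr
  linarith

end SplitPrimeSums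


/-! ## Part S. Lemma 6 assembled ((4.14)–(4.28)) and §5: Theorem 2 -/

section AssemblyTools

variable {D : ℕ} (χ : DirichletCharacter ℂ D)

/-- `p^{−σ} ≤ 3/5` for a prime `p` and `σ ≥ 3/4` (`2^{−3/4} ≤ 3/5`). [folklore] -/
private theorem prime_rpow_neg_le_three_fifths {p : ℕ} (hp : p.Prime) {σ : ℝ} (hσ : 3 / 4 ≤ σ) :
    (p : ℝ) ^ (-σ) ≤ 3 / 5 := by
  have hp2 : (2 : ℝ) ≤ p := by exact_mod_cast hp.two_le
  have h1 : (p : ℝ) ^ (-σ) ≤ (2 : ℝ) ^ (-σ) := Real.rpow_le_rpow_of_nonpos (by norm_num) hp2 (by linarith)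
  have h2 : (2 : ℝ) ^ (-σ) ≤ (2 : ℝ) ^ (-(3 / 4) : ℝ) :=
    Real.rpow_le_rpow_of_exponent_le (by norm_num) (by linarith)
  have h3 : (2 : ℝ) ^ (-(3 / 4) : ℝ) ≤ 3 / 5 := by
    have h4 : ((2 : ℝ) ^ (-(3 / 4) : ℝ)) ^ 4 = 1 / 8 := by
      rw [← Real.rpow_natCast, ← Real.rpow_mul (by norm_num)]; norm_num
    have h0 : 0 ≤ (2 : ℝ) ^ (-(3 / 4) : ℝ) := Real.rpow_nonneg (by norm_num) _
    have h5 : ((2 : ℝ) ^ (-(3 / 4) : ℝ)) ^ 4 ≤ (3 / 5 : ℝ) ^ 4 := by rw [h4]; norm_num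
    exact (pow_le_pow_iff_left₀ h0 (by norm_num) (by norm_num)).mp h5
  exact h1.trans (h2.trans h3)

/-- `(1 − u)^{−1} ≤ e^{(5/2)u}` for `0 ≤ u ≤ 3/5` (`1/(1−u) = 1 + u/(1−u) ≤ e^{u/(1−u)}`). [folklore] -/
private theorem inv_one_sub_le_exp {u : ℝ} (hu0 : 0 ≤ u) (hu : u ≤ 3 / 5) :
    (1 - u)⁻¹ ≤ Real.exp (5 / 2 * u) := by
  have h1u : 0 < 1 - u := by linarith
  have hkey : (1 - u)⁻¹ = u / (1 - u) + 1 := by field_simp; ring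
  rw [hkey]
  refine (Real.add_one_le_exp _).trans (Real.exp_le_exp.mpr ?_)
  rw [div_le_iff₀ h1u]; nlinarith

/-- **(4.25)-type Euler factors**: for a finite set `P` of primes and `σ ≥ 3/4`,
`∏_{p∈P} (1 − p^{−σ})^{−1} ≤ exp((5/2) Σ_{p∈P} p^{−σ})`. [folklore] -/
private theorem prod_inv_one_sub_le_exp {P : Finset ℕ} (hP : ∀ p ∈ P, p.Prime) {σ : ℝ} (hσ : 3 / 4 ≤ σ) :
    ∏ p ∈ P, (1 - (p : ℝ) ^ (-σ))⁻¹ ≤ Real.exp (5 / 2 * ∑ p ∈ P, (p : ℝ) ^ (-σ)) := by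
  rw [Finset.mul_sum, Real.exp_sum]
  refine Finset.prod_le_prod (fun p hp => ?_) fun p hp => ?_
  · have := (prime_rpow_neg_lt_one (hP p hp) (by linarith : 0 < σ)).2
    exact inv_nonneg.mpr (by linarith)
  · exact inv_one_sub_le_exp (Real.rpow_nonneg (Nat.cast_nonneg p) _)
      (prime_rpow_neg_le_three_fifths (hP p hp) hσ)

/-- Squared version: `∏_{p∈P} (1 − p^{−σ})^{−2} ≤ exp(5 Σ_{p∈P} p^{−σ})`. [folklore] -/
private theorem prod_inv_one_sub_sq_le_exp {P : Finset ℕ} (hP : ∀ p ∈ P, p.Prime) {σ : ℝ}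
    (hσ : 3 / 4 ≤ σ) :
    ∏ p ∈ P, (1 - (p : ℝ) ^ (-σ))⁻¹ ^ 2 ≤ Real.exp (5 * ∑ p ∈ P, (p : ℝ) ^ (-σ)) := by
  rw [Finset.prod_pow, show 5 * ∑ p ∈ P, (p : ℝ) ^ (-σ) = (5 / 2 * ∑ p ∈ P, (p : ℝ) ^ (-σ)) * 2 by ring,
    Real.exp_mul, show ((2 : ℝ)) = ((2 : ℕ) : ℝ) by norm_num, Real.rpow_natCast]
  refine pow_le_pow_left₀ (Finset.prod_nonneg fun p hp => ?_) (prod_inv_one_sub_le_exp hP hσ) 2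
  have := (prime_rpow_neg_lt_one (hP p hp) (by linarith : 0 < σ)).2
  exact inv_nonneg.mpr (by linarith)

/-- `Σ_{1 < n ≤ M} n^{−3/4} ≤ 4 M^{1/4} − 4` (telescoping `n^{−3/4} ≤ 4(n^{1/4} − (n−1)^{1/4})`).
[folklore] -/
private theorem sum_Ioc_one_rpow_le {M : ℕ} (hM : 1 ≤ M) :
    ∑ n ∈ Ioc 1 M, (n : ℝ) ^ (-(3 / 4) : ℝ) ≤ 4 * (M : ℝ) ^ (1 / 4 : ℝ) - 4 := by
  induction M, hM using Nat.le_induction with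
  | base => simp
  | succ M hM ih =>
      rw [Finset.sum_Ioc_succ_top hM]
      have hM1 : (1 : ℝ) ≤ M := by exact_mod_cast hM
      set b : ℝ := ((M + 1 : ℕ) : ℝ) ^ (1 / 4 : ℝ) with hb
      set a : ℝ := (M : ℝ) ^ (1 / 4 : ℝ) with ha
      have hb0 : 0 < b := Real.rpow_pos_of_pos (by positivity) _
      have ha0 : 0 ≤ a := Real.rpow_nonneg (by positivity) _
      have hab : a ≤ b := Real.rpow_le_rpow (by positivity) (by push_cast; linarith) (by norm_num)
      have hb4 : b ^ 4 = (M : ℝ) + 1 := by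
        rw [hb, ← Real.rpow_natCast, ← Real.rpow_mul (by positivity)]; push_cast; norm_num
      have ha4 : a ^ 4 = (M : ℝ) := by
        rw [ha, ← Real.rpow_natCast, ← Real.rpow_mul (by positivity)]; norm_num
      have hterm : ((M + 1 : ℕ) : ℝ) ^ (-(3 / 4) : ℝ) = 1 / b ^ 3 := by
        rw [hb, ← Real.rpow_natCast, ← Real.rpow_mul (by positivity), Real.rpow_neg (by positivity)]
        norm_num
      have hkey : 1 / b ^ 3 ≤ 4 * (b - a) := by
        rw [div_le_iff₀ (by positivity)]
        have h1 : b ^ 4 - a ^ 4 = (b - a) * (b ^ 3 + a * b ^ 2 + a ^ 2 * b + a ^ 3) := by ring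
        have h2 : b ^ 3 + a * b ^ 2 + a ^ 2 * b + a ^ 3 ≤ 4 * b ^ 3 := by
          nlinarith [pow_le_pow_left₀ ha0 hab 2, pow_le_pow_left₀ ha0 hab 3, mul_nonneg ha0 hb0.le]
        have h3 : (b - a) * (b ^ 3 + a * b ^ 2 + a ^ 2 * b + a ^ 3) ≤ (b - a) * (4 * b ^ 3) :=
          mul_le_mul_of_nonneg_left h2 (by linarith)
        nlinarith
      rw [hterm]
      linarith

/-- **The ramified primes are few in the `p^{−3/4}`-measure**: for `P₀ ≥ 2`,
`Σ_{p∣D} p^{−3/4} ≤ 4 P₀^{1/4} + (log D/log P₀) P₀^{−3/4}` (the primes `≤ P₀` contribute at most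
`Σ_{n≤P₀} n^{−3/4}`, and at most `log D/log P₀` primes `> P₀` divide `D`). [folklore] -/
private theorem sum_primeFactors_rpow_le [NeZero D] {P₀ : ℕ} (hP₀ : 2 ≤ P₀) :
    ∑ p ∈ D.primeFactors, (p : ℝ) ^ (-(3 / 4) : ℝ) ≤
      4 * (P₀ : ℝ) ^ (1 / 4 : ℝ) + Real.log D / Real.log P₀ * (P₀ : ℝ) ^ (-(3 / 4) : ℝ) := by
  classical
  have hD0 : 0 < D := NeZero.pos D
  have hP₀r : (2 : ℝ) ≤ P₀ := by exact_mod_cast hP₀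
  have hlogP : 0 < Real.log P₀ := Real.log_pos (by linarith)
  rw [← Finset.sum_filter_add_sum_filter_not D.primeFactors (fun p => p ≤ P₀)]
  refine add_le_add ?_ ?_
  · -- small primes
    have hsub : D.primeFactors.filter (fun p => p ≤ P₀) ⊆ Ioc 1 P₀ := by
      intro p hp
      rw [Finset.mem_filter] at hp
      rw [Finset.mem_Ioc]
      exact ⟨(Nat.prime_of_mem_primeFactors hp.1).one_lt, hp.2⟩
    calc ∑ p ∈ D.primeFactors.filter (fun p => p ≤ P₀), (p : ℝ) ^ (-(3 / 4) : ℝ)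
        ≤ ∑ n ∈ Ioc 1 P₀, (n : ℝ) ^ (-(3 / 4) : ℝ) :=
          Finset.sum_le_sum_of_subset_of_nonneg hsub fun n _ _ => Real.rpow_nonneg (Nat.cast_nonneg n) _
      _ ≤ 4 * (P₀ : ℝ) ^ (1 / 4 : ℝ) - 4 := sum_Ioc_one_rpow_le (by omega)
      _ ≤ 4 * (P₀ : ℝ) ^ (1 / 4 : ℝ) := by linarith
  · -- large primes: at most `log D/log P₀` of them
    set T := D.primeFactors.filter (fun p => ¬ p ≤ P₀) with hT
    have hTprime : ∀ p ∈ T, p.Prime := fun p hp => Nat.prime_of_mem_primeFactors (Finset.mem_filter.mp hp).1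
    have hdvd : (∏ p ∈ T, p) ∣ D :=
      (Finset.prod_dvd_prod_of_subset _ _ _ (Finset.filter_subset _ _)).trans (Nat.prod_primeFactors_dvd D)
    have hle : P₀ ^ T.card ≤ D := by
      calc P₀ ^ T.card = ∏ _p ∈ T, P₀ := (Finset.prod_const P₀).symm
        _ ≤ ∏ p ∈ T, p := Finset.prod_le_prod' fun p hp => by
            have := (Finset.mem_filter.mp hp).2; omega
        _ ≤ D := Nat.le_of_dvd hD0 hdvd
    have hcard : (T.card : ℝ) ≤ Real.log D / Real.log P₀ := by
      rw [le_div_iff₀ hlogP, ← Real.log_pow]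
      exact Real.log_le_log (by positivity) (by exact_mod_cast hle)
    have hterm : ∀ p ∈ T, (p : ℝ) ^ (-(3 / 4) : ℝ) ≤ (P₀ : ℝ) ^ (-(3 / 4) : ℝ) := by
      intro p hp
      have := (Finset.mem_filter.mp hp).2
      exact Real.rpow_le_rpow_of_nonpos (by positivity) (by exact_mod_cast (by omega : P₀ ≤ p)) (by norm_num)
    calc ∑ p ∈ T, (p : ℝ) ^ (-(3 / 4) : ℝ) ≤ T.card • (P₀ : ℝ) ^ (-(3 / 4) : ℝ) :=
          Finset.sum_le_card_nsmul _ _ _ hterm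
      _ = (T.card : ℝ) * (P₀ : ℝ) ^ (-(3 / 4) : ℝ) := by rw [nsmul_eq_mul]
      _ ≤ Real.log D / Real.log P₀ * (P₀ : ℝ) ^ (-(3 / 4) : ℝ) :=
          mul_le_mul_of_nonneg_right hcard (Real.rpow_nonneg (by positivity) _)

/-- **(4.22), the tail of `ζ(2s)`**: if a finite set `S ⊆ ℕ_{>0}` contains `1, …, R` (`R ≥ 1`) and
`Re s = σ ≥ 3/4`, then `‖Σ_{l∈S} (l^{−s})² − ζ(2s)‖ ≤ Σ_{l>R} l^{−2σ} ≤ 2/√R`. [folklore] -/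
private theorem norm_sum_sq_sub_zeta_le {s : ℂ} (hσ : 3 / 4 ≤ s.re) {R : ℕ} (hR : 1 ≤ R)
    (S : Finset ℕ) (h0 : 0 ∉ S) (hS : ∀ n, 1 ≤ n → n ≤ R → n ∈ S) :
    ‖(∑ l ∈ S, ((l : ℂ) ^ (-s)) ^ 2) - riemannZeta (2 * s)‖ ≤ 2 / Real.sqrt R := by
  classical
  have h2re : (2 * s).re = 2 * s.re := by simp [Complex.mul_re]
  have hre : 1 < (2 * s).re := by rw [h2re]; linarith
  set f : ℕ → ℂ := fun n => 1 / (n : ℂ) ^ (2 * s) with hf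
  have hsum : Summable f := Complex.summable_one_div_nat_cpow.mpr hre
  have hzeta : riemannZeta (2 * s) = ∑' n, f n := zeta_eq_tsum_one_div_nat_cpow hre
  -- the finite sum is `Σ_{l∈S} f l`
  have hfin : (∑ l ∈ S, ((l : ℂ) ^ (-s)) ^ 2) = ∑ l ∈ S, f l := by
    refine Finset.sum_congr rfl fun l hl => ?_
    have hl0 : (l : ℂ) ≠ 0 := by
      have : l ≠ 0 := fun h => h0 (h ▸ hl)
      exact_mod_cast this
    rw [hf]; simp only []
    rw [← Complex.cpow_nat_mul, show ((2 : ℕ) : ℂ) * -s = -(2 * s) by push_cast; ring,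
      Complex.cpow_neg, one_div]
  rw [hfin, hzeta, ← hsum.sum_add_tsum_compl (s := S), sub_add_cancel_left, norm_neg]
  -- norms of the tail terms
  have hnorm : ∀ n : ℕ, ‖f n‖ = if n = 0 then 0 else (n : ℝ) ^ (-(2 * s.re)) := by
    intro n
    rcases eq_or_ne n 0 with rfl | hn
    · simp [hf, Complex.zero_cpow (by intro h; rw [h, Complex.zero_re] at hre; linarith : 2 * s ≠ 0)]
    · rw [if_neg hn, hf]; simp only []
      rw [norm_div, norm_one, Complex.norm_natCast_cpow_of_pos (Nat.pos_of_ne_zero hn), h2re,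
        Real.rpow_neg (Nat.cast_nonneg n), one_div]
  have hsum' : Summable fun x : ↥((↑S : Set ℕ)ᶜ) => ‖f x‖ := (hsum.norm).subtype _
  refine (norm_tsum_le_tsum_norm hsum').trans ?_
  refine hsum'.tsum_le_of_sum_le fun F => ?_
  -- a finite piece of the tail lies in `(R, M]`
  set G : Finset ℕ := F.map (Function.Embedding.subtype _) with hG
  have hGS : ∀ n ∈ G, n ∉ S := by
    intro n hn
    obtain ⟨x, -, rfl⟩ := Finset.mem_map.mp hn
    exact x.2
  have hFG : ∑ x ∈ F, ‖f x‖ = ∑ n ∈ G, ‖f n‖ := by rw [hG, Finset.sum_map]; rfl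
  rw [hFG]
  set M := G.sup id with hM
  calc ∑ n ∈ G, ‖f n‖ = ∑ n ∈ G, (if n = 0 then 0 else (n : ℝ) ^ (-(2 * s.re))) :=
        Finset.sum_congr rfl fun n _ => hnorm n
    _ = ∑ n ∈ G.filter (fun n => n ≠ 0), (n : ℝ) ^ (-(2 * s.re)) := by
        rw [Finset.sum_filter]; refine Finset.sum_congr rfl fun n _ => ?_
        by_cases h : n = 0 <;> simp [h]
    _ ≤ ∑ n ∈ Ioc R M, (n : ℝ) ^ (-(2 * s.re)) := by
        refine Finset.sum_le_sum_of_subset_of_nonneg (fun n hn => ?_) fun n _ _ =>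
          Real.rpow_nonneg (Nat.cast_nonneg n) _
        rw [Finset.mem_filter] at hn
        rw [Finset.mem_Ioc]
        refine ⟨?_, Finset.le_sup (f := id) hn.1⟩
        by_contra hle
        exact hGS n hn.1 (hS n (Nat.pos_of_ne_zero hn.2) (not_lt.mp hle))
    _ ≤ 2 / Real.sqrt R := sum_Ioc_rpow_le_two_div_sqrt hσ hR M

/-- **(4.22), the kernel sum is an Euler product**: for a completely multiplicative `w`
(`w(1) = 1`, `w(ab) = w(a)w(b)`) and `N ≥ D ≥ 1`,
`Σ_{b ≤ N, b squarefree, p∣b ⇒ p∣D} w(b) = ∏_{p∣D} (1 + w(p))`. [folklore] -/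
private theorem sum_kernel_eq_prod [NeZero D] {R : Type*} [CommSemiring R] (w : ℕ → R) (hw1 : w 1 = 1)
    (hw : ∀ a b, w (a * b) = w a * w b) {N : ℕ} (hN : D ≤ N) :
    ∑ b ∈ (Ioc 0 N).filter (fun b => Squarefree b ∧ ∀ p ∈ b.primeFactors, p ∣ D), w b =
      ∏ p ∈ D.primeFactors, (1 + w p) := by
  classical
  have hD0 : 0 < D := NeZero.pos D
  -- `w` is a monoid hom
  let W : ℕ →* R := { toFun := w, map_one' := hw1, map_mul' := hw }
  have hWprod : ∀ T : Finset ℕ, w (∏ p ∈ T, p) = ∏ p ∈ T, w p := fun T => map_prod W _ T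
  rw [Finset.prod_one_add]
  symm
  refine Finset.sum_nbij' (fun T => ∏ p ∈ T, p) (fun b => b.primeFactors) ?_ ?_ ?_ ?_ ?_
  · intro T hT
    rw [Finset.mem_powerset] at hT
    have hTp : ∀ p ∈ T, p.Prime := fun p hp => Nat.prime_of_mem_primeFactors (hT hp)
    have hdvd : (∏ p ∈ T, p) ∣ D := (Finset.prod_dvd_prod_of_subset _ _ _ hT).trans (Nat.prod_primeFactors_dvd D)
    rw [Finset.mem_filter, Finset.mem_Ioc]
    refine ⟨⟨Finset.prod_pos fun p hp => (hTp p hp).pos, (Nat.le_of_dvd hD0 hdvd).trans hN⟩, ?_, ?_⟩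
    · -- squarefree
      clear hT hdvd
      induction T using Finset.induction_on with
      | empty => simp
      | insert p T hpT ih =>
        rw [Finset.prod_insert hpT]
        have hp : p.Prime := hTp p (Finset.mem_insert_self _ _)
        have hTp' : ∀ q ∈ T, q.Prime := fun q hq => hTp q (Finset.mem_insert_of_mem hq)
        have hcop : Nat.Coprime p (∏ q ∈ T, q) :=
          Nat.Coprime.prod_right fun q hq => (Nat.coprime_primes hp (hTp' q hq)).mpr
            (fun h => hpT (h ▸ hq))
        exact (Nat.squarefree_mul hcop).mpr ⟨hp.prime.squarefree, ih hTp'⟩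
    · intro q hq
      rw [Nat.primeFactors_prod hTp] at hq
      exact Nat.dvd_of_mem_primeFactors (hT hq)
  · intro b hb
    rw [Finset.mem_filter] at hb
    rw [Finset.mem_powerset]
    intro q hq
    exact Nat.mem_primeFactors.mpr ⟨Nat.prime_of_mem_primeFactors hq, hb.2.2 q hq, hD0.ne'⟩
  · intro T hT
    rw [Finset.mem_powerset] at hT
    exact Nat.primeFactors_prod fun p hp => Nat.prime_of_mem_primeFactors (hT hp)
  · intro b hb
    rw [Finset.mem_filter] at hb
    exact Nat.prod_primeFactors_of_squarefree hb.2.1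
  · intro T _
    exact (hWprod T).symm

/-- `‖∏_{p∣D}(1 + p^{−s})‖ ≥ ∏_{p∣D}(1 − p^{−σ})` and `Σ-type bound ∏(1 + p^{−σ}) ≤ ∏(1 − p^{−σ})^{−1}`.
[folklore] -/
private theorem prod_one_sub_le_norm_prod (s : ℂ) (hσ : 0 < s.re) :
    ∏ p ∈ D.primeFactors, (1 - (p : ℝ) ^ (-s.re)) ≤ ‖∏ p ∈ D.primeFactors, (1 + (p : ℂ) ^ (-s))‖ ∧
    ∏ p ∈ D.primeFactors, (1 + (p : ℝ) ^ (-s.re)) ≤ ∏ p ∈ D.primeFactors, (1 - (p : ℝ) ^ (-s.re))⁻¹ := by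
  have hnormp : ∀ p ∈ D.primeFactors, ‖(p : ℂ) ^ (-s)‖ = (p : ℝ) ^ (-s.re) := by
    intro p hp
    rw [Complex.norm_natCast_cpow_of_pos (Nat.prime_of_mem_primeFactors hp).pos, Complex.neg_re]
  have hu : ∀ p ∈ D.primeFactors, 0 ≤ (p : ℝ) ^ (-s.re) ∧ (p : ℝ) ^ (-s.re) < 1 := fun p hp =>
    prime_rpow_neg_lt_one (Nat.prime_of_mem_primeFactors hp) hσ
  constructor
  · rw [Complex.norm_prod]
    refine Finset.prod_le_prod (fun p hp => by linarith [(hu p hp).2]) fun p hp => ?_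
    rw [← hnormp p hp]
    -- `‖1‖ - ‖z‖ ≤ ‖1 + z‖`
    have h := norm_sub_norm_le (1 : ℂ) (-((p : ℂ) ^ (-s)))
    rwa [norm_neg, norm_one, sub_neg_eq_add] at h
  · refine Finset.prod_le_prod (fun p hp => by linarith [(hu p hp).1]) fun p hp => ?_
    obtain ⟨h0, h1⟩ := hu p hp
    have hprod : (1 + (p : ℝ) ^ (-s.re)) * (1 - (p : ℝ) ^ (-s.re)) ≤ 1 := by nlinarith
    calc 1 + (p : ℝ) ^ (-s.re) = (1 + (p : ℝ) ^ (-s.re)) * (1 - (p : ℝ) ^ (-s.re)) / (1 - (p : ℝ) ^ (-s.re)) := by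
          rw [mul_div_assoc, div_self (by linarith : (1 - (p : ℝ) ^ (-s.re)) ≠ 0), mul_one]
      _ ≤ 1 / (1 - (p : ℝ) ^ (-s.re)) := div_le_div_of_nonneg_right hprod (by linarith)
      _ = (1 - (p : ℝ) ^ (-s.re))⁻¹ := one_div _

/-- `‖ζ(2s)‖ ≥ 1/3` for `Re s ≥ 3/4` (`‖ζ(w)‖ ≥ (Re w − 1)/Re w`, the tree's
`ZetaClassicalRegion.norm_riemannZeta_ge_of_one_lt_re`). [folklore] -/
private theorem norm_zeta_two_mul_ge {s : ℂ} (hσ : 3 / 4 ≤ s.re) : 1 / 3 ≤ ‖riemannZeta (2 * s)‖ := by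
  have h2re : (2 * s).re = 2 * s.re := by simp [Complex.mul_re]
  have h := ZetaClassicalRegion.norm_riemannZeta_ge_of_one_lt_re (s := 2 * s) (by rw [h2re]; linarith)
  refine le_trans ?_ h
  rw [h2re, div_le_div_iff₀ (by norm_num) (by linarith)]
  linarith

/-- `e^x − 1 ≤ 2x` for `0 ≤ x ≤ 1/2`. [folklore] -/
private theorem exp_sub_one_le_two_mul {x : ℝ} (hx0 : 0 ≤ x) (hx : x ≤ 1 / 2) :
    Real.exp x - 1 ≤ 2 * x := by
  have h1 : Real.exp x * (1 - x) ≤ 1 := by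
    have := Real.one_sub_le_exp_neg x
    calc Real.exp x * (1 - x) ≤ Real.exp x * Real.exp (-x) :=
          mul_le_mul_of_nonneg_left this (Real.exp_nonneg _)
      _ = 1 := by rw [← Real.exp_add, add_neg_cancel, Real.exp_zero]
  have h2 : Real.exp x ≤ 2 := by
    have := Real.exp_one_lt_d9
    calc Real.exp x ≤ Real.exp (1 / 2) := Real.exp_le_exp.mpr hx
      _ = Real.sqrt (Real.exp 1) := by rw [Real.sqrt_eq_rpow, ← Real.exp_mul]; norm_num
      _ ≤ Real.sqrt 4 := Real.sqrt_le_sqrt (by linarith)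
      _ = 2 := by rw [show (4 : ℝ) = 2 ^ 2 by norm_num, Real.sqrt_sq (by norm_num)]
  nlinarith [Real.exp_nonneg x]

/-- Powers against exponentials: `L^k ≤ e^{kL}` for `L ≥ 0`. [folklore] -/
private theorem pow_le_exp_mul {L : ℝ} (hL : 0 ≤ L) (k : ℕ) : L ^ k ≤ Real.exp (k * L) := by
  rw [Real.exp_nat_mul]
  exact pow_le_pow_left₀ hL (by linarith [Real.add_one_le_exp L]) k

/-- `L³ ≤ 4096 e^{3L/16 − 3}` (`L/16 ≤ e^{L/16 − 1}`). [folklore] -/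
private theorem cube_le_exp {L : ℝ} (hL : 0 ≤ L) : L ^ 3 ≤ 4096 * Real.exp (3 * L / 16 - 3) := by
  have h1 : L / 16 ≤ Real.exp (L / 16 - 1) := by linarith [Real.add_one_le_exp (L / 16 - 1)]
  have h2 : L ≤ 16 * Real.exp (L / 16 - 1) := by linarith
  calc L ^ 3 ≤ (16 * Real.exp (L / 16 - 1)) ^ 3 := pow_le_pow_left₀ hL h2 3
    _ = 4096 * Real.exp (L / 16 - 1) ^ 3 := by ring
    _ = 4096 * Real.exp (3 * L / 16 - 3) := by
        rw [← Real.exp_nat_mul]; congr 1; push_cast; ring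

end AssemblyTools

section Assembly

open Literature.NumberTheory.QuadraticFields

variable {D : ℕ} (χ : DirichletCharacter ℂ D)

/-- Norm of a term: `‖g(n) n^{−s}‖ = g(n) n^{−σ}` (`n ≥ 1`). [folklore] -/
private theorem norm_term_eq (hq : χ ^ 2 = 1) (s : ℂ) {n : ℕ} (hn : 0 < n) :
    ‖(charDivisorSum χ n : ℂ) * (n : ℂ) ^ (-s)‖ = charDivisorSum χ n * (n : ℝ) ^ (-s.re) := by
  rw [norm_mul, Complex.norm_real, Real.norm_eq_abs, abs_of_nonneg (charDivisorSum_nonneg χ hq n),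
    Complex.norm_natCast_cpow_of_pos hn, Complex.neg_re]

/-- **Lemma 6, the chain (4.20)–(4.22) with its error terms.** For `Re s = σ ≥ 3/4`, `N ≥ D`, and an
integer `R ≥ 1` with `R² ≤ N/D` below every split prime:
`‖Σ_{n≤N} g(n) n^{−s} − ζ(2s) ∏_{p∣D}(1 + p^{−s})‖ ≤ PiD_D · (3W + 2/√R)`, where
`PiD_D = ∏_{p∣D}(1 − p^{−σ})^{−1}` and `W = Σ_{1<a≤N, a∈A₁} g(a) a^{−σ}` ("(4.20) … = Σ_{r∈R} g(r)r^{−s}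
[1 + O(Σ_{a∈A₁,1<a≤y} g(a)a^{−σ})]; (4.21); (4.22) `Σ_{r∈R, r²≤y/b} r^{−2s} = ζ(2s) − Σ' = ζ(2s) +
O(Σ_{r>(D/4)^{1/(2h)}} r^{−3/2})`", pp. 304–305).
[cite: Pintz1976ElementaryIII, §4 (4.20)–(4.23) pp. 304–305] -/
theorem norm_sum_sub_zeta_mul_prod_le [NeZero D] (hq : χ ^ 2 = 1) {s : ℂ} (hσ : 3 / 4 ≤ s.re)
    {N R : ℕ} (hN : D ≤ N) (hR : 1 ≤ R) (hRN : R * R ≤ N / D)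
    (hRsplit : ∀ p, p.Prime → reChar χ p = 1 → R < p) :
    ‖(∑ n ∈ Ioc 0 N, (charDivisorSum χ n : ℂ) * (n : ℂ) ^ (-s)) -
        riemannZeta (2 * s) * ∏ p ∈ D.primeFactors, (1 + (p : ℂ) ^ (-s))‖ ≤
      (∏ p ∈ D.primeFactors, (1 - (p : ℝ) ^ (-s.re))⁻¹) *
        (3 * ((∑ a ∈ (Ioc 0 N).filter (fun a => ∀ p ∈ a.primeFactors, reChar χ p = 1),
            charDivisorSum χ a * (a : ℝ) ^ (-s.re)) - 1) + 2 / Real.sqrt R) := by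
  classical
  have hD0 : 0 < D := NeZero.pos D
  have hN1 : 1 ≤ N := le_trans (NeZero.one_le) hN
  set σ := s.re with hσdef
  set PiD : ℝ := ∏ p ∈ D.primeFactors, (1 - (p : ℝ) ^ (-σ))⁻¹ with hPiD
  set splitSet := (Ioc 0 N).filter (fun a => ∀ p ∈ a.primeFactors, reChar χ p = 1) with hsplitSet
  set W : ℝ := (∑ a ∈ splitSet, charDivisorSum χ a * (a : ℝ) ^ (-σ)) - 1 with hW
  set freeSet := (Ioc 0 N).filter (fun r => ∀ p ∈ r.primeFactors, reChar χ p ≠ 1) with hfreeSet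
  set c : ℕ → ℂ := fun r => (charDivisorSum χ r : ℂ) * (r : ℂ) ^ (-s) with hc
  set A : ℕ → ℂ := fun r => ∑ a ∈ (Ioc 0 (N / r)).filter (fun a => ∀ p ∈ a.primeFactors, reChar χ p = 1),
    (charDivisorSum χ a : ℂ) * (a : ℂ) ^ (-s) with hA
  set T : ℂ := ∑ n ∈ Ioc 0 N, (charDivisorSum χ n : ℂ) * (n : ℂ) ^ (-s) with hT
  set F : ℂ := ∑ r ∈ freeSet, c r with hF
  -- nonnegativity facts
  have hterm0 : ∀ n : ℕ, 0 ≤ charDivisorSum χ n * (n : ℝ) ^ (-σ) := fun n =>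
    mul_nonneg (charDivisorSum_nonneg χ hq n) (Real.rpow_nonneg (Nat.cast_nonneg n) _)
  have h1split : 1 ∈ splitSet := by
    rw [hsplitSet, Finset.mem_filter, Finset.mem_Ioc]
    exact ⟨⟨Nat.one_pos, hN1⟩, by simp⟩
  have hW' : ∑ a ∈ splitSet.erase 1, charDivisorSum χ a * (a : ℝ) ^ (-σ) = W := by
    rw [hW, Finset.sum_erase_eq_sub h1split]; simp
  have hW0 : 0 ≤ W := by rw [← hW']; exact Finset.sum_nonneg fun a _ => hterm0 a
  have hPiD1 : ∀ p ∈ D.primeFactors, 1 ≤ (1 - (p : ℝ) ^ (-σ))⁻¹ := by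
    intro p hp
    obtain ⟨h0, h1⟩ := prime_rpow_neg_lt_one (Nat.prime_of_mem_primeFactors hp) (by linarith : 0 < σ)
    rw [← one_div, le_div_iff₀ (by linarith)]; linarith
  have hPiDge1 : 1 ≤ PiD := by
    rw [hPiD, ← Finset.prod_const_one (s := D.primeFactors)]
    exact Finset.prod_le_prod (fun _ _ => zero_le_one) (by simpa using hPiD1)
  -- (4.20): `T = Σ_{r free} c(r) A(r)` and `‖A(r) − 1‖ ≤ W`
  have h420 : T = ∑ r ∈ freeSet, c r * A r := sum_eq_sum_free_mul_sum_split χ hq s N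
  have hA1 : ∀ r ∈ freeSet, ‖A r - 1‖ ≤ W := by
    intro r hr
    obtain ⟨hr0, hrN⟩ := Finset.mem_Ioc.mp (Finset.mem_filter.mp hr).1
    have hNr : 1 ≤ N / r := (Nat.le_div_iff_mul_le hr0).mpr (by simpa using hrN)
    set Sr := (Ioc 0 (N / r)).filter (fun a => ∀ p ∈ a.primeFactors, reChar χ p = 1) with hSr
    have h1Sr : 1 ∈ Sr := by
      rw [hSr, Finset.mem_filter, Finset.mem_Ioc]; exact ⟨⟨Nat.one_pos, hNr⟩, by simp⟩
    have hsub : Sr.erase 1 ⊆ splitSet.erase 1 := by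
      refine Finset.erase_subset_erase _ fun a ha => ?_
      rw [hSr, Finset.mem_filter, Finset.mem_Ioc] at ha
      rw [hsplitSet, Finset.mem_filter, Finset.mem_Ioc]
      exact ⟨⟨ha.1.1, ha.1.2.trans (Nat.div_le_self _ _)⟩, ha.2⟩
    have hAr : A r - 1 = ∑ a ∈ Sr.erase 1, (charDivisorSum χ a : ℂ) * (a : ℂ) ^ (-s) := by
      rw [Finset.sum_erase_eq_sub h1Sr]; simp [hA, hSr]
    rw [hAr]
    calc ‖∑ a ∈ Sr.erase 1, (charDivisorSum χ a : ℂ) * (a : ℂ) ^ (-s)‖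
        ≤ ∑ a ∈ Sr.erase 1, ‖(charDivisorSum χ a : ℂ) * (a : ℂ) ^ (-s)‖ := norm_sum_le _ _
      _ = ∑ a ∈ Sr.erase 1, charDivisorSum χ a * (a : ℝ) ^ (-σ) := by
          refine Finset.sum_congr rfl fun a ha => ?_
          have ha0 : 0 < a := (Finset.mem_Ioc.mp (Finset.mem_filter.mp (Finset.mem_of_mem_erase ha)).1).1
          exact norm_term_eq χ hq s ha0
      _ ≤ ∑ a ∈ splitSet.erase 1, charDivisorSum χ a * (a : ℝ) ^ (-σ) :=
          Finset.sum_le_sum_of_subset_of_nonneg hsub fun a _ _ => hterm0 a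
      _ = W := hW'
  have hTF : ‖T - F‖ ≤ PiD * (3 * W) := by
    have hdiff : T - F = ∑ r ∈ freeSet, c r * (A r - 1) := by
      rw [h420, hF, ← Finset.sum_sub_distrib]
      refine Finset.sum_congr rfl fun r _ => by ring
    rw [hdiff]
    calc ‖∑ r ∈ freeSet, c r * (A r - 1)‖ ≤ ∑ r ∈ freeSet, ‖c r * (A r - 1)‖ := norm_sum_le _ _
      _ ≤ ∑ r ∈ freeSet, charDivisorSum χ r * (r : ℝ) ^ (-σ) * W := by
          refine Finset.sum_le_sum fun r hr => ?_
          have hr0 : 0 < r := (Finset.mem_Ioc.mp (Finset.mem_filter.mp hr).1).1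
          rw [norm_mul, hc]; simp only []
          rw [norm_term_eq χ hq s hr0]
          exact mul_le_mul_of_nonneg_left (hA1 r hr) (hterm0 r)
      _ = (∑ r ∈ freeSet, charDivisorSum χ r * (r : ℝ) ^ (-σ)) * W := by rw [Finset.sum_mul]
      _ ≤ (3 * PiD) * W := mul_le_mul_of_nonneg_right (sum_free_le_prod χ hq hσ N) hW0
      _ = PiD * (3 * W) := by ring
  -- (4.21)–(4.22): `F = Σ_b b^{-s} Z_b`, `‖Z_b − ζ(2s)‖ ≤ 2/√R`, `Σ_b b^{-s} = ∏(1 + p^{-s})`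
  set kerSet := (Ioc 0 N).filter (fun b => Squarefree b ∧ ∀ p ∈ b.primeFactors, reChar χ p = 0)
    with hkerSet
  set Z : ℕ → ℂ := fun b => ∑ l ∈ (Ioc 0 (Nat.sqrt (N / b))).filter
      (fun l => ∀ p ∈ l.primeFactors, reChar χ p ≠ 1), ((l : ℂ) ^ (-s)) ^ 2 with hZ
  have h421 : F = ∑ b ∈ kerSet, (b : ℂ) ^ (-s) * Z b := sum_free_eq_sum_kernel_mul_sum_sq χ hq s N
  have hkerSet' : kerSet = (Ioc 0 N).filter (fun b => Squarefree b ∧ ∀ p ∈ b.primeFactors, p ∣ D) := by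
    rw [hkerSet]
    refine Finset.filter_congr fun b _ => ?_
    refine and_congr_right fun _ => forall₂_congr fun p hp => ?_
    exact reChar_prime_eq_zero_iff' χ hq (Nat.prime_of_mem_primeFactors hp)
  have hBc : ∑ b ∈ kerSet, (b : ℂ) ^ (-s) = ∏ p ∈ D.primeFactors, (1 + (p : ℂ) ^ (-s)) := by
    rw [hkerSet']
    exact sum_kernel_eq_prod (fun n : ℕ => (n : ℂ) ^ (-s)) (by simp)
      (fun a b => by rw [Nat.cast_mul, Complex.natCast_mul_natCast_cpow]) hN
  have hBr : ∑ b ∈ kerSet, (b : ℝ) ^ (-σ) = ∏ p ∈ D.primeFactors, (1 + (p : ℝ) ^ (-σ)) := by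
    rw [hkerSet']
    exact sum_kernel_eq_prod (fun n : ℕ => (n : ℝ) ^ (-σ)) (by simp)
      (fun a b => by rw [Nat.cast_mul, Real.mul_rpow (Nat.cast_nonneg a) (Nat.cast_nonneg b)]) hN
  have hBrPiD : ∑ b ∈ kerSet, (b : ℝ) ^ (-σ) ≤ PiD := by
    rw [hBr]; exact (prod_one_sub_le_norm_prod s (by linarith : 0 < s.re)).2
  have hZb : ∀ b ∈ kerSet, ‖Z b - riemannZeta (2 * s)‖ ≤ 2 / Real.sqrt R := by
    intro b hb
    have hb' := hb
    rw [hkerSet'] at hb'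
    obtain ⟨hbIoc, hbsq, hbdvd⟩ := Finset.mem_filter.mp hb'
    obtain ⟨hb0, hbN⟩ := Finset.mem_Ioc.mp hbIoc
    -- `b ∣ D`, so `b ≤ D` and `R ≤ √(N/b)`
    have hbD : b ∣ D := by
      rw [← Nat.prod_primeFactors_of_squarefree hbsq]
      have hsub : b.primeFactors ⊆ D.primeFactors := fun q hq =>
        Nat.mem_primeFactors.mpr ⟨Nat.prime_of_mem_primeFactors hq, hbdvd q hq, hD0.ne'⟩
      exact (Finset.prod_dvd_prod_of_subset _ _ _ hsub).trans (Nat.prod_primeFactors_dvd D)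
    have hbleD : b ≤ D := Nat.le_of_dvd hD0 hbD
    have hRsqrt : R ≤ Nat.sqrt (N / b) := by
      rw [Nat.le_sqrt]
      exact hRN.trans (Nat.div_le_div_left hbleD hb0)
    refine norm_sum_sq_sub_zeta_le hσ hR _ (by simp) fun n hn1 hnR => ?_
    rw [Finset.mem_filter, Finset.mem_Ioc]
    refine ⟨⟨hn1, hnR.trans hRsqrt⟩, fun p hp h1 => ?_⟩
    have hpn : p ≤ n := Nat.le_of_dvd hn1 (Nat.dvd_of_mem_primeFactors hp)
    have := hRsplit p (Nat.prime_of_mem_primeFactors hp) h1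
    omega
  have hFB : ‖F - riemannZeta (2 * s) * ∏ p ∈ D.primeFactors, (1 + (p : ℂ) ^ (-s))‖ ≤
      PiD * (2 / Real.sqrt R) := by
    have hdiff : F - riemannZeta (2 * s) * ∏ p ∈ D.primeFactors, (1 + (p : ℂ) ^ (-s)) =
        ∑ b ∈ kerSet, (b : ℂ) ^ (-s) * (Z b - riemannZeta (2 * s)) := by
      rw [h421, ← hBc, Finset.mul_sum, ← Finset.sum_sub_distrib]
      refine Finset.sum_congr rfl fun b _ => by ring
    rw [hdiff]
    calc ‖∑ b ∈ kerSet, (b : ℂ) ^ (-s) * (Z b - riemannZeta (2 * s))‖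
        ≤ ∑ b ∈ kerSet, ‖(b : ℂ) ^ (-s) * (Z b - riemannZeta (2 * s))‖ := norm_sum_le _ _
      _ ≤ ∑ b ∈ kerSet, (b : ℝ) ^ (-σ) * (2 / Real.sqrt R) := by
          refine Finset.sum_le_sum fun b hb => ?_
          have hb0 : 0 < b := (Finset.mem_Ioc.mp (Finset.mem_filter.mp hb).1).1
          rw [norm_mul, Complex.norm_natCast_cpow_of_pos hb0, Complex.neg_re]
          exact mul_le_mul_of_nonneg_left (hZb b hb) (Real.rpow_nonneg (Nat.cast_nonneg b) _)
      _ = (∑ b ∈ kerSet, (b : ℝ) ^ (-σ)) * (2 / Real.sqrt R) := by rw [Finset.sum_mul]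
      _ ≤ PiD * (2 / Real.sqrt R) := mul_le_mul_of_nonneg_right hBrPiD (by positivity)
  -- combine
  calc ‖T - riemannZeta (2 * s) * ∏ p ∈ D.primeFactors, (1 + (p : ℂ) ^ (-s))‖
      = ‖(T - F) + (F - riemannZeta (2 * s) * ∏ p ∈ D.primeFactors, (1 + (p : ℂ) ^ (-s)))‖ := by
        congr 1; ring
    _ ≤ ‖T - F‖ + ‖F - riemannZeta (2 * s) * ∏ p ∈ D.primeFactors, (1 + (p : ℂ) ^ (-s))‖ :=
        norm_add_le _ _
    _ ≤ PiD * (3 * W) + PiD * (2 / Real.sqrt R) := add_le_add hTF hFB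
    _ = PiD * (3 * W + 2 / Real.sqrt R) := by ring

end Assembly

section SplitSumTotal

open Literature.NumberTheory.QuadraticFields

variable {K : Type} [Field K] [NumberField K] {D : ℕ} [NeZero D] (χ : DirichletCharacter ℂ D)

/-- **(4.6) + (4.7) + (4.11) + (4.13): the split primes `p ≤ y` in the `p^{−σ}`-measure.** For
`σ ≥ ¾ + ε`, `1 − σ ≤ τ`, `D^{−ε/4} ≤ τ ≤ ¼ − ε`, `y = D^{(½−ε)/τ}`:
`Σ_{p ≤ y, χ(p)=1} p^{−σ} ≤ Σ₁ + Σ₂ + Σ₃` with the three bounds of Part R.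
[cite: Pintz1976ElementaryIII, §4 (4.6)–(4.13) pp. 302–303] -/
theorem sum_rpow_splitPrimes_le (h2 : Module.finrank ℚ K = 2)
    (hd : NumberField.discr K < 0) (hKD : (NumberField.discr K).natAbs = D)
    (hprim : χ.IsPrimitive) (hquad : χ.IsQuadratic) (hodd : χ.Odd) {C₄ : ℝ}
    (hL4 : ∀ s : ℂ, s ≠ 1 → 0 ≤ 1 - s.re → 1 - s.re ≤ 1 / 2 →
      ∀ x : ℝ, ‖s‖ ^ 2 * max 1 (1 / ‖1 - s‖) * Real.sqrt D ≤ x →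
        ‖(∑ n ∈ Icc 1 ⌊x⌋₊, (∑ d ∈ n.divisors, χ (d : ZMod D)) * (n : ℂ) ^ (-s)) -
            χ.LFunction s * riemannZeta s - χ.LFunction 1 * (x : ℂ) ^ (1 - s) / (1 - s)‖ ≤
          C₄ * (x ^ (1 - s.re) * ‖s‖ * (D : ℝ) ^ (1 / 4 : ℝ) * Real.sqrt (max 1 (1 / ‖1 - s‖)) *
            Real.log D * Real.log x / Real.sqrt x))
    (hL1 : χ.LFunction 1 = ((Real.pi * (NumberField.classNumber K : ℝ) / Real.sqrt D : ℝ) : ℂ))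
    {ε : ℝ} (hε : 0 < ε) (hε8 : ε < 1 / 8) (hD : 1024 ≤ D) {σ τ : ℝ} (hστ : 1 - σ ≤ τ)
    (hσ : 3 / 4 + ε ≤ σ) (hτD : (D : ℝ) ^ (-ε / 4) ≤ τ) (hτ : τ ≤ 1 / 4 - ε) :
    ∑ p ∈ (⌊(D : ℝ) ^ ((1 / 2 - ε) / τ)⌋₊ + 1).primesBelow.filter (fun p => reChar χ p = 1),
        (p : ℝ) ^ (-σ) ≤
      (NumberField.classNumber K : ℝ) *
          (4 / (D : ℝ)) ^ (σ / (2 * (NumberField.classNumber K : ℝ))) +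
        Real.sqrt (8 * Real.pi * (NumberField.classNumber K : ℝ) * (D : ℝ) ^ (-(2 * ε)) +
          12 * |C₄| * ((D : ℝ) ^ (-ε) * Real.log D ^ 2)) +
        (Real.pi * (NumberField.classNumber K : ℝ) * (D : ℝ) ^ (-(3 * ε / 4)) / 2 +
          3 / 2 * |C₄| * ((D : ℝ) ^ (-(7 * ε / 8)) * Real.log D ^ 2)) := by
  classical
  have hq : χ ^ 2 = 1 := MulChar.IsQuadratic.sq_eq_one hquad
  have hσ0 : 0 < σ := by linarith
  have hh0 : 0 ≤ (NumberField.classNumber K : ℝ) := by positivity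
  set N := ⌊(D : ℝ) ^ ((1 / 2 - ε) / τ)⌋₊ with hN
  set Q := (N + 1).primesBelow.filter (fun p => reChar χ p = 1) with hQ
  have hQmem : ∀ p ∈ Q, p.Prime ∧ p ≤ N ∧ reChar χ p = 1 := by
    intro p hp
    rw [hQ, Finset.mem_filter, Nat.mem_primesBelow] at hp
    exact ⟨hp.1.2, by omega, hp.2⟩
  have hterm0 : ∀ p : ℕ, 0 ≤ (p : ℝ) ^ (-σ) := fun p => Real.rpow_nonneg (Nat.cast_nonneg p) _
  rw [← Finset.sum_filter_add_sum_filter_not Q (fun p => 4 * p ^ 2 ≤ D),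
    ← Finset.sum_filter_add_sum_filter_not (Q.filter (fun p => ¬ 4 * p ^ 2 ≤ D)) (fun p => p ≤ D),
    add_assoc]
  refine add_le_add ?_ (add_le_add ?_ ?_)
  · -- `p ≤ √D/2`
    refine sum_rpow_smallSplitPrimes_le χ h2 hd hKD hprim hquad hodd hσ0 _ fun p hp => ?_
    rw [Finset.mem_filter] at hp
    exact ⟨(hQmem p hp.1).1, hp.2, (hQmem p hp.1).2.2⟩
  · -- `√D/2 < p ≤ D`
    set P := (Q.filter (fun p => ¬ 4 * p ^ 2 ≤ D)).filter (fun p => p ≤ D) with hP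
    have hPmem : ∀ p ∈ P, p.Prime ∧ D < 4 * p ^ 2 ∧ p ≤ D ∧ reChar χ p = 1 := by
      intro p hp
      rw [hP, Finset.mem_filter, Finset.mem_filter] at hp
      exact ⟨(hQmem p hp.1.1).1, by omega, hp.2, (hQmem p hp.1.1).2.2⟩
    have hmid := sq_sum_rpow_midSplitPrimes_le χ hq hL4 hh0 hL1 hε hε8 hD P hPmem
    have hle : ∑ p ∈ P, (p : ℝ) ^ (-σ) ≤ ∑ p ∈ P, (p : ℝ) ^ (-(3 / 4 + ε)) := by
      refine Finset.sum_le_sum fun p hp => ?_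
      have hp1 : (1 : ℝ) ≤ p := by exact_mod_cast (hPmem p hp).1.one_lt.le
      exact Real.rpow_le_rpow_of_exponent_le hp1 (by linarith)
    exact hle.trans (Real.le_sqrt_of_sq_le hmid)
  · -- `D < p ≤ y`
    set P := (Q.filter (fun p => ¬ 4 * p ^ 2 ≤ D)).filter (fun p => ¬ p ≤ D) with hP
    have hPmem : ∀ p ∈ P, p.Prime ∧ D < p ∧ p ≤ ⌊(D : ℝ) ^ ((1 / 2 - ε) / τ)⌋₊ ∧ reChar χ p = 1 := by
      intro p hp
      rw [hP, Finset.mem_filter, Finset.mem_filter] at hp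
      exact ⟨(hQmem p hp.1.1).1, by omega, (hQmem p hp.1.1).2.1, (hQmem p hp.1.1).2.2⟩
    have hD3 : 3 ≤ D := le_trans (by norm_num) hD
    have hbig := sum_rpow_bigSplitPrimes_le χ hq hL4 hh0 hL1 hε hε8 hτD hτ hD3 P hPmem
    have hle : ∑ p ∈ P, (p : ℝ) ^ (-σ) ≤ ∑ p ∈ P, (p : ℝ) ^ (-(1 - τ)) := by
      refine Finset.sum_le_sum fun p hp => ?_
      have hp1 : (1 : ℝ) ≤ p := by exact_mod_cast (hPmem p hp).1.one_lt.le
      exact Real.rpow_le_rpow_of_exponent_le hp1 (by linarith)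
    exact hle.trans hbig

end SplitSumTotal

section Numerics

variable {D : ℕ}

/-- Thresholds in `L = log^{1/4}D`: if `m + t ≤ a·(εL³)` (`t ≥ 0`, `L ≥ 1`) then
`e^{−aεL⁴} ≤ e^{−mL − t}`. [folklore] -/
private theorem exp_neg_rpow_le {ε L a m t : ℝ} (hL : 1 ≤ L) (ht : 0 ≤ t)
    (h : m + t ≤ a * (ε * L ^ 3)) : Real.exp (-(a * ε) * L ^ 4) ≤ Real.exp (-(m * L) - t) := by
  rw [Real.exp_le_exp]
  have h1 : (m + t) * L ≤ a * (ε * L ^ 3) * L := mul_le_mul_of_nonneg_right h (by linarith)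
  nlinarith

/-- Numerics: `571 e^{−3L/16} ≤ 1/10` and `51411 e^{−L/8} < 1` for `L ≥ 640`. [folklore] -/
private theorem exp_numerics {L : ℝ} (hL : 640 ≤ L) :
    571 * Real.exp (-(3 * L / 16)) ≤ 1 / 10 ∧ 51411 * Real.exp (-(L / 8)) < 1 := by
  have h40 : (41 : ℝ) ≤ Real.exp 40 := by linarith [Real.add_one_le_exp (40 : ℝ)]
  have h120 : (41 : ℝ) ^ 3 ≤ Real.exp 120 := by
    calc (41 : ℝ) ^ 3 ≤ Real.exp 40 ^ 3 := pow_le_pow_left₀ (by norm_num) h40 3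
      _ = Real.exp 120 := by rw [← Real.exp_nat_mul]; norm_num
  have h20 : (21 : ℝ) ≤ Real.exp 20 := by linarith [Real.add_one_le_exp (20 : ℝ)]
  have h80 : (21 : ℝ) ^ 4 ≤ Real.exp 80 := by
    calc (21 : ℝ) ^ 4 ≤ Real.exp 20 ^ 4 := pow_le_pow_left₀ (by norm_num) h20 4
      _ = Real.exp 80 := by rw [← Real.exp_nat_mul]; norm_num
  constructor
  · have h1 : Real.exp (-(3 * L / 16)) ≤ Real.exp (-120) := Real.exp_le_exp.mpr (by linarith)
    have h2 : Real.exp (-120) * Real.exp 120 = 1 := by rw [← Real.exp_add]; norm_num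
    nlinarith [Real.exp_pos (-(3 * L / 16)), Real.exp_pos (-120 : ℝ)]
  · have h1 : Real.exp (-(L / 8)) ≤ Real.exp (-80) := Real.exp_le_exp.mpr (by linarith)
    have h2 : Real.exp (-80) * Real.exp 80 = 1 := by rw [← Real.exp_add]; norm_num
    nlinarith [Real.exp_pos (-(L / 8)), Real.exp_pos (-80 : ℝ)]

/-- **(4.25): the ramified primes.** With `L = log^{1/4}D` and `L ≥ 640·exp(400·640³)`:
`Σ_{p∣D} p^{−3/4} ≤ L/80` (from `sum_primeFactors_rpow_le` with `P₀ = ⌊(L/640)⁴⌋`). The print has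
`Σ_{p∣D} p^{−3/4} = O(Σ_{p<log D} p^{−3/4}) = o(log^{1/4}D)` (p. 305); here it is made effective
crudely. [folklore] -/
private theorem sum_primeFactors_le_L [NeZero D] {L : ℝ} (hlogD : Real.log D = L ^ 4)
    (hL : 640 * Real.exp (400 * 640 ^ 3) ≤ L) :
    ∑ p ∈ D.primeFactors, (p : ℝ) ^ (-(3 / 4) : ℝ) ≤ L / 80 := by
  set M : ℝ := 400 * 640 ^ 3 with hM
  have hM0 : 1 ≤ M := by rw [hM]; norm_num
  have hexpM : 2 ≤ Real.exp M := by linarith [Real.add_one_le_exp M]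
  have hL640 : Real.exp M ≤ L / 640 := by rw [le_div_iff₀ (by norm_num)]; linarith
  have hu2 : 2 ≤ L / 640 := hexpM.trans hL640
  set u : ℝ := L / 640 with hu
  have hu0 : 0 < u := by linarith
  have hlogu : M ≤ Real.log u := by
    rw [Real.le_log_iff_exp_le hu0]; exact hL640
  have hlog2 : Real.log 2 ≤ M := le_trans (le_of_lt (by
    have := Real.log_two_lt_d9; linarith)) hM0
  -- `P₀ = ⌊u⁴⌋`, `u⁴/2 ≤ P₀ ≤ u⁴`, `P₀ ≥ 2`
  have hu4 : (16 : ℝ) ≤ u ^ 4 := by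
    calc (16 : ℝ) = 2 ^ 4 := by norm_num
      _ ≤ u ^ 4 := pow_le_pow_left₀ (by norm_num) hu2 4
  set P₀ : ℕ := ⌊u ^ 4⌋₊ with hP₀
  have hP₀le : (P₀ : ℝ) ≤ u ^ 4 := Nat.floor_le (by positivity)
  have hP₀ge : u ^ 4 / 2 ≤ (P₀ : ℝ) := by
    have := Nat.sub_one_lt_floor (u ^ 4); rw [← hP₀] at this; linarith
  have hP₀2 : 2 ≤ P₀ := by
    have h3 : (1 : ℝ) < P₀ := by linarith
    have : 1 < P₀ := by exact_mod_cast h3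
    omega
  have hP₀pos : (0 : ℝ) < P₀ := by exact_mod_cast (by omega : 0 < P₀)
  have hmain := sum_primeFactors_rpow_le (D := D) hP₀2
  -- `4 P₀^{1/4} ≤ L/160`
  have h1 : (P₀ : ℝ) ^ (1 / 4 : ℝ) ≤ u := by
    calc (P₀ : ℝ) ^ (1 / 4 : ℝ) ≤ (u ^ 4) ^ (1 / 4 : ℝ) := Real.rpow_le_rpow (by positivity) hP₀le (by norm_num)
      _ = u := by rw [show (1 / 4 : ℝ) = ((4 : ℕ) : ℝ)⁻¹ by norm_num, Real.pow_rpow_inv_natCast hu0.le (by norm_num)]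
  -- `log P₀ ≥ 3 log u ≥ 3M` and `P₀^{-3/4} ≤ 2/u³`
  have hlogP₀ : 3 * M ≤ Real.log P₀ := by
    have : Real.log (u ^ 4 / 2) ≤ Real.log P₀ := Real.log_le_log (by positivity) hP₀ge
    rw [Real.log_div (by positivity) (by norm_num), Real.log_pow] at this
    push_cast at this
    linarith
  have hlogP₀pos : 0 < Real.log P₀ := by linarith
  have h2 : (P₀ : ℝ) ^ (-(3 / 4) : ℝ) ≤ 2 / u ^ 3 := by
    have e1 : (u ^ 4) ^ (-(3 / 4) : ℝ) = (u ^ 3)⁻¹ := by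
      rw [← Real.rpow_natCast u 4, ← Real.rpow_mul hu0.le,
        show ((4 : ℕ) : ℝ) * (-(3 / 4) : ℝ) = -((3 : ℕ) : ℝ) by norm_num, Real.rpow_neg hu0.le,
        Real.rpow_natCast]
    have e2 : (1 / 2 : ℝ) ≤ (2 : ℝ) ^ (-(3 / 4) : ℝ) := by
      calc (1 / 2 : ℝ) = (2 : ℝ) ^ (-1 : ℝ) := by rw [Real.rpow_neg_one]; norm_num
        _ ≤ (2 : ℝ) ^ (-(3 / 4) : ℝ) := Real.rpow_le_rpow_of_exponent_le (by norm_num) (by norm_num)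
    calc (P₀ : ℝ) ^ (-(3 / 4) : ℝ) ≤ (u ^ 4 / 2) ^ (-(3 / 4) : ℝ) :=
          Real.rpow_le_rpow_of_nonpos (by positivity) hP₀ge (by norm_num)
      _ = (u ^ 3)⁻¹ / (2 : ℝ) ^ (-(3 / 4) : ℝ) := by
          rw [Real.div_rpow (by positivity) (by norm_num), e1]
      _ ≤ (u ^ 3)⁻¹ / (1 / 2) := div_le_div_of_nonneg_left (by positivity) (by norm_num) e2
      _ = 2 / u ^ 3 := by field_simp
  have h3 : Real.log D / Real.log P₀ * (P₀ : ℝ) ^ (-(3 / 4) : ℝ) ≤ L / 600 := by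
    have hlogD0 : 0 ≤ Real.log D := by rw [hlogD]; positivity
    calc Real.log D / Real.log P₀ * (P₀ : ℝ) ^ (-(3 / 4) : ℝ)
        ≤ L ^ 4 / (3 * M) * (2 / u ^ 3) := by
          rw [hlogD]
          exact mul_le_mul (div_le_div_of_nonneg_left (by positivity) (by positivity) hlogP₀) h2
            (Real.rpow_nonneg hP₀pos.le _) (by positivity)
      _ = L * (2 * 640 ^ 3 / (3 * M)) := by rw [hu]; field_simp
      _ ≤ L * (1 / 600) := by
          refine mul_le_mul_of_nonneg_left ?_ (by linarith)
          rw [hM]; norm_num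
      _ = L / 600 := by ring
  calc ∑ p ∈ D.primeFactors, (p : ℝ) ^ (-(3 / 4) : ℝ)
      ≤ 4 * (P₀ : ℝ) ^ (1 / 4 : ℝ) + Real.log D / Real.log P₀ * (P₀ : ℝ) ^ (-(3 / 4) : ℝ) := hmain
    _ ≤ 4 * u + L / 600 := add_le_add (by linarith) h3
    _ ≤ L / 80 := by rw [hu]; linarith

/-- **(4.7), the size of `Σ₁`**: `h (4/D)^{σ/(2h)} ≤ 560 e^{−3L/16}` for `1 ≤ h ≤ L³`, `σ ≥ ¾`,
`log D = L⁴`, `L ≥ 1`, `D ≥ 8`. [folklore] -/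
private theorem smallTerm_le {h σ L : ℝ} (hh1 : 1 ≤ h) (hhL : h ≤ L ^ 3) (hσ : 3 / 4 ≤ σ) (hL : 1 ≤ L)
    (hD8 : 8 ≤ D) (hlogD : Real.log D = L ^ 4) :
    h * (4 / (D : ℝ)) ^ (σ / (2 * h)) ≤ 560 * Real.exp (-(3 * L / 16)) := by
  have hD8r : (8 : ℝ) ≤ D := by exact_mod_cast hD8
  have hD0 : (0 : ℝ) < D := by linarith
  have hb0 : 0 < 4 / (D : ℝ) := by positivity
  have hb1 : 4 / (D : ℝ) ≤ 1 := by rw [div_le_one hD0]; linarith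
  have hh0 : 0 < h := by linarith
  have hL3 : 0 < L ^ 3 := by positivity
  -- exponent `σ/(2h) ≥ 3/(8L³)`
  have hexp : 3 / (8 * L ^ 3) ≤ σ / (2 * h) := by
    rw [div_le_div_iff₀ (by positivity) (by positivity)]; nlinarith
  have h1 : (4 / (D : ℝ)) ^ (σ / (2 * h)) ≤ (4 / (D : ℝ)) ^ (3 / (8 * L ^ 3)) :=
    Real.rpow_le_rpow_of_exponent_ge hb0 hb1 hexp
  -- `(4/D)^{3/(8L³)} = exp((3/(8L³))(log 4 − L⁴)) ≤ exp(1 − 3L/8)`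
  have hlog4 : Real.log 4 ≤ 2 := by
    have := Real.log_two_lt_d9
    rw [show (4 : ℝ) = 2 ^ 2 by norm_num, Real.log_pow]; push_cast; linarith
  have h2 : (4 / (D : ℝ)) ^ (3 / (8 * L ^ 3)) ≤ Real.exp (1 - 3 * L / 8) := by
    rw [Real.rpow_def_of_pos hb0, Real.log_div (by norm_num) hD0.ne', hlogD, Real.exp_le_exp]
    have hkey : (Real.log 4 - L ^ 4) * (3 / (8 * L ^ 3)) = 3 * Real.log 4 / (8 * L ^ 3) - 3 * L / 8 := by
      field_simp
    rw [hkey]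
    have : 3 * Real.log 4 / (8 * L ^ 3) ≤ 1 := by
      rw [div_le_one (by positivity)]; nlinarith
    linarith
  have h3 : L ^ 3 ≤ 4096 * Real.exp (3 * L / 16 - 3) := cube_le_exp (by linarith)
  have he : Real.exp 1 ≤ 3 := le_of_lt (lt_trans Real.exp_one_lt_d9 (by norm_num))
  calc h * (4 / (D : ℝ)) ^ (σ / (2 * h)) ≤ L ^ 3 * Real.exp (1 - 3 * L / 8) :=
        mul_le_mul hhL (h1.trans h2) (Real.rpow_nonneg hb0.le _) (by positivity)
    _ ≤ 4096 * Real.exp (3 * L / 16 - 3) * Real.exp (1 - 3 * L / 8) :=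
        mul_le_mul_of_nonneg_right h3 (Real.exp_nonneg _)
    _ = Real.exp (-(3 * L / 16)) * (4096 * Real.exp (-2)) := by
        have : Real.exp (3 * L / 16 - 3) * Real.exp (1 - 3 * L / 8) =
            Real.exp (-(3 * L / 16)) * Real.exp (-2) := by
          rw [← Real.exp_add, ← Real.exp_add]; congr 1; ring
        calc 4096 * Real.exp (3 * L / 16 - 3) * Real.exp (1 - 3 * L / 8)
            = 4096 * (Real.exp (3 * L / 16 - 3) * Real.exp (1 - 3 * L / 8)) := by ring
          _ = _ := by rw [this]; ring
    _ ≤ Real.exp (-(3 * L / 16)) * 560 := by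
        refine mul_le_mul_of_nonneg_left ?_ (Real.exp_nonneg _)
        have hg := Real.exp_one_gt_d9
        have hE2 : (7.32 : ℝ) ≤ Real.exp 2 := by
          have : Real.exp 2 = Real.exp 1 ^ 2 := by rw [← Real.exp_nat_mul]; norm_num
          rw [this]; nlinarith
        have hprod : Real.exp (-2) * Real.exp 2 = 1 := by rw [← Real.exp_add]; norm_num
        nlinarith [Real.exp_pos (-2 : ℝ)]
    _ = 560 * Real.exp (-(3 * L / 16)) := mul_comm _ _

/-- **(4.22)/(4.26), the size of `R = ⌊(D/4)^{1/(2h)}⌋`**: if `e^{L/2 − 1} ≤ ρ₀` and `L ≥ 4` then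
`1 ≤ ⌊ρ₀⌋` and `2/√⌊ρ₀⌋ ≤ 6 e^{−L/4}`. [folklore] -/
private theorem floor_root_bounds {ρ₀ L : ℝ} (hρ : Real.exp (L / 2 - 1) ≤ ρ₀) (hL : 4 ≤ L) :
    1 ≤ ⌊ρ₀⌋₊ ∧ 2 / Real.sqrt (⌊ρ₀⌋₊ : ℕ) ≤ 6 * Real.exp (-(L / 4)) := by
  have he2 : 2 ≤ Real.exp (L / 2 - 1) := by
    have : (1 : ℝ) ≤ L / 2 - 1 := by linarith
    linarith [Real.add_one_le_exp (L / 2 - 1)]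
  have hρ2 : 2 ≤ ρ₀ := he2.trans hρ
  have hR1 : 1 ≤ ⌊ρ₀⌋₊ := Nat.le_floor (by push_cast; linarith)
  refine ⟨hR1, ?_⟩
  have hRge : ρ₀ / 2 ≤ (⌊ρ₀⌋₊ : ℝ) := by
    have := Nat.sub_one_lt_floor ρ₀; linarith
  -- `⌊ρ₀⌋ ≥ ρ₀/2 ≥ e^{L/2−1}/2 ≥ e^{L/2−2} = (e^{L/4−1})²`
  have hhalf : Real.exp (L / 2 - 2) ≤ Real.exp (L / 2 - 1) / 2 := by
    rw [show L / 2 - 2 = (L / 2 - 1) + (-1) by ring, Real.exp_add, le_div_iff₀ (by norm_num)]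
    have : Real.exp (-1) * 2 ≤ 1 := by
      rw [Real.exp_neg]
      have := Real.add_one_le_exp (1 : ℝ)
      rw [inv_mul_le_iff₀ (Real.exp_pos 1)]; linarith
    nlinarith [Real.exp_pos (L / 2 - 1)]
  have hR : Real.exp (L / 4 - 1) ^ 2 ≤ (⌊ρ₀⌋₊ : ℝ) := by
    rw [← Real.exp_nat_mul, show ((2 : ℕ) : ℝ) * (L / 4 - 1) = L / 2 - 2 by push_cast; ring]
    linarith
  have hsqrt : Real.exp (L / 4 - 1) ≤ Real.sqrt (⌊ρ₀⌋₊ : ℕ) := by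
    rw [← Real.sqrt_sq (Real.exp_pos _).le]
    exact Real.sqrt_le_sqrt (by exact_mod_cast hR)
  have he3 : Real.exp 1 ≤ 3 := le_of_lt (lt_trans Real.exp_one_lt_d9 (by norm_num))
  calc 2 / Real.sqrt (⌊ρ₀⌋₊ : ℕ) ≤ 2 / Real.exp (L / 4 - 1) :=
        div_le_div_of_nonneg_left (by norm_num) (Real.exp_pos _) hsqrt
    _ = 2 * Real.exp 1 * Real.exp (-(L / 4)) := by
        rw [show L / 4 - 1 = -( -(L / 4) + 1) by ring, Real.exp_neg, div_inv_eq_mul, Real.exp_add]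
        ring
    _ ≤ 6 * Real.exp (-(L / 4)) := by nlinarith [Real.exp_pos (-(L / 4))]

end Numerics

section TheoremTwo

open Literature.NumberTheory.QuadraticFields

set_option maxHeartbeats 2000000 in
/-- **Theorem 2 with `D = |d_K|` as a separate variable** (Lemma 5 + Lemma 6 + §5, pp. 300–306).
With `L = log^{1/4}D`: for `D > D₁(ε)` and `h_K ≤ log^{3/4}D`, on `H(ε, D)`:
`L(s)ζ(s) = ζ(2s)∏_{p∣D}(1 + p^{−s}) + E`, `3Π_D‖E‖ ≤ 51411 e^{−L/8} < 1`
(`Π_D = ∏_{p∣D}(1 − p^{−σ})^{−1} ≤ e^{L/32}` by (4.25)), whence `ζ(s) ≠ 0`, `L(s) ≠ 0`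
(`‖ζ(2s)∏(1 + p^{−s})‖ ≥ 1/(3Π_D)`) and `‖L(s) − M(s)‖ = ‖E‖/‖ζ(s)‖ ≤ ‖M(s)‖ · 3Π_D‖E‖`
("(5.1) `L(s)ζ(s) = ζ(2s)∏_{p∣D}(1 + p^{−s})[1 + O(e^{−L/8})]` … as for `σ ≥ ¾`
`|ζ(2s)∏(1 + p^{−s})| ≥ (1/ζ(3/2))∏(1 − p^{−3/4}) > 0`, (5.1) implies `ζ(s) ≠ 0` and so …", p. 306).
The constant `C = 52000` is absolute; all dependence on `ε` (and on the Lemma 4/5 constants) is in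
the crude explicit threshold `D₁(ε) = max(D₄, D₅, 1024, ⌈exp(L*⁴)⌉)`,
`L* = max(640·e^{400·640³}, B/ε + 1)`, `B = 40 + 2 log(1 + |C₄|) + 2 log(1 + |C₅|)`.
[cite: Pintz1976ElementaryIII, Theorem 2 pp. 296–297; §4 (4.23)–(4.28) pp. 305–306; §5 p. 306] -/
theorem theorem2_aux {ε : ℝ} (hε : 0 < ε) (hε8 : ε < 1 / 8) :
    ∃ C : ℝ, ∃ D₁ : ℕ, ∀ (D : ℕ) [NeZero D] (K : Type) [Field K] [NumberField K],
      Module.finrank ℚ K = 2 → NumberField.discr K < 0 → (NumberField.discr K).natAbs = D →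
      D₁ < D → (NumberField.classNumber K : ℝ) ≤ Real.log D ^ (3 / 4 : ℝ) →
      ∀ χ : DirichletCharacter ℂ D, χ.IsQuadratic → χ.IsPrimitive → χ.Odd →
      ∀ s : ℂ, s ∈ region ε D →
        χ.LFunction s ≠ 0 ∧ riemannZeta s ≠ 0 ∧
        ‖χ.LFunction s - BellottiPuglisi2023.mainTerm D s‖ ≤
          ‖BellottiPuglisi2023.mainTerm D s‖ * C *
            Real.exp (-(1 / 8) * Real.log D ^ (1 / 4 : ℝ)) := by
  classical
  obtain ⟨C₅, D₅, hL5⟩ := lemma5 hε hε8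
  obtain ⟨C₄, D₄, hL4⟩ := pintz1976Deuring_lemma4_largeD_holds
  set B : ℝ := 40 + 2 * Real.log (1 + |C₄|) + 2 * Real.log (1 + |C₅|) with hB
  set Lstar : ℝ := max (640 * Real.exp (400 * 640 ^ 3)) (B / ε + 1) with hLstar
  refine ⟨52000, max (max D₄ D₅) (max 1024 ⌈Real.exp (Lstar ^ 4)⌉₊), ?_⟩
  intro D _ K _ _ h2 hd hKD hD₁ hh χ hquad hprim hodd s hs
  /- (0) thresholds; `L = log^{1/4} D ≥ L*` -/
  have hDD₄ : D₄ < D := lt_of_le_of_lt (le_trans (le_max_left _ _) (le_max_left _ _)) hD₁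
  have hDD₅ : D₅ < D := lt_of_le_of_lt (le_trans (le_max_right _ _) (le_max_left _ _)) hD₁
  have hD1024 : 1024 ≤ D :=
    le_of_lt (lt_of_le_of_lt (le_trans (le_max_left _ _) (le_max_right _ _)) hD₁)
  have hDceil : ⌈Real.exp (Lstar ^ 4)⌉₊ < D :=
    lt_of_le_of_lt (le_trans (le_max_right _ _) (le_max_right _ _)) hD₁
  have hD0 : 0 < D := NeZero.pos D
  have hD0r : (0 : ℝ) < D := by exact_mod_cast hD0
  have hD1r : (1 : ℝ) ≤ D := by exact_mod_cast NeZero.one_le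
  have hD1024r : (1024 : ℝ) ≤ D := by exact_mod_cast hD1024
  have hLstar0 : 0 ≤ Lstar := le_trans (by positivity) (le_max_left _ _)
  have hlogDge : Lstar ^ 4 ≤ Real.log D := by
    rw [Real.le_log_iff_exp_le hD0r]
    exact le_trans (Nat.le_ceil _) (by exact_mod_cast hDceil.le)
  have hlogD0 : 0 ≤ Real.log D := Real.log_nonneg hD1r
  set L : ℝ := Real.log D ^ (1 / 4 : ℝ) with hLdef
  have hlogD : Real.log D = L ^ 4 := by
    rw [hLdef, show (1 / 4 : ℝ) = ((4 : ℕ) : ℝ)⁻¹ by norm_num,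
      Real.rpow_inv_natCast_pow hlogD0 (by norm_num)]
  have hLge : Lstar ≤ L := by
    calc Lstar = (Lstar ^ 4) ^ (1 / 4 : ℝ) := by
          rw [show (1 / 4 : ℝ) = ((4 : ℕ) : ℝ)⁻¹ by norm_num,
            Real.pow_rpow_inv_natCast hLstar0 (by norm_num)]
      _ ≤ L := Real.rpow_le_rpow (by positivity) hlogDge (by norm_num)
  have hLbig : 640 * Real.exp (400 * 640 ^ 3) ≤ L := le_trans (le_max_left _ _) hLge
  have hL640 : 640 ≤ L := by
    have : (1 : ℝ) ≤ Real.exp (400 * 640 ^ 3) := Real.one_le_exp (by positivity)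
    nlinarith
  have hL1 : 1 ≤ L := by linarith
  have hLfour : 4 ≤ L := by linarith
  have hLB : B / ε + 1 ≤ L := le_trans (le_max_right _ _) hLge
  have hlogC₄ : 0 ≤ Real.log (1 + |C₄|) := Real.log_nonneg (by linarith [abs_nonneg C₄])
  have hlogC₅ : 0 ≤ Real.log (1 + |C₅|) := Real.log_nonneg (by linarith [abs_nonneg C₅])
  have hεL3 : B ≤ ε * L ^ 3 := by
    have h1 : B ≤ L * ε := by
      have : B / ε ≤ L := by linarith
      rwa [div_le_iff₀ hε] at this
    have h2 : ε * L ≤ ε * L ^ 3 := mul_le_mul_of_nonneg_left (le_self_pow₀ hL1 (by norm_num)) hε.le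
    linarith
  have hDpow : ∀ x : ℝ, (D : ℝ) ^ x = Real.exp (x * L ^ 4) := fun x => by
    rw [Real.rpow_def_of_pos hD0r, hlogD, mul_comm]
  -- the exponential thresholds
  have hT1 : |C₅| * (D : ℝ) ^ (-ε / 2) ≤ Real.exp (-(20 * L)) := by
    rw [hDpow, show -ε / 2 * L ^ 4 = -(1 / 2 * ε) * L ^ 4 by ring]
    have h := exp_neg_rpow_le (ε := ε) (a := 1 / 2) (m := 20) hL1 hlogC₅ (by linarith)
    rw [Real.exp_sub, Real.exp_log (by linarith [abs_nonneg C₅])] at h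
    calc |C₅| * Real.exp (-(1 / 2 * ε) * L ^ 4) ≤ |C₅| * (Real.exp (-(20 * L)) / (1 + |C₅|)) :=
          mul_le_mul_of_nonneg_left h (abs_nonneg _)
      _ = Real.exp (-(20 * L)) * (|C₅| / (1 + |C₅|)) := by ring
      _ ≤ Real.exp (-(20 * L)) * 1 := by
          refine mul_le_mul_of_nonneg_left ?_ (Real.exp_nonneg _)
          rw [div_le_one (by linarith [abs_nonneg C₅])]; linarith
      _ = Real.exp (-(20 * L)) := mul_one _
  have hT2 : |C₄| * (D : ℝ) ^ (-ε) ≤ Real.exp (-(40 * L)) := by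
    rw [hDpow, show -ε * L ^ 4 = -(1 * ε) * L ^ 4 by ring]
    have h := exp_neg_rpow_le (ε := ε) (a := 1) (m := 40) hL1 hlogC₄ (by linarith)
    rw [Real.exp_sub, Real.exp_log (by linarith [abs_nonneg C₄])] at h
    calc |C₄| * Real.exp (-(1 * ε) * L ^ 4) ≤ |C₄| * (Real.exp (-(40 * L)) / (1 + |C₄|)) :=
          mul_le_mul_of_nonneg_left h (abs_nonneg _)
      _ = Real.exp (-(40 * L)) * (|C₄| / (1 + |C₄|)) := by ring
      _ ≤ Real.exp (-(40 * L)) * 1 := by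
          refine mul_le_mul_of_nonneg_left ?_ (Real.exp_nonneg _)
          rw [div_le_one (by linarith [abs_nonneg C₄])]; linarith
      _ = Real.exp (-(40 * L)) := mul_one _
  have hT3 : (D : ℝ) ^ (-(2 * ε)) ≤ Real.exp (-(80 * L)) := by
    rw [hDpow, show -(2 * ε) * L ^ 4 = -(2 * ε) * L ^ 4 by ring]
    have h := exp_neg_rpow_le (ε := ε) (a := 2) (m := 80) (t := 0) hL1 le_rfl (by linarith)
    rwa [sub_zero] at h
  have hT4 : (D : ℝ) ^ (-(3 * ε / 4)) ≤ Real.exp (-(30 * L)) := by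
    rw [hDpow, show -(3 * ε / 4) * L ^ 4 = -(3 / 4 * ε) * L ^ 4 by ring]
    have h := exp_neg_rpow_le (ε := ε) (a := 3 / 4) (m := 30) (t := 0) hL1 le_rfl (by linarith)
    rwa [sub_zero] at h
  have hT5 : |C₄| * (D : ℝ) ^ (-(7 * ε / 8)) ≤ Real.exp (-(35 * L)) := by
    rw [hDpow, show -(7 * ε / 8) * L ^ 4 = -(7 / 8 * ε) * L ^ 4 by ring]
    have h := exp_neg_rpow_le (ε := ε) (a := 7 / 8) (m := 35) hL1 hlogC₄ (by linarith)
    rw [Real.exp_sub, Real.exp_log (by linarith [abs_nonneg C₄])] at h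
    calc |C₄| * Real.exp (-(7 / 8 * ε) * L ^ 4) ≤ |C₄| * (Real.exp (-(35 * L)) / (1 + |C₄|)) :=
          mul_le_mul_of_nonneg_left h (abs_nonneg _)
      _ = Real.exp (-(35 * L)) * (|C₄| / (1 + |C₄|)) := by ring
      _ ≤ Real.exp (-(35 * L)) * 1 := by
          refine mul_le_mul_of_nonneg_left ?_ (Real.exp_nonneg _)
          rw [div_le_one (by linarith [abs_nonneg C₄])]; linarith
      _ = Real.exp (-(35 * L)) := mul_one _
  have hT6 : (D : ℝ) ^ (-ε / 4) ≤ 1 / 8 := by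
    rw [hDpow, show -ε / 4 * L ^ 4 = -(1 / 4 * ε) * L ^ 4 by ring]
    have h := exp_neg_rpow_le (ε := ε) (a := 1 / 4) (m := 10) (t := 0) hL1 le_rfl (by linarith)
    rw [sub_zero] at h
    refine h.trans ?_
    have h9 : (9 : ℝ) ≤ Real.exp (10 * L) := by
      have := Real.add_one_le_exp (10 * L); linarith
    have hprod : Real.exp (-(10 * L)) * Real.exp (10 * L) = 1 := by
      rw [← Real.exp_add]; norm_num
    nlinarith [Real.exp_pos (-(10 * L))]
  have hL0 : 0 ≤ L := by linarith
  have hL3exp : L ^ 3 ≤ Real.exp (3 * L) := by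
    have := pow_le_exp_mul hL0 3; simpa using this
  have hL8exp : L ^ 8 ≤ Real.exp (8 * L) := by
    have := pow_le_exp_mul hL0 8; simpa using this
  have hlog2D : Real.log D ^ 2 = L ^ 8 := by rw [hlogD]; ring
  /- (1) the class number, the character, the class number formula -/
  set hK : ℝ := (NumberField.classNumber K : ℝ) with hhK
  have hh1 : 1 ≤ hK := by
    rw [hhK]; exact_mod_cast NumberField.classNumber_pos K
  have hh0 : 0 < hK := by linarith
  have hhL : hK ≤ L ^ 3 := by
    refine hh.trans (le_of_eq ?_)
    rw [hLdef, ← Real.rpow_natCast, ← Real.rpow_mul hlogD0]; norm_num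
  have hq : χ ^ 2 = 1 := MulChar.IsQuadratic.sq_eq_one hquad
  have hΔ : NumberField.discr K = -(D : ℤ) := by rw [← hKD]; omega
  have hne : χ ≠ 1 := by
    intro h1
    have h := hodd
    rw [DirichletCharacter.Odd, h1, MulChar.one_apply isUnit_one.neg] at h
    norm_num at h
  have hD5 : 5 ≤ D := le_trans (by norm_num) hD1024
  have hd4 : NumberField.discr K < -4 := by have := hD5; omega
  have hcnf := Quadratic.LFunction_one_eq_of_discr_neg_of_eq h2 hd hne (fun s hs => by
    rw [← DirichletCharacter.LFunction_eq_LSeries χ (show 1 < (s : ℂ).re by simpa using hs)]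
    exact Quadratic.dedekindZeta_eq_riemannZeta_mul_LFunction_of_odd_primitive hprim hquad hodd
      h2 hΔ (by simpa using hs))
  have hw : (NumberField.Units.torsionOrder K : ℝ) = 2 := by
    exact_mod_cast Quadratic.torsionOrder_eq_two_of_discr_lt_neg_four h2 hd4
  have habs : |(NumberField.discr K : ℝ)| = (D : ℝ) := by
    rw [← hKD, Nat.cast_natAbs, Int.cast_abs]
  have hL1cnf : χ.LFunction 1 =
      ((Real.pi * (NumberField.classNumber K : ℝ) / Real.sqrt D : ℝ) : ℂ) := by
    rw [hcnf, hw, habs, mul_assoc, mul_div_mul_left _ _ (two_ne_zero' ℝ)]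
  /- (2) the region and the parameters `σ, τ, y, N` -/
  have hs' := hs
  obtain ⟨-, hτ0', hτε, -⟩ := hs'
  set σ : ℝ := s.re with hσdef
  have hσ34ε : 3 / 4 + ε ≤ σ := by linarith
  have hσ34 : 3 / 4 ≤ σ := by linarith
  have hσ34' : 3 / 4 ≤ s.re := hσ34
  have hσpos : 0 < σ := by linarith
  set τ : ℝ := max (1 - s.re) ((D : ℝ) ^ (-ε / 4)) with hτdef
  have hστ : 1 - σ ≤ τ := le_max_left _ _
  have hτD : (D : ℝ) ^ (-ε / 4) ≤ τ := le_max_right _ _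
  have hτle : τ ≤ 1 / 4 - ε := max_le hτε (by linarith)
  have hDε0 : 0 < (D : ℝ) ^ (-ε / 4) := Real.rpow_pos_of_pos hD0r _
  have hτ0 : 0 < τ := lt_of_lt_of_le hDε0 hτD
  set y : ℝ := (D : ℝ) ^ ((1 / 2 - ε) / τ) with hydef
  set N : ℕ := ⌊y⌋₊ with hNdef
  have hexp2 : 2 ≤ (1 / 2 - ε) / τ := by rw [le_div_iff₀ hτ0]; linarith
  have hyD2 : (D : ℝ) ^ 2 ≤ y := by
    rw [hydef, show ((D : ℝ) ^ 2) = (D : ℝ) ^ (2 : ℝ) by norm_num]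
    exact Real.rpow_le_rpow_of_exponent_le hD1r hexp2
  have hN2 : D * D ≤ N := by
    refine Nat.le_floor ?_
    rw [show ((D * D : ℕ) : ℝ) = (D : ℝ) ^ 2 by push_cast; ring]
    exact hyD2
  have hDN : D ≤ N := le_trans (Nat.le_mul_self D) hN2
  have hNdivD : D ≤ N / D := (Nat.le_div_iff_mul_le hD0).mpr hN2
  /- (3) Lemma 5 -/
  have hL5' := hL5 D K h2 hd hKD hDD₅ hh χ hquad hprim hodd s hs
  set T : ℂ := ∑ n ∈ Ioc 0 N, (charDivisorSum χ n : ℂ) * (n : ℂ) ^ (-s) with hTdef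
  have hTeq : (∑ n ∈ Icc 1 N, (∑ d ∈ n.divisors, χ (d : ZMod D)) * (n : ℂ) ^ (-s)) = T := by
    rw [hTdef, show Icc 1 N = Ioc 0 N from rfl]
    exact Finset.sum_congr rfl fun n _ => by rw [sum_divisors_eq_charDivisorSum χ hq]
  rw [hTeq] at hL5'
  have hE5 : ‖T - χ.LFunction s * riemannZeta s‖ ≤ Real.exp (-(20 * L)) := by
    refine hL5'.trans (le_trans ?_ hT1)
    exact mul_le_mul_of_nonneg_right (le_abs_self _) (Real.rpow_nonneg hD0r.le _)
  /- (4) `R = ⌊(D/4)^{1/(2h)}⌋` -/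
  set ρ₀ : ℝ := ((D : ℝ) / 4) ^ (1 / (2 * hK)) with hρ₀def
  have hD4pos : (0 : ℝ) < (D : ℝ) / 4 := by positivity
  have hD4one : (1 : ℝ) ≤ (D : ℝ) / 4 := by linarith
  have hlog4 : Real.log 4 ≤ 2 := by
    have := Real.log_two_lt_d9
    rw [show (4 : ℝ) = 2 ^ 2 by norm_num, Real.log_pow]; push_cast; linarith
  have hρ₀ge : Real.exp (L / 2 - 1) ≤ ρ₀ := by
    rw [hρ₀def, Real.rpow_def_of_pos hD4pos, Real.log_div hD0r.ne' (by norm_num), hlogD,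
      Real.exp_le_exp, ← sub_nonneg]
    have hkey : (L ^ 4 - Real.log 4) * (1 / (2 * hK)) - (L / 2 - 1) =
        ((L ^ 4 - Real.log 4) - (L - 2) * hK) / (2 * hK) := by field_simp
    rw [hkey]
    refine div_nonneg ?_ (by positivity)
    have h1 : (L - 2) * hK ≤ (L - 2) * L ^ 3 := mul_le_mul_of_nonneg_left hhL (by linarith)
    nlinarith
  obtain ⟨hR1, hRbound⟩ := floor_root_bounds hρ₀ge hLfour
  set R : ℕ := ⌊ρ₀⌋₊ with hRdef
  have hρ₀0 : 0 ≤ ρ₀ := Real.rpow_nonneg hD4pos.le _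
  have hRsplit : ∀ p, p.Prime → reChar χ p = 1 → R < p := by
    intro p hp h1
    have hlt := root_lt_splitPrime χ h2 hd hKD hprim hquad hodd hp h1
    have hRle : (R : ℝ) ≤ ρ₀ := Nat.floor_le hρ₀0
    exact_mod_cast (hRle.trans_lt hlt)
  have hRN : R * R ≤ N / D := by
    refine le_trans ?_ hNdivD
    have hρhalf : ρ₀ ≤ ((D : ℝ) / 4) ^ (1 / 2 : ℝ) := by
      refine Real.rpow_le_rpow_of_exponent_le hD4one ?_
      rw [div_le_div_iff₀ (by positivity) (by norm_num)]; linarith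
    have hρsq : ρ₀ ^ 2 ≤ (D : ℝ) / 4 := by
      calc ρ₀ ^ 2 ≤ (((D : ℝ) / 4) ^ (1 / 2 : ℝ)) ^ 2 := pow_le_pow_left₀ hρ₀0 hρhalf 2
        _ = (D : ℝ) / 4 := by
            rw [← Real.sqrt_eq_rpow, Real.sq_sqrt hD4pos.le]
    have hRle : (R : ℝ) ≤ ρ₀ := Nat.floor_le hρ₀0
    have hR0 : (0 : ℝ) ≤ R := Nat.cast_nonneg R
    have hRR : (R : ℝ) * R ≤ ρ₀ ^ 2 := by
      rw [sq]; exact mul_le_mul hRle hRle hR0 hρ₀0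
    have hR2 : ((R * R : ℕ) : ℝ) ≤ (D : ℝ) := by
      push_cast; linarith
    exact_mod_cast hR2
  /- (5) Lemma 6: the chain (4.20)–(4.22) -/
  have hA := norm_sum_sub_zeta_mul_prod_le χ hq hσ34' hDN hR1 hRN hRsplit
  set PiD : ℝ := ∏ p ∈ D.primeFactors, (1 - (p : ℝ) ^ (-s.re))⁻¹ with hPiD
  set P : ℂ := ∏ p ∈ D.primeFactors, (1 + (p : ℂ) ^ (-s)) with hPdef
  set W : ℝ := (∑ a ∈ (Ioc 0 N).filter (fun a => ∀ p ∈ a.primeFactors, reChar χ p = 1),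
      charDivisorSum χ a * (a : ℝ) ^ (-s.re)) - 1 with hWdef
  -- the split primes `S₁`
  set Q := (N + 1).primesBelow.filter (fun p => reChar χ p = 1) with hQ
  have hQprime : ∀ p ∈ Q, p.Prime := fun p hp =>
    (Nat.mem_primesBelow.mp (Finset.mem_filter.mp hp).1).2
  set S₁ : ℝ := ∑ p ∈ Q, (p : ℝ) ^ (-σ) with hS₁
  have hS₁0 : 0 ≤ S₁ := Finset.sum_nonneg fun p _ => Real.rpow_nonneg (Nat.cast_nonneg p) _
  have hS₁le : S₁ ≤ 571 * Real.exp (-(3 * L / 16)) := by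
    have hsplit := sum_rpow_splitPrimes_le χ h2 hd hKD hprim hquad hodd (hL4 D hDD₄ χ hne) hL1cnf
      hε hε8 hD1024 hστ hσ34ε hτD hτle
    -- the three pieces
    have hsmall : hK * (4 / (D : ℝ)) ^ (σ / (2 * hK)) ≤ 560 * Real.exp (-(3 * L / 16)) :=
      smallTerm_le hh1 hhL hσ34 hL1 (le_trans (by norm_num) hD1024) hlogD
    have hmid : Real.sqrt (8 * Real.pi * hK * (D : ℝ) ^ (-(2 * ε)) +
        12 * |C₄| * ((D : ℝ) ^ (-ε) * Real.log D ^ 2)) ≤ 7 * Real.exp (-(3 * L / 16)) := by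
      have hπ := Real.pi_lt_d2
      have hπ0 := Real.pi_pos
      have h1 : 8 * Real.pi * hK * (D : ℝ) ^ (-(2 * ε)) ≤ 26 * Real.exp (-(32 * L)) := by
        calc 8 * Real.pi * hK * (D : ℝ) ^ (-(2 * ε)) ≤ 8 * Real.pi * Real.exp (3 * L) * Real.exp (-(80 * L)) :=
              mul_le_mul (mul_le_mul_of_nonneg_left (hhL.trans hL3exp) (by positivity)) hT3
                (Real.rpow_nonneg hD0r.le _) (by positivity)
          _ = 8 * Real.pi * Real.exp (-(77 * L)) := by
              rw [mul_assoc, ← Real.exp_add]; congr 2; ring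
          _ ≤ 26 * Real.exp (-(32 * L)) :=
              mul_le_mul (by linarith) (Real.exp_le_exp.mpr (by linarith)) (Real.exp_nonneg _)
                (by norm_num)
      have h2 : 12 * |C₄| * ((D : ℝ) ^ (-ε) * Real.log D ^ 2) ≤ 12 * Real.exp (-(32 * L)) := by
        rw [hlog2D]
        calc 12 * |C₄| * ((D : ℝ) ^ (-ε) * L ^ 8) = 12 * ((|C₄| * (D : ℝ) ^ (-ε)) * L ^ 8) := by ring
          _ ≤ 12 * (Real.exp (-(40 * L)) * Real.exp (8 * L)) := by
              refine mul_le_mul_of_nonneg_left (mul_le_mul hT2 hL8exp (by positivity)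
                (Real.exp_nonneg _)) (by norm_num)
          _ = 12 * Real.exp (-(32 * L)) := by rw [← Real.exp_add]; congr 2; ring
      have h3 : 8 * Real.pi * hK * (D : ℝ) ^ (-(2 * ε)) + 12 * |C₄| * ((D : ℝ) ^ (-ε) * Real.log D ^ 2) ≤
          49 * Real.exp (-(32 * L)) := by linarith [Real.exp_pos (-(32 * L))]
      have he2 : Real.exp (-(32 * L)) = Real.exp (-(16 * L)) ^ 2 := by
        rw [← Real.exp_nat_mul]; congr 1; push_cast; ring
      have hsq : Real.sqrt (49 * Real.exp (-(32 * L))) = 7 * Real.exp (-(16 * L)) := by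
        rw [show (49 : ℝ) * Real.exp (-(32 * L)) = (7 * Real.exp (-(16 * L))) ^ 2 by
          rw [mul_pow, ← he2]; norm_num, Real.sqrt_sq (by positivity)]
      calc Real.sqrt _ ≤ Real.sqrt (49 * Real.exp (-(32 * L))) := Real.sqrt_le_sqrt h3
        _ = 7 * Real.exp (-(16 * L)) := hsq
        _ ≤ 7 * Real.exp (-(3 * L / 16)) :=
            mul_le_mul_of_nonneg_left (Real.exp_le_exp.mpr (by linarith)) (by norm_num)
    have hbig : Real.pi * hK * (D : ℝ) ^ (-(3 * ε / 4)) / 2 +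
        3 / 2 * |C₄| * ((D : ℝ) ^ (-(7 * ε / 8)) * Real.log D ^ 2) ≤ 4 * Real.exp (-(3 * L / 16)) := by
      have hπ := Real.pi_lt_d2
      have hπ0 := Real.pi_pos
      have h1 : Real.pi * hK * (D : ℝ) ^ (-(3 * ε / 4)) / 2 ≤ 2 * Real.exp (-(27 * L)) := by
        calc Real.pi * hK * (D : ℝ) ^ (-(3 * ε / 4)) / 2
            ≤ Real.pi * Real.exp (3 * L) * Real.exp (-(30 * L)) / 2 := by
              gcongr
              · exact hhL.trans hL3exp
          _ = Real.pi / 2 * Real.exp (-(27 * L)) := by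
              rw [mul_assoc, ← Real.exp_add, show 3 * L + -(30 * L) = -(27 * L) by ring]; ring
          _ ≤ 2 * Real.exp (-(27 * L)) := mul_le_mul_of_nonneg_right (by linarith) (Real.exp_nonneg _)
      have h2 : 3 / 2 * |C₄| * ((D : ℝ) ^ (-(7 * ε / 8)) * Real.log D ^ 2) ≤ 2 * Real.exp (-(27 * L)) := by
        rw [hlog2D]
        calc 3 / 2 * |C₄| * ((D : ℝ) ^ (-(7 * ε / 8)) * L ^ 8)
            = 3 / 2 * ((|C₄| * (D : ℝ) ^ (-(7 * ε / 8))) * L ^ 8) := by ring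
          _ ≤ 3 / 2 * (Real.exp (-(35 * L)) * Real.exp (8 * L)) := by
              refine mul_le_mul_of_nonneg_left (mul_le_mul hT5 hL8exp (by positivity)
                (Real.exp_nonneg _)) (by norm_num)
          _ = 3 / 2 * Real.exp (-(27 * L)) := by rw [← Real.exp_add]; congr 2; ring
          _ ≤ 2 * Real.exp (-(27 * L)) := mul_le_mul_of_nonneg_right (by norm_num) (Real.exp_nonneg _)
      have h3 : Real.exp (-(27 * L)) ≤ Real.exp (-(3 * L / 16)) := Real.exp_le_exp.mpr (by linarith)
      linarith
    calc S₁ ≤ _ := hsplit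
      _ ≤ 560 * Real.exp (-(3 * L / 16)) + 7 * Real.exp (-(3 * L / 16)) + 4 * Real.exp (-(3 * L / 16)) :=
          add_le_add (add_le_add hsmall hmid) hbig
      _ = 571 * Real.exp (-(3 * L / 16)) := by ring
  obtain ⟨hnum1, hnum2⟩ := exp_numerics hL640
  have hS₁small : S₁ ≤ 1 / 10 := hS₁le.trans hnum1
  -- `W ≤ e^{5 S₁} − 1 ≤ 10 S₁`
  have hWle : W ≤ 10 * S₁ := by
    have h1 : W + 1 ≤ Real.exp (5 * S₁) := by
      rw [hWdef, sub_add_cancel]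
      exact (sum_split_le_prod χ hq hσpos N).trans (prod_inv_one_sub_sq_le_exp hQprime hσ34)
    have h2 := exp_sub_one_le_two_mul (by positivity : 0 ≤ 5 * S₁) (by linarith)
    linarith
  -- `Π_D ≤ e^{L/32}` by (4.25)
  have hΘ : ∑ p ∈ D.primeFactors, (p : ℝ) ^ (-(3 / 4) : ℝ) ≤ L / 80 :=
    sum_primeFactors_le_L hlogD hLbig
  have hPiD1 : 1 ≤ PiD := by
    have h : ∏ _p ∈ D.primeFactors, (1 : ℝ) ≤ ∏ p ∈ D.primeFactors, (1 - (p : ℝ) ^ (-s.re))⁻¹ := by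
      refine Finset.prod_le_prod (fun _ _ => zero_le_one) fun p hp => ?_
      obtain ⟨h0, h1⟩ := prime_rpow_neg_lt_one (Nat.prime_of_mem_primeFactors hp) hσpos
      rw [← one_div, le_div_iff₀ (by linarith)]; linarith
    rw [Finset.prod_const_one] at h
    rw [hPiD]; exact h
  have hPiDle : PiD ≤ Real.exp (L / 32) := by
    have h1 := prod_inv_one_sub_le_exp (fun p hp => Nat.prime_of_mem_primeFactors hp) hσ34'
      (P := D.primeFactors)
    refine h1.trans (Real.exp_le_exp.mpr ?_)
    have h2 : ∑ p ∈ D.primeFactors, (p : ℝ) ^ (-s.re) ≤ ∑ p ∈ D.primeFactors, (p : ℝ) ^ (-(3 / 4) : ℝ) := by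
      refine Finset.sum_le_sum fun p hp => ?_
      have hp1 : (1 : ℝ) ≤ p := by exact_mod_cast (Nat.prime_of_mem_primeFactors hp).one_lt.le
      exact Real.rpow_le_rpow_of_exponent_le hp1 (by linarith)
    linarith
  /- (6) `E = L(s)ζ(s) − ζ(2s) P` and `η = 3 Π_D ‖E‖ ≤ 51411 e^{−L/8} < 1` -/
  set E : ℂ := χ.LFunction s * riemannZeta s - riemannZeta (2 * s) * P with hEdef
  have hEle : ‖E‖ ≤ 17137 * PiD * Real.exp (-(3 * L / 16)) := by
    have h1 : ‖E‖ ≤ ‖T - χ.LFunction s * riemannZeta s‖ + ‖T - riemannZeta (2 * s) * P‖ := by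
      have : E = (T - riemannZeta (2 * s) * P) - (T - χ.LFunction s * riemannZeta s) := by
        rw [hEdef]; ring
      rw [this]
      exact (norm_sub_le _ _).trans (by linarith)
    have h2 : ‖T - riemannZeta (2 * s) * P‖ ≤ PiD * (3 * W + 2 / Real.sqrt R) := hA
    have h3 : PiD * (3 * W + 2 / Real.sqrt R) ≤ PiD * (30 * S₁ + 6 * Real.exp (-(L / 4))) :=
      mul_le_mul_of_nonneg_left (by linarith) (by linarith)
    have h4 : 30 * S₁ + 6 * Real.exp (-(L / 4)) ≤ 17136 * Real.exp (-(3 * L / 16)) := by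
      have : Real.exp (-(L / 4)) ≤ Real.exp (-(3 * L / 16)) := Real.exp_le_exp.mpr (by linarith)
      linarith
    have h5 : Real.exp (-(20 * L)) ≤ PiD * Real.exp (-(3 * L / 16)) := by
      calc Real.exp (-(20 * L)) ≤ Real.exp (-(3 * L / 16)) := Real.exp_le_exp.mpr (by linarith)
        _ = 1 * Real.exp (-(3 * L / 16)) := (one_mul _).symm
        _ ≤ PiD * Real.exp (-(3 * L / 16)) := mul_le_mul_of_nonneg_right hPiD1 (Real.exp_nonneg _)
    have h6 : PiD * (30 * S₁ + 6 * Real.exp (-(L / 4))) ≤ PiD * (17136 * Real.exp (-(3 * L / 16))) :=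
      mul_le_mul_of_nonneg_left h4 (by linarith)
    calc ‖E‖ ≤ Real.exp (-(20 * L)) + PiD * (30 * S₁ + 6 * Real.exp (-(L / 4))) := by
          linarith [hE5]
      _ ≤ PiD * Real.exp (-(3 * L / 16)) + PiD * (17136 * Real.exp (-(3 * L / 16))) := add_le_add h5 h6
      _ = 17137 * PiD * Real.exp (-(3 * L / 16)) := by ring
  have hη : 3 * PiD * ‖E‖ ≤ 51411 * Real.exp (-(L / 8)) := by
    have hsq : PiD * PiD ≤ Real.exp (L / 16) := by
      calc PiD * PiD ≤ Real.exp (L / 32) * Real.exp (L / 32) :=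
            mul_le_mul hPiDle hPiDle (by linarith) (Real.exp_nonneg _)
        _ = Real.exp (L / 16) := by rw [← Real.exp_add]; congr 1; ring
    calc 3 * PiD * ‖E‖ ≤ 3 * PiD * (17137 * PiD * Real.exp (-(3 * L / 16))) :=
          mul_le_mul_of_nonneg_left hEle (by linarith)
      _ = 51411 * (PiD * PiD) * Real.exp (-(3 * L / 16)) := by ring
      _ ≤ 51411 * Real.exp (L / 16) * Real.exp (-(3 * L / 16)) := by gcongr
      _ = 51411 * Real.exp (-(L / 8)) := by rw [mul_assoc, ← Real.exp_add]; congr 2; ring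
  have hη1 : 3 * PiD * ‖E‖ < 1 := lt_of_le_of_lt hη hnum2
  /- (7) §5: the conclusions -/
  -- `‖ζ(2s) P‖ ≥ P₀/3`, `P₀ = ∏(1 − p^{−σ}) = Π_D⁻¹`
  set P₀ : ℝ := ∏ p ∈ D.primeFactors, (1 - (p : ℝ) ^ (-s.re)) with hP₀def
  have hP₀pos : 0 < P₀ := by
    rw [hP₀def]
    refine Finset.prod_pos fun p hp => ?_
    have := (prime_rpow_neg_lt_one (Nat.prime_of_mem_primeFactors hp) hσpos).2
    linarith
  have hP₀Pi : P₀ * PiD = 1 := by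
    rw [hP₀def, hPiD, Finset.prod_inv_distrib, mul_inv_cancel₀ hP₀pos.ne']
  have hPnorm : P₀ ≤ ‖P‖ := (prod_one_sub_le_norm_prod s hσpos).1
  have hζ2 : 1 / 3 ≤ ‖riemannZeta (2 * s)‖ := norm_zeta_two_mul_ge hσ34'
  have hmain_ge : P₀ / 3 ≤ ‖riemannZeta (2 * s) * P‖ := by
    rw [norm_mul]
    calc P₀ / 3 = 1 / 3 * P₀ := by ring
      _ ≤ ‖riemannZeta (2 * s)‖ * ‖P‖ := mul_le_mul hζ2 hPnorm hP₀pos.le (norm_nonneg _)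
  have hEsmall : ‖E‖ < P₀ / 3 := by
    have h1 : ‖E‖ = (3 * PiD * ‖E‖) * (P₀ / 3) := by
      have : PiD * P₀ = 1 := by rw [mul_comm]; exact hP₀Pi
      calc ‖E‖ = (PiD * P₀) * ‖E‖ := by rw [this, one_mul]
        _ = (3 * PiD * ‖E‖) * (P₀ / 3) := by ring
    rw [h1]
    calc (3 * PiD * ‖E‖) * (P₀ / 3) < 1 * (P₀ / 3) := mul_lt_mul_of_pos_right hη1 (by positivity)
      _ = P₀ / 3 := one_mul _
  have hζne : riemannZeta s ≠ 0 := by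
    intro h0
    have : E = -(riemannZeta (2 * s) * P) := by rw [hEdef, h0, mul_zero, zero_sub]
    rw [this, norm_neg] at hEsmall
    linarith
  have hLne : χ.LFunction s ≠ 0 := by
    intro h0
    have : E = -(riemannZeta (2 * s) * P) := by rw [hEdef, h0, zero_mul, zero_sub]
    rw [this, norm_neg] at hEsmall
    linarith
  refine ⟨hLne, hζne, ?_⟩
  -- `L(s) − M(s) = E/ζ(s)` and `‖M(s)‖ = ‖ζ(2s)P‖/‖ζ(s)‖`
  have hζpos : 0 < ‖riemannZeta s‖ := norm_pos_iff.mpr hζne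
  have hM : BellottiPuglisi2023.mainTerm D s = riemannZeta (2 * s) * P / riemannZeta s := by
    rw [BellottiPuglisi2023.mainTerm, hPdef]; ring
  have hdiff : χ.LFunction s - BellottiPuglisi2023.mainTerm D s = E / riemannZeta s := by
    rw [hM, hEdef]; field_simp
  have hnormM : ‖BellottiPuglisi2023.mainTerm D s‖ = ‖riemannZeta (2 * s) * P‖ / ‖riemannZeta s‖ := by
    rw [hM, norm_div]
  rw [hdiff, norm_div, hnormM]
  have hexp_eq : Real.exp (-(1 / 8) * L) = Real.exp (-(L / 8)) := by congr 1; ring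
  rw [hexp_eq]
  -- `‖E‖ ≤ ‖ζ(2s)P‖ · 52000 e^{−L/8}`
  have hE_le : ‖E‖ ≤ ‖riemannZeta (2 * s) * P‖ * 52000 * Real.exp (-(L / 8)) := by
    have h1 : ‖E‖ = (3 * PiD * ‖E‖) * (P₀ / 3) := by
      have : PiD * P₀ = 1 := by rw [mul_comm]; exact hP₀Pi
      calc ‖E‖ = (PiD * P₀) * ‖E‖ := by rw [this, one_mul]
        _ = (3 * PiD * ‖E‖) * (P₀ / 3) := by ring
    rw [h1]
    calc (3 * PiD * ‖E‖) * (P₀ / 3) ≤ (51411 * Real.exp (-(L / 8))) * ‖riemannZeta (2 * s) * P‖ :=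
          mul_le_mul hη hmain_ge (by positivity) (by positivity)
      _ ≤ (52000 * Real.exp (-(L / 8))) * ‖riemannZeta (2 * s) * P‖ := by
          gcongr; norm_num
      _ = ‖riemannZeta (2 * s) * P‖ * 52000 * Real.exp (-(L / 8)) := by ring
  calc ‖E‖ / ‖riemannZeta s‖
      ≤ (‖riemannZeta (2 * s) * P‖ * 52000 * Real.exp (-(L / 8))) / ‖riemannZeta s‖ :=
        div_le_div_of_nonneg_right hE_le hζpos.le
    _ = ‖riemannZeta (2 * s) * P‖ / ‖riemannZeta s‖ * 52000 * Real.exp (-(L / 8)) := by ring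

/-- **Pintz 1976 (III), Theorem 2 — the named fact `pintz1976Deuring_theorem2`, DISCHARGED.** For
`0 < ε < 1/8` there are `C` (here `52000`) and an effective `D₁(ε)` such that for every imaginary
quadratic field `K` with `D = |d_K| > D₁` and `h_K ≤ log^{3/4}D`, the odd real primitive character
`χ` mod `D`, and `s ∈ H(ε, D)`: `L(s, χ) ≠ 0`, `ζ(s) ≠ 0`, and
`‖L(s, χ) − M(s)‖ ≤ ‖M(s)‖ · C · exp(−⅛ log^{1/4}D)`, `M(s) = (ζ(2s)/ζ(s))∏_{p∣D}(1 + p^{−s})`.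
[cite: Pintz1976ElementaryIII, Theorem 2 pp. 296–297 (1.7)–(1.9); proof §§3–5 pp. 298–306] -/
theorem _root_.Literature.NumberTheory.LFunctions.pintz1976Deuring_theorem2_holds :
    pintz1976Deuring_theorem2 := by
  intro ε hε hε8
  obtain ⟨C, D₁, hD₁⟩ := theorem2_aux hε hε8
  exact ⟨C, D₁, fun K _ _ _ h2 hd hD hh χ hquad hprim hodd s hs =>
    hD₁ _ K h2 hd rfl hD hh χ hquad hprim hodd s hs⟩

end TheoremTwo

end Pintz1976Deuring

end Literature.NumberTheory.LFunctions

end
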